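/-
Copyright: cell `langlands-arthur-audit` (papers/Langlands/langlands-arthur-audit), unit `pub-arthur-down-g38`
(downstream tracer, gen 38).  Twelfth file of the exact-support certificates of the downstream register (module M218 of the cell's MODULE-MAP — CLAIMed in
`lean/MODULE-MAP2.md` 2026-08-22T16:03:25Z): `DownstreamSupport.lean` … `DownstreamSupport10.lean` are full or CLOSED and `DownstreamSupport11.lean` (sections
92–98, module M208, ≈ 87 % of the proposal cap after v7) is CLOSED for sections; the supports of the register from tranche 96 on (`Downstream29.lean` v1 ff.) start
here, APPEND-ONLY in the same conventions and the same namespace `…Arthur2013.Downstream.Support`; this file imports `…DownstreamSupport11` (through it every earlier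
support file and the canonical readings `canon`, `νtop`, `μtop`, `κtop`, `κnoMok`, `bookInputs_top`, `not_B_cm`, the denied reading `c₁noA4` of section 95, the
countermodel lemmas) and `…Downstream29`; v1 = section 99, the supports of the ninety-sixth tranche (NEW `Downstream29.lean` v1, this unit: census row E29 re-graded
and typed as row C241 Hsieh – Palvannan arXiv:2505.09975 — `HsPclass` (Proposition 3.2 with §3.2) ⇐ book ∧ A4 `Consumers.GeeTaibi`, `HsPmain` (the three theorems
of the introduction) ⇐ `HsPclass`; `canon₉₆W`, `canon₉₆`, `canon_implications₉₆W`, `canon_implications₉₆`, `c96_all_of`, `ninetysixth_holds_top`, `c96_book_cm`,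
`c96_A4_denied_top`, `c96_unitary_independent`, `c96_regraded`); v2 (unit `pub-arthur-down-g39`, gen 39) = section 100, the supports of the ninety-seventh tranche
(`Downstream29.lean` v2: NEW rows C242 Zheng Liu arXiv:2308.08533 — `ZLpadic` ⇐ book ∧ A4 — and C243 Wei – Yi, IJNT 2026 = arXiv:2207.13234 — `WYlevel` ⇐ row C180
`Consumers19.SchmidtParamodular`, `WYtwo` ⇐ row C49 `Consumers21.RSYCount`; `canon₉₇W`, `canon₉₇`, `canon_implications₉₇W`, `canon_implications₉₇`, `c97_all_of`,
`ninetyseventh_holds_top`, `c97_book_cm`, `c97_denied_top`, `c97_unitary_independent`, `c97_regraded`; no new import — `canon₁₉`, `canon₂₀`, `canon₂₁` and the denied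
readings of sections 25 / 26 / 95 come through `…DownstreamSupport11`); v3 (same unit) = section 101, the supports of the ninety-eighth tranche (`Downstream29.lean` v3:
NEW rows C244 Dummigan – Pacetti – Rama – Tornaría, Math. Comp. 93 (2024) = arXiv:2112.03797 — `DPRTjl` ⇐ row C182 `Consumers20.SchmidtCAP`, `DPRTcong` ⇐ `DPRTjl` —,
C245 Ibukiyama, J. Math. Soc. Japan 78 (2026) = arXiv:2208.13578 — `IbuCompact` premise-free, `IbuParamodular` ⇐ `IbuCompact` ∧ `DPRTjl` ∧ row C90 `Consumers28.VanHoften`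
∧ row C49 `Consumers21.RSYCount` ∧ C182 ∧ C180 — and C246 Loeffler – Zerbes arXiv:2011.15064 — `LZ3padicL` ⇐ book ∧ A4 ∧ row C87 `Consumers29.LPSZ` —; `canon₉₈W`,
`canon₉₈`, `canon_implications₉₈W`, `canon_implications₉₈`, `c98_all_of`, `ninetyeighth_holds_top`, `c98_book_cm`, the denied readings `canon₉₈noC182` / `canon₉₈noC90` /
`canon₉₈noC49` / `canon₉₈noC180` / `canon₉₈noC87` / `canon₉₈noA4`, `c98_denied_top`, `c98_unitary_independent`, `c98_regraded`; no new import — `canon₂₈`, `canon₂₉`,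
`c₂₈noC90`, `canon₂₉noC87`, `canon₂₀noCAP`, `canon₂₁noC182` come through `…DownstreamSupport11`); v4 (same unit) = section 102, the supports of the ninety-ninth tranche
(`Downstream29.lean` v4: NEW rows C247 Bergström – Cléry arXiv:2309.04388 — `BCisotypic` ⇐ book ∧ row C180 ∧ row C184 `Consumers22.RSYLevel4` — and C248 Pitale – Saha –
Schmidt, Ann. Math. Québec 45 (2021) — `PSSdeg5` ⇐ book ∧ C180, `PSSsym4` ⇐ `PSSdeg5` —; `canon₉₉W`, `canon₉₉`, `canon_implications₉₉W`, `canon_implications₉₉`,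
`c99_all_of`, `ninetyninth_holds_top`, `c99_book_cm`, `canon₉₉noC180`, `canon₉₉noC184`, `c99_denied_top`, `c99_unitary_independent`, `c99_regraded`; no new import —
`canon₂₂` / `canon₂₂no` of section 26 come through `…DownstreamSupport11`); v5 (same unit) = section 103, the supports of the hundredth tranche (NEW `Downstream30.lean`
v1, module M220 — hence the new import `…Downstream30`: NEW rows C249 Dummigan – Tornaría, Res. Number Theory 12 (2026) — `DTresidual` ⇐ row C244 `Consumers98.DPRTjl` —,
C250 Ray – Roy – Yi, Ramanujan J. (2021) — `RRYcong` ⇐ row C49 `Consumers21.RSYCount` — and C251 Dang arXiv:2608.14145 — `DangRB` ⇐ book ∧ row C90 ∧ C244 ∧ row C180 —;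
`canon₁₀₀W`, `canon₁₀₀`, `canon_implications₁₀₀W`, `canon_implications₁₀₀`, `c100_all_of`, `hundredth_holds_top`, `c100_book_cm`, `canon₁₀₀noC182` / `canon₁₀₀noC49` /
`canon₁₀₀noC90` / `canon₁₀₀noC180`, `c100_denied_top`, `c100_unitary_independent`, `c100_regraded`); v6 (same unit) = section 104, the supports of the hundred-and-first
tranche (`Downstream30.lean` v2: NEW rows C252 Waibel, Q. J. Math. 2019 — `WaibelMoment` ⇐ C180 —, C253 Calegari – Chidambaram – Ghitza, Math. Comp. 89 (2020) — `CCGmodular` ⇐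
row C9 `Consumers.BCGP` — and C254 Gu arXiv:2512.04732 — `GuK3` ⇐ C9 —; `canon₁₀₁W`, `canon₁₀₁`, `canon_implications₁₀₁W`, `canon_implications₁₀₁`, `c101_all_of`,
`hundredfirst_holds_top`, `c101_book_cm`, `c₁noC9`, `c101_denied_top`, `c101_unitary_independent`, `c101_regraded`; no new import); v7 (unit `pub-arthur-down-g40`,
gen 40) = section 105, the supports of the hundred-and-second tranche (`Downstream30.lean` v3: NEW rows C256 N. Taylor, Trans. Amer. Math. Soc. 373 (2020) —
`NTaylorTraces` ⇐ C9 ∧ row A4 `Consumers.GeeTaibi` — and C257 Calegari – Chidambaram – Roberts, Open Book Series 4 (2020) — `CCRfamilies` ⇐ C9 —; `canon₁₀₂W`,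
`canon₁₀₂`, `canon_implications₁₀₂W`, `canon_implications₁₀₂`, `c102_all_of`, `hundredsecond_holds_top`, `c102_book_cm`, `c102_denied_top` (over `c₁noC9` of section 104
and `c₁noA4` of section 95), `c102_unitary_independent`, `c102_regraded`; no new import); v8 (same unit) = section 106, the supports of the hundred-and-third tranche
(`Downstream30.lean` v4: NEW rows C258 Chiriac – Jorza, Trans. AMS 372 (2019) — `CJdensity` ⇐ C9 —, C259 Calegari – Geraghty – Harris arXiv:1907.08694 — `CGHselmer` ⇐ row
C34 `Consumers64.CalegariGeraghtyGSp4` ∧ C9 —, C260 Li – Zhang, Essential Number Theory 1 (2022) — `LZtateII` ⇐ C9 — and C261 Nemoto – Yamauchi arXiv:2512.24607 —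
`NYregulator` ⇐ C9 —; `canon₁₀₃W`, `canon₁₀₃`, `canon_implications₁₀₃W`, `canon_implications₁₀₃`, `c103_all_of`, `hundredthird_holds_top`, `c103_book_cm`, `c₆₄noC34`,
`c103_denied_top` (over `c₁noC9` of section 104 and `c₆₄noC34`), `c103_unitary_independent`, `c103_regraded`; no new import — `canon₆₄` / `canon_implications₆₄` of section 64
and `canon_implications₂₈` come through `…DownstreamSupport11`); v9 (same unit) = section 107, the supports of the hundred-and-fourth tranche (NEW `Downstream31.lean` v1,
module M223 — hence the new import `…Downstream31`: NEW rows C262 Katsurada arXiv:2106.10873 — `KatsuradaMult1` ⇐ row C5 `Consumers.ChenevierLannesStar` ∧ row B1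
`Consumers.AMR`, `KatsuradaDenom` ⇐ it —, C263 Ibukiyama – Katsurada – Kojima, J. Number Theory 269 (2025) — `IKKperiod` ⇐ B1 ∧ C5 —, a NEW node `FMtempered` on the
existing row C226 (Furusawa – Morimoto, Compositio 2024, Cor. 8.1 ⇐ the book by name) and C264 Pitale – Saha – Schmidt arXiv:2302.05148 — `PSSsup` ⇐ `FMtempered` —;
`PSSbessel` ⇐ C226's `Consumers89.FMrefined` ∧ `FMtempered` —; `canon₁₀₄W`, `canon₁₀₄`, `canon_implications₁₀₄W`, `canon_implications₁₀₄`, `c104_all_of`,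
`hundredfourth_holds_top`, `c104_book_cm`, `c₁noC5`, `c104_denied_top` (over `c₁noC5` and `c₁noB1` of section 98), `c104_mok_cm`, `c104_kmsw`, `c104_regraded`);
v10 (unit `pub-arthur-down-g42`, gen 42) = QUOTE HYGIENE ONLY (referee G-REF-g179-2; no declaration, statement or proof touched): the four census labels that v2 – v4 printed
in guillemets are re-marked ‘…’, and five guillemet spans that were glyph- or whitespace-normalised renderings of PDF-extracted sentences are replaced by their exact staged
forms; every « … » span of the file is now an asserted verbatim (whitespace-normalised) substring of a page staged under `HOME/pub-arthur-down-g*/primaries*`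
(generator `HOME/pub-arthur-down-g42/tree/gen_hygiene42b.py`).
-/
import HarnessLib
import Literature.NumberTheory.Automorphic.Arthur2013.DownstreamSupport11
import Literature.NumberTheory.Automorphic.Arthur2013.Downstream29
import Literature.NumberTheory.Automorphic.Arthur2013.Downstream30
import Literature.NumberTheory.Automorphic.Arthur2013.Downstream31

/-!
# Downstream of Arthur (2013): exact leaf support of the downstream register, twelfth file (sections ≥ 99)

**Source reproduced.**  Nothing beyond what `Downstream.lean` … `Downstream29.lean` transcribe (the downstream
authors' own sentences, cited there chunk by chunk) and what the three leaf-support modules certify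
(`Arthur2013/LeafSupport.lean`, `Mok2015/LeafSupport.lean`, `KMSW2014/LeafSupport.lean`: for every leaf a
kernel-checked countermodel of the DAG as typed).  As in the first eleven files: a CANONICAL READING assigns to each
typed downstream statement the conjunction of DAG outputs its edge receives, the tranche's edges are shown to hold in
that reading for arbitrary node assignments, and the countermodels then give the « only if » half of each support —
which leaves are load-bearing for which downstream theorem, in the register AS TYPED (a statement about the cell's
transcription, not about the mathematics).  [cite: Arthur2013, §1.5 with AGIKMS2024 l.380-382 (the conditional
reading whose supports are certified)]

**v1 (section 99; unit `pub-arthur-down-g38`, gen 38).**  The ninety-sixth tranche (NEW `Downstream29.lean` v1, module M217) re-grades census row E29 `[g5b]` (M.-L.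
Hsieh – B. Palvannan, *On the congruence ideal associated to p-adic families of Yoshida lifts*, arXiv:2505.09975, 2025; census-only since 2026-08-18 on the strength of
the authors' Arthur-free alternative for the existence of Yoshida lifts, « (or utilising the representation theoretic approach of Roberts [MR1871665]) ») as typed row
C241: `HsPclass` = Proposition 3.2 (tempered ⇒ stable or of Yoshida type; types (c)–(f) non-tempered — « In view of the classification [Gee19] ») with §3.2's existence
and exhaustion of Yoshida-type Π (« By Arthur's multiplicity formula as established in [Gee19] ») ⇐ book ∧ row A4; `HsPmain` = the three theorems of the introduction
(the p-adic family and uniqueness of the GSp_4 Hida family through a Yoshida lift; Div(Sel^Σ0(ℚ)^∨) ≥ Div(𝒞); pseudo-cyclicity) ⇐ `HsPclass` (Theorem 3.9's proof « By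
Proposition (P:32) »).  Certified with ONE reading `canon₉₆W ν c` parametrised by the assignment of tranche 1 (both statements := book ∧ `c.GeeTaibi`), whose edges hold
for every ν and every such assignment (`canon_implications₉₆W`), and its canonical instance `canon₉₆ ν μ κ` (`canon_implications₉₆`): at the top both statements hold
(`ninetysixth_holds_top`, through the tranche's `ninetysixth_of_leaves`); in each of the 24 book countermodels (tranches 1 / 96 read canonically over it, all their
edges valid) BOTH FAIL (`c96_book_cm`: every book leaf is load-bearing, by name and through A4); at the top with row A4 denied (`c₁noA4` of section 95) BOTH FAIL while
the tranche-96 edges hold over the denied assignment (`c96_A4_denied_top`); in every Mok countermodel (KMSW = `κnoMok`) and every KMSW countermodel, the book at the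
top, BOTH HOLD (`c96_unitary_independent`).  In one statement (`c96_regraded`): support(`HsPclass`) = support(`HsPmain`) = book 24 (directly and through A4); Mok ∩
support = KMSW ∩ support = ∅ — the same support as row C239 (Pilloni 2020) and as C238's `HPpacket`: the 2025 congruence-ideal / Selmer-group theorems for Yoshida
families inherit exactly the book's open leaves (the 2024–2026 preprint layer and the two weighted fundamental lemmas), the Roberts alternative notwithstanding
(it covers the existence sentence, not Proposition 3.2).

**v2 (section 100; unit `pub-arthur-down-g39`, gen 39).**  The ninety-seventh tranche (`Downstream29.lean` v2, which now also imports `…Downstream4`) types two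
‘peripheral (conduit cited; no invocation needle ≥ 3)’ rows of `DOWNSTREAM.md` §I.6 opened at the cited theorem (GAPS G-DN-423 (b) / G-DN-426): NEW row C242 Zheng Liu,
*p-adic L-functions for GSp(4) × GL(2)*, arXiv:2308.08533 (2023; `ZLpadic` = Theorem 1.0.1 = Theorem 4.2.1 with Proposition 4.2.2 ⇐ book ([Art04]) ∧ row A4 ([GT19]:
« ¯Π = Π ⊗ω−1 Π ◦ν » [= Π̄ = Π ⊗ ω_Π⁻¹ ∘ ν] and « the transfer of Π to GL(5) [ GT19, Theorem 8.1.2] »)) and NEW row C243 Z. Wei – S. Yi, *On distinguishing Siegel cusp forms of degree two*,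
IJNT 2026 (to appear) = arXiv:2207.13234 v3 (`WYlevel` = Theorem 1.1 with Theorem 3.1 / Lemma 3.2 ⇐ row C180 `Consumers19.SchmidtParamodular` (« [Sch18, Table 1] » and
the uncited type-(G) transfer to GL(4)); `WYtwo` = Theorem 1.2 with Corollary 4.1 ⇐ row C49 `Consumers21.RSYCount` (« [RSY21, Theorem 3.1] » ×3)).  Certified with ONE
reading `canon₉₇W ν c c₁₉ c₂₁` parametrised by the assignments of tranches 1 / 19 / 21 (C242 := book ∧ `c.GeeTaibi`; C243's Theorem 1.1 := `c₁₉.SchmidtParamodular`,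
its Theorem 1.2 := `c₂₁.RSYCount`), whose edges hold for every ν and every such assignment (`canon_implications₉₇W`), and its canonical instance `canon₉₇ ν μ κ`
(`canon_implications₉₇`): at the top all three statements hold (`ninetyseventh_holds_top`, through the tranche's `ninetyseventh_of_leaves`); in each of the 24 book
countermodels (tranches 1 / 19 / 20 / 21 / 97 read canonically over it, ALL their edges valid) ALL THREE FAIL (`c97_book_cm`: every book leaf is load-bearing — by name
and through A4 for C242, through C180 for C243's Theorem 1.1, through C49 ⇐ book ∧ C182 for its Theorem 1.2); with one premise denied at the top (`c97_denied_top`): A4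
denied (`c₁noA4` of section 95) ⇒ `ZLpadic` FAILS, both C243 statements HOLD; C180 denied (`c₁₉noConduit`, with `canon₂₀free` / `canon₂₁noC180` of section 25: C182 and
C49 free-standing) ⇒ `WYlevel` FAILS, `WYtwo` and `ZLpadic` HOLD; C49 alone denied (`canon₂₁noC49` of section 26) ⇒ `WYtwo` FAILS, `WYlevel` and `ZLpadic` HOLD; in every
Mok countermodel (KMSW = `κnoMok`) and every KMSW countermodel, the book at the top, ALL THREE HOLD (`c97_unitary_independent`).  In one statement (`c97_regraded`):
support(`ZLpadic`) = support(`WYlevel`) = support(`WYtwo`) = book 24 (through A4; through C180; through C49 / C182 / C180); Mok ∩ support = KMSW ∩ support = ∅ — the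
same support as rows C237 – C241: a 2023 p-adic L-function and a 2026 multiplicity / distinguishing theorem whose texts never name the classification as a hypothesis
(C243 never names Arthur at all) inherit exactly the book's open leaves (the 2024–2026 preprint layer and the two weighted fundamental lemmas).

**v3 (section 101; unit `pub-arthur-down-g39`, gen 39).**  The ninety-eighth tranche (`Downstream29.lean` v3, which now also imports `…Downstream6`) types THE
QUINARY / PARAMODULAR LINE and one more p-adic row, found among the ‘peripheral (conduit cited; no invocation needle ≥ 3)’ rows of `DOWNSTREAM.md` §I.6 opened at the
cited theorem (GAPS G-DN-428 / G-DN-430): NEW row C244 N. Dummigan – A. Pacetti – G. Rama – G. Tornaría, *Quinary forms and paramodular forms*, Math. Comp. 93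
(2024) = arXiv:2112.03797 (`DPRTjl` = Theorems 9.6 / 9.8 / 10.1 ⇐ row C182 `Consumers20.SchmidtCAP` (« By [ Sch20, Proposition 5.1] »); `DPRTcong` = Theorems 11.2 – 11.8 ⇐ `DPRTjl`),
NEW row C245 T. Ibukiyama, *Dimensions of paramodular forms and compact twist modular forms with involutions*, J. Math. Soc. Japan 78 (2026) = arXiv:2208.13578 v2
(`IbuCompact` = Theorem 2.1, premise-free; `IbuParamodular` = Theorem 2.2 ⇐ `IbuCompact` ∧ `DPRTjl` ∧ row C90 `Consumers28.VanHoften` ∧ row C49 `Consumers21.RSYCount` ∧ C182 ∧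
row C180 `Consumers19.SchmidtParamodular`) and NEW row C246 D. Loeffler – S. L. Zerbes, arXiv:2011.15064 (PREPRINT; `LZ3padicL` = Theorem 5.5.1 ⇐ book ∧ row A4 ∧ row C87
`Consumers29.LPSZ`).  Certified with ONE reading `canon₉₈W ν c c₁₉ c₂₀ c₂₁ c₂₈ c₂₉` parametrised by the assignments of tranches 1 / 19 / 20 / 21 / 28 / 29 (C244 :=
`c₂₀.SchmidtCAP` (both fields); C245's Theorem 2.1 := `True`, its Theorem 2.2 := the conjunction of its five typed premises; C246 := (book ∧ `c.GeeTaibi`) ∧ `c₂₉.LPSZ`),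
whose edges hold for every ν and every such assignment (`canon_implications₉₈W`), and its canonical instance `canon₉₈ ν μ κ` (`canon_implications₉₈`): at the top all five
statements hold (`ninetyeighth_holds_top`, through the tranche's `ninetyeighth_of_leaves`); in each of the 24 book countermodels (tranches 1 / 19 / 20 / 21 / 28 / 29 / 98
read canonically over it, ALL their edges valid) the four Arthur-dependent statements FAIL and the control `IbuCompact` HOLDS (`c98_book_cm`: every book leaf is
load-bearing — through C182 ⇐ book ∧ C180 for C244, through C90 / C49 / C182 / C180 / C244 for C245's Theorem 2.2, by name (« [arthur04,geetaibi18] ») and through A4 and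
C87 for C246); with one premise denied at the top (`c98_denied_top`, over the named readings `canon₉₈noC182`, `canon₉₈noC90`, `canon₉₈noC49`, `canon₉₈noC180`,
`canon₉₈noC87`, `canon₉₈noA4`): C182 denied (`canon₂₀noCAP` / `canon₂₁noC182` of section 25: C49 falls with it) ⇒ BOTH C244 fields and C245's Theorem 2.2 FAIL, C246
HOLDS; C90 alone denied (`c₂₈noC90` of section 97) ⇒ only C245's Theorem 2.2 FAILS; C49 alone denied (`canon₂₁noC49` of section 26) ⇒ only C245's Theorem 2.2 FAILS; C180
denied with C182 and C49 free-standing (`c₁₉noConduit` / `canon₂₀free` / `canon₂₁noC180` of section 25) ⇒ C245's Theorem 2.2 FAILS, C244 HOLDS free-standing, C246 HOLDS;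
C87 denied (`canon₂₉noC87` of section 37) ⇒ only C246 FAILS; A4 denied at the reading level (`c₁noA4` of section 95; C90 read canonically, i.e. free-standing over it) ⇒ only
C246 FAILS; in every Mok countermodel (KMSW = `κnoMok`) and every KMSW countermodel, the book at the top, ALL FIVE HOLD (`c98_unitary_independent`).  In one statement
(`c98_regraded`): support(`DPRTjl`) = support(`DPRTcong`) = support(`IbuParamodular`) = support(`LZ3padicL`) = book 24 (through C182 / C180; through C90 / C49 / C182 /
C180 / C244; through A4 / C87); support(`IbuCompact`) = ∅; Mok ∩ support = KMSW ∩ support = ∅ — a 2024 Math. Comp. isomorphism with its congruences, a 2026 JMSJ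
dimension formula whose text never names Arthur, and a 2020/21 p-adic L-function inherit exactly the book's open leaves (the 2024–2026 preprint layer and the two
weighted fundamental lemmas).

**v4 (section 102; unit `pub-arthur-down-g39`, gen 39).**  The ninety-ninth tranche (`Downstream29.lean` v4) types two more ‘peripheral’ rows of the C180-citer
table of `DOWNSTREAM.md` §I.6, the second CORRECTING v3's census note (GAPS G-DN-433): NEW row C247 J. Bergström – F. Cléry, *Dimension formulas for spaces of vector-valued
Siegel modular forms of degree two and level two*, arXiv:2309.04388 v2 (to appear in Publ. Mat.; `BCisotypic` = the refinement by Arthur type of the S_6-isotypical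
decompositions of S_{k,j}(Γ[2]) with Theorem 5.3 ⇐ book ([2]) ∧ row C180 ([24, §2.1]) ∧ row C184 `Consumers22.RSYLevel4` ([23, Prop. 4.3])) and NEW row C248 A. Pitale –
A. Saha – R. Schmidt, Ann. Math. Québec 45 (2021) = arXiv:1803.06227 (`PSSdeg5` = Theorem 1.1 / 7.4 ⇐ book ∧ C180 (« [arthur-book, ralf-packets] »); `PSSsym4` = Theorem 1.5 /
7.9 ⇐ `PSSdeg5`).  Certified with ONE reading `canon₉₉W ν c₁₉ c₂₂` (C247 := book ∧ `c₁₉.SchmidtParamodular` ∧ `c₂₂.RSYLevel4`; both C248 fields := book ∧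
`c₁₉.SchmidtParamodular`), whose edges hold for every ν and every assignment (`canon_implications₉₉W`), and its canonical instance `canon₉₉ ν μ κ` (`canon_implications₉₉`):
at the top all three hold (`ninetyninth_holds_top`, through the tranche's `ninetyninth_of_leaves`); in each of the 24 book countermodels (tranches 19 / 20 / 21 / 22 / 99 read
canonically over it, ALL their edges valid) ALL THREE FAIL (`c99_book_cm`: every book leaf is load-bearing — by name and through C180 / C184 for C247, by name and through C180
for C248); with one premise denied at the top (`c99_denied_top`, over `canon₉₉noC180` / `canon₉₉noC184`): C180 denied with C184 free-standing (`c₁₉noConduit` of section 25,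
`canon₂₂` at the top) ⇒ ALL THREE FAIL; C184 alone denied (`canon₂₂no` of section 26) ⇒ only C247 FAILS; in every Mok countermodel (KMSW = `κnoMok`) and every KMSW
countermodel, the book at the top, ALL THREE HOLD (`c99_unitary_independent`).  In one statement (`c99_regraded`): support(`BCisotypic`) = support(`PSSdeg5`) =
support(`PSSsym4`) = book 24 (by name; through C180; through C184 / C182 / C49 for C247); Mok ∩ support = KMSW ∩ support = ∅ — a to-appear refinement of level-2 dimension
formulas by Arthur type and a PUBLISHED (2021) reciprocity law for the critical values of the degree-5 L-function of every cohomological Siegel cusp form of degree 2 (with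
its sym⁴ corollary) inherit exactly the book's open leaves.

**v5 (section 103; unit `pub-arthur-down-g39`, gen 39; new import `…Downstream30`).**  The hundredth tranche opens the register's thirtieth file (`Downstream30.lean`,
module M220) with the second batch of ‘peripheral (conduit cited)’ rows of `DOWNSTREAM.md` §I.6 read IN FULL under GAPS G-DN-433's rule: NEW row C249 N. Dummigan –
G. Tornaría, *Residual paramodularity of a certain Calabi-Yau threefold*, Res. Number Theory 12 (2026) = arXiv:2412.14289 (`DTresidual` = Theorem 1.1 / Corollary 1.3 ⇐ row
C244 `Consumers98.DPRTjl` — a third-order consumer), NEW row C250 C. Ray – M. Roy – S. Yi, *Congruences for dimensions of spaces of Siegel cusp forms and 4-core partitions*,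
Ramanujan J. (2021) = arXiv:2104.09710 (`RRYcong` = Theorems 3.1 – 3.3, Corollaries 4.1 – 4.2 ⇐ row C49 `Consumers21.RSYCount`) and NEW row C251 H. T. Dang, arXiv:2608.14145
(PREPRINT 2026; `DangRB` = Theorem 2.4 / Proposition 4.4 ⇐ book ∧ row C90 `Consumers28.VanHoften` ∧ C244 ∧ row C180 `Consumers19.SchmidtParamodular`).  Certified with ONE
reading `canon₁₀₀W ν c₁₉ c₂₁ c₂₈ c₉₈` (C249 := `c₉₈.DPRTjl`; C250 := `c₂₁.RSYCount`; C251 := book ∧ `c₂₈.VanHoften` ∧ `c₉₈.DPRTjl` ∧ `c₁₉.SchmidtParamodular`), whose edges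
hold for every ν and every assignment (`canon_implications₁₀₀W`), and its canonical instance `canon₁₀₀ ν μ κ` over `canon₉₈` of section 101 (`canon_implications₁₀₀`): at
the top all three hold (`hundredth_holds_top`, through the tranche's `hundredth_of_leaves`); in each of the 24 book countermodels (tranches 1 / 19 / 20 / 21 / 28 / 98 / 100
read canonically over it, ALL their edges valid) ALL THREE FAIL (`c100_book_cm`: every book leaf is load-bearing — through C244 / C182 / C180 for C249, through C49 / C182
for C250, by name and through C90 / C244 / C180 for C251); with one premise denied at the top (`c100_denied_top`, over `canon₁₀₀noC182` / `canon₁₀₀noC49` /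
`canon₁₀₀noC90` / `canon₁₀₀noC180`, built on section 101's `canon₉₈noC182` / `canon₉₈noC49` / `canon₉₈noC90` / `canon₉₈noC180`): C182 denied (C244 and C49 fall with it)
⇒ ALL THREE FAIL; C49 alone denied ⇒ only C250 FAILS; C90 alone denied ⇒ only C251 FAILS; C180 denied with C182 / C49 / C244 free-standing ⇒ only C251 FAILS; in every
Mok countermodel (KMSW = `κnoMok`) and every KMSW countermodel, the book at the top, ALL THREE HOLD (`c100_unitary_independent`).  In one statement (`c100_regraded`):
support(`DTresidual`) = support(`RRYcong`) = support(`DangRB`) = book 24; Mok ∩ support = KMSW ∩ support = ∅ — a 2026 residual-paramodularity theorem for a Calabi – Yau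
threefold, 2021 dimension congruences and a 2026 preprint's transfer laws for the Richelot – Brandt graph inherit exactly the book's open leaves.

**v6 (section 104; unit `pub-arthur-down-g39`, gen 39).**  The hundred-and-first tranche (`Downstream30.lean` v2) types the third batch of ‘peripheral’ rows read in full
(GAPS G-DN-436): NEW row C252 F. Waibel, *Moments of spinor L-functions and symplectic Kloosterman sums*, Q. J. Math. (2019) = arXiv:1805.11502 (`WaibelMoment` = Theorem 1 ⇐
row C180: « class (G) in the notion of [RS2018] »), NEW row C253 F. Calegari – S. Chidambaram – A. Ghitza, *Some modular abelian surfaces*, Math. Comp. 89 (2020) =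
arXiv:1906.10939 (`CCGmodular` = Theorems 5 / 7 ⇐ row C9 `Consumers.BCGP`), NEW row C254 C. Gu, *Potential automorphy of K3 surfaces with large Picard rank*, arXiv:2512.04732
(PREPRINT 2025; `GuK3` = Theorems 1.1 / 7.1 ⇐ C9) and NEW row C255 E. Florit – A. Pacetti, *K-varieties and Galois representations*, arXiv:2412.03184 (PREPRINT 2024; `FPpotQM` =
Theorem 5.3 ⇐ C9).  Certified with ONE reading `canon₁₀₁W c c₁₉` (C252 := `c₁₉.SchmidtParamodular`; C253, C254, C255 := `c.BCGP`), whose edges hold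
for every assignment (`canon_implications₁₀₁W`), and its canonical instance `canon₁₀₁ ν μ κ` (`canon_implications₁₀₁`): at the top all four hold (`hundredfirst_holds_top`);
in each of the 24 book countermodels (tranches 1 / 19 / 101 read canonically over it) ALL FOUR FAIL (`c101_book_cm`: through C180 for C252, through C9 ⇐ A4 for C253 –
C255); with one premise denied at the top (`c101_denied_top`): C180 denied (`c₁₉noConduit` of section 25) ⇒ only C252 FAILS; C9 denied (`c₁noC9`, defined here like section 95's
`c₁noA4`) ⇒ C253, C254 and C255 FAIL, C252 HOLDS; in every Mok / KMSW countermodel ALL FOUR HOLD (`c101_unitary_independent`).  In one statement (`c101_regraded`): support =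
book 24 for each; Mok ∩ support = KMSW ∩ support = ∅ — a 2019 second-moment theorem for spinor L-values, 2020's explicit modular abelian surfaces, a 2025
potential-automorphy theorem for K3 surfaces and a 2024 Siegel-modularity theorem for abelian surfaces with potential QM inherit exactly the book's open leaves.

**v7 (section 105; unit `pub-arthur-down-g40`, gen 40).**  The hundred-and-second tranche (`Downstream30.lean` v3, unit `pub-arthur-down-g39`) types the fourth batch of
‘peripheral’ rows read in full — the BCGP vein proper (GAPS G-DN-437): NEW row C256 N. Taylor, *Sato-Tate distributions on Abelian surfaces*, Trans. Amer. Math. Soc. 373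
(2020) = arXiv:1808.00243 (`NTaylorTraces` = Theorems 4.1 – 4.4 ⇐ row C9 `Consumers.BCGP` ∧ row A4 `Consumers.GeeTaibi`: « Theorem 4.5 ( [BCGP]) », « Theorem 4.6
([GeeTaibi]) ») and NEW row C257 F. Calegari – S. Chidambaram – D. P. Roberts, *Abelian surfaces with fixed 3-torsion*, Open Book Series 4 (2020) = arXiv:2003.00604
(`CCRfamilies` = §4.3 ⇐ C9: « satisfies all the conditions of [BCGP], so that $X$ is modular »).  Certified with ONE reading `canon₁₀₂W c` (C256 := `c.BCGP ∧ c.GeeTaibi`; C257 :=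
`c.BCGP`), whose edges hold for every assignment of tranche 1 (`canon_implications₁₀₂W`), and its canonical instance `canon₁₀₂ ν μ κ` (`canon_implications₁₀₂`): at the top
both hold (`hundredsecond_holds_top`, through the tranche's `hundredsecond_of_leaves`); in each of the 24 book countermodels (tranches 1 / 102 read canonically over it) BOTH
FAIL (`c102_book_cm`: through C9 ⇐ A4 and through A4); with one premise denied at the top (`c102_denied_top`): C9 denied (`c₁noC9` of section 104) ⇒ BOTH FAIL; A4 denied at
the reading level (`c₁noA4` of section 95; C9 read canonically, i.e. free-standing over it) ⇒ only C256 FAILS, C257 HOLDS; in every Mok / KMSW countermodel BOTH HOLD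
(`c102_unitary_independent`).  In one statement (`c102_regraded`): support = book 24 for each; Mok ∩ support = KMSW ∩ support = ∅ — a 2020 theorem on the extreme values
of normalised Frobenius traces of abelian surfaces and 2020's explicit families of modular genus-2 curves inherit exactly the book's open leaves.

**v8 (section 106; unit `pub-arthur-down-g40`, gen 40).**  The hundred-and-third tranche (`Downstream30.lean` v4, this unit) concludes the BCGP vein of `DOWNSTREAM.md` §I.6
(GAPS G-DN-438: the 27 BCGP-citer rows not yet opened, read in full — four consumers): NEW row C258 L. Chiriac – A. Jorza, *Comparing Hecke coefficients of automorphic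
representations*, Trans. Amer. Math. Soc. 372 (2019) = arXiv:1802.05684 (`CJdensity` = Example 4.7 ⇐ row C9 `Consumers.BCGP`), NEW row C259 F. Calegari – D. Geraghty – M.
Harris, arXiv:1907.08694 (PREPRINT 2019; `CGHselmer` = Theorem 1.1 ⇐ row C34 `Consumers64.CalegariGeraghtyGSp4` ∧ C9: « the modularity lifting results of [CG] and [CG2] », « as in
the proof of Proposition 7.9.8 of [BCGP] »), NEW row C260 C. Li – W. Zhang, Essential Number Theory 1 (2022) = arXiv:2112.15164 (`LZtateII` = Theorem 1.4, the abelian-surface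
cases ⇐ C9: « follows from [BCGP21] and its proof ») and NEW row C261 Y. Nemoto – T. Yamauchi, arXiv:2512.24607 (PREPRINT 2025; `NYregulator` = §5.2's « unconditionally »
normalisation ⇐ C9).  Certified with ONE reading `canon₁₀₃W c c₆₄` (C258, C260, C261 := `c.BCGP`; C259 := `c₆₄.CalegariGeraghtyGSp4 ∧ c.BCGP`), whose edges hold for every
assignment of tranches 1 / 64 (`canon_implications₁₀₃W`), and its canonical instance `canon₁₀₃ ν μ κ` over `canon`, `canon₆₄` (`canon_implications₁₀₃`): at the top all four
hold (`hundredthird_holds_top`, through the tranche's `hundredthird_of_leaves` fed by `canon_implications₆₄` and `canon_implications₂₈`); in each of the 24 book countermodels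
(tranches 1 / 64 / 103 read canonically over it) ALL FOUR FAIL (`c103_book_cm`: through C9 ⇐ A4, and for C259 also through C34 ⇐ book); with one premise denied at the top
(`c103_denied_top`): C9 denied (`c₁noC9` of section 104) ⇒ ALL FOUR FAIL; C34 denied at the reading level (`c₆₄noC34`, defined here: `canon₆₄` at the top with
`CalegariGeraghtyGSp4 := False`) ⇒ only C259 FAILS; in every Mok / KMSW countermodel ALL FOUR HOLD (`c103_unitary_independent` — C34's Mok-side premise C191 is a BOOK row,
Mok's Compositio 2014 GSp₄ paper).  In one statement (`c103_regraded`): support = book 24 for each; Mok ∩ support = KMSW ∩ support = ∅ — a 2019 density statement for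
Hecke signs of genus-2 curves, a 2019 adjoint Selmer-group vanishing for modular abelian surfaces, 2022's Tate II for abelian surfaces over totally real fields and a 2025
regulator computation inherit exactly the book's open leaves.

**v9 (section 107; unit `pub-arthur-down-g40`, gen 40).**  The hundred-and-fourth tranche (NEW `Downstream31.lean` v1, module M223, this unit — hence the new import
`…Downstream31`) types the remainder of GAPS G-DN-430 (c) read in full (G-DN-440): NEW row C262 H. Katsurada, arXiv:2106.10873 (PREPRINT; `KatsuradaMult1` = Theorem 2.2, the
level-one multiplicity one for S_k(Sp_n(ℤ)), k ≥ n+1 ⇐ row C5 `Consumers.ChenevierLannesStar` « Corollary 8.5.4 » ∧ row B1 `Consumers.AMR`; `KatsuradaDenom` = Theorem 2.3 /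
Corollary 2.4 ⇐ `KatsuradaMult1`), NEW row C263 T. Ibukiyama – H. Katsurada – H. Kojima, J. Number Theory 269 (2025) = arXiv:2311.07848 (`IKKperiod` = Theorems 3.6 / 3.8 ⇐ B1
∧ C5, « (cf. [2],[7]) »), a NEW node on the existing row C226 (M. Furusawa – K. Morimoto, Compositio Math. 160 (2024): `FMtempered` = Corollary 8.1 with Proposition 8.1 ⇐
the book by name, « Arthur [3] ») and NEW row C264 A. Pitale – A. Saha – R. Schmidt, arXiv:2302.05148 (PREPRINT; `PSSsup` = Theorem 1.1 ⇐ `FMtempered`, « [12, Theorem 6.3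
and Corollary 8.1] »; and `PSSbessel` = Theorem 4.8 ⇐ row C226's `Consumers89.FMrefined` (section 89: ⇐ Mok ∧ C67 ∧ C24) ∧ `FMtempered`, « Theorem 1.2 of [12] … Proposition 8.1 of [12] »).
Certified with ONE reading `canon₁₀₄W ν c c₈₉` (C262 ×2, C263 := `c.ChenevierLannesStar ∧ c.AMR`; `FMtempered`, `PSSsup` := book at all ranks; `PSSbessel` :=
`c₈₉.FMrefined ∧` book), whose
edges hold for every ν and every assignment of tranches 1 / 89 (`canon_implications₁₀₄W`), and its canonical instance `canon₁₀₄ ν μ κ` over `canon` and section 89's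
`canon₈₉W … (canon₈no ν μ) (canon₃₄ μ κ)` (`canon_implications₁₀₄`): at the top all six hold (`hundredfourth_holds_top`, through the tranche's `hundredfourth_of_inputs`); in
each of the 24 book countermodels ALL SIX FAIL (`c104_book_cm`: through C5 / B1 ⇐ book, and by name); with one premise denied at the top (`c104_denied_top`): C5 denied
(`c₁noC5`, defined here like section 98's `c₁noB1`) or B1 denied (`c₁noB1`) ⇒ C262 ×2 and C263 FAIL while C226's node and both C264 statements HOLD (their book premise
is the top itself, not deniable at the top reading); in every Mok countermodel and with KMSW's Mok import denied (`c104_mok_cm`, `c104_kmsw`) the five book-side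
statements HOLD while `PSSbessel` FAILS (through C226's Theorem 1.2: « by Mok [82] », rows C67 / C24); in KMSW's leaf countermodels the five hold.  In one statement
(`c104_regraded`): support = book 24 for all six; Mok 29 ∪ KMSW's import for `PSSbessel` only — a level-one multiplicity-one input of two L-value algebraicity
papers, a temperedness corollary and a sup-norm theorem inherit exactly the book's open leaves, and an explicit Bessel-period formula for Siegel cusp forms of non-
squarefree level inherits, through Furusawa – Morimoto's Theorem 1.2, Mok's open leaves as well: the first row of the ‘peripheral’ GSp₄ quarry to do so.

**Deliberately not here.**  Any claim about the content or truth of a downstream statement; no new named fact (every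
canonical value is written out); no Mathlib, no `axiom`, no `sorry`, no `opaque`.
-/

set_option autoImplicit false

namespace Literature.NumberTheory.Automorphic.Arthur2013

namespace Downstream

namespace Support
/-! ## 99. Ninety-sixth tranche (v1 of this file, after NEW `Downstream29.lean` v1; unit `pub-arthur-down-g38`): supports of row C241 (= census row E29 re-graded)
`HsPclass` (⇐ book ∧ A4) / `HsPmain` (⇐ `HsPclass`); see the module docstring for the summary. -/

section Canon96

variable (ν : Nodes) (μ : Mok2015.Nodes) (κ : KMSW2014.Nodes)

/-- The parametrised canonical reading of the ninety-sixth tranche: the assignment `c` of tranche 1 is the parameter; C241's Proposition 3.2 with §3.2 := book ∧ A4, its three theorems := the same. [cite: HsiehPalvannan2025, Prop. 3.2, Thm (thm:mainconj2) (canonical model; bookkeeping)] -/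
abbrev canon₉₆W (c : Consumers) : Consumers96 where
  HsPclass := (∀ N, ν.Everything N) ∧ c.GeeTaibi
  HsPmain := (∀ N, ν.Everything N) ∧ c.GeeTaibi

/-- The canonical instance: the parametrised reading over the canonical reading `canon` of tranche 1 (there `GeeTaibi := ∀ N, ν.Everything N`). [cite: HsiehPalvannan2025, Prop. 3.2 (canonical model; bookkeeping)] -/
abbrev canon₉₆ : Consumers96 := canon₉₆W ν (canon ν μ κ)

/-- Every ninety-sixth-tranche edge holds in the parametrised reading, for arbitrary ν and EVERY assignment of tranche 1. [cite: HsiehPalvannan2025, Prop. 3.2, Thm (thm:mainconj2) (bookkeeping proved here)] -/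
theorem canon_implications₉₆W (c : Consumers) : Implications96 ν c (canon₉₆W ν c) where
  hspClass := fun b g => ⟨b, g⟩
  hspMain := fun h => h

/-- Every ninety-sixth-tranche edge holds in the canonical instance, for arbitrary ν, μ, κ. [cite: HsiehPalvannan2025, Prop. 3.2 (bookkeeping proved here)] -/
theorem canon_implications₉₆ : Implications96 ν (canon ν μ κ) (canon₉₆ ν μ κ) :=
  canon_implications₉₆W ν _

/-- In the parametrised reading both statements hold as soon as the book holds at all ranks and row A4 holds — through the tranche's bookkeeping theorem `hsp_of_book_and_A4`. [cite: HsiehPalvannan2025, Prop. 3.2, Thm (thm:mainconj2) (bookkeeping proved here)] -/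
theorem c96_all_of (c : Consumers) (hν : ∀ N, ν.Everything N) (h₄ : c.GeeTaibi) : (canon₉₆W ν c).HsPclass ∧ (canon₉₆W ν c).HsPmain :=
  hsp_of_book_and_A4 (canon_implications₉₆W ν c) hν h₄

end Canon96

/-- At the top (every input of the book; Mok and KMSW at the all-ones assignments, unread by the tranche; tranche 1 read canonically) both statements hold, through the
tranche's own `ninetysixth_of_leaves`. [cite: HsiehPalvannan2025, Prop. 3.2, Thm (thm:mainconj2) (bookkeeping proved here)] -/
theorem ninetysixth_holds_top : (canon₉₆ νtop μtop κtop).HsPclass ∧ (canon₉₆ νtop μtop κtop).HsPmain :=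
  ninetysixth_of_leaves (canon_implications₉₆ νtop μtop κtop) (canon_implications νtop μtop κtop) bookInputs_top

/-- BOOK SIDE, EXACT SUPPORT: in each of the 24 book countermodels (book edge systems and every other book leaf hold, the removed leaf fails; Mok and KMSW at the all-ones
assignments; tranches 1 / 96 read canonically over it, ALL their edges valid) BOTH statements FAIL — every one of the 24 book leaves is load-bearing, by name (« Arthur's
multiplicity formula », « the classification [Gee19] ») and through row A4. [cite: HsiehPalvannan2025, Prop. 3.2 proof, §3.2, with GeeTaibi2019 Thm 7.4.1 and Arthur2013 §1.5 (bookkeeping proved here)] -/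
theorem c96_book_cm (l : LeafSupport.Leaf) :
    LeafSupport.Systems (LeafSupport.mkN (LeafSupport.cm l)) (LeafSupport.mkW (LeafSupport.cm l)) (LeafSupport.mkG (LeafSupport.cm l)) ∧
      (∀ l', l' ≠ l → (LeafSupport.mkN (LeafSupport.cm l)).leaf l') ∧ ¬ (LeafSupport.mkN (LeafSupport.cm l)).leaf l ∧
      (Implications (LeafSupport.mkN (LeafSupport.cm l)) μtop κtop (canon (LeafSupport.mkN (LeafSupport.cm l)) μtop κtop) ∧
        Implications96 (LeafSupport.mkN (LeafSupport.cm l)) (canon (LeafSupport.mkN (LeafSupport.cm l)) μtop κtop) (canon₉₆ (LeafSupport.mkN (LeafSupport.cm l)) μtop κtop)) ∧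
      (¬ (canon₉₆ (LeafSupport.mkN (LeafSupport.cm l)) μtop κtop).HsPclass ∧ ¬ (canon₉₆ (LeafSupport.mkN (LeafSupport.cm l)) μtop κtop).HsPmain) :=
  have cmod := LeafSupport.countermodel l
  have nb := not_B_cm l
  ⟨cmod.1, cmod.2.1, cmod.2.2.1, ⟨canon_implications _ _ _, canon_implications₉₆ _ _ _⟩, ⟨fun h => nb h.1, fun h => nb h.1⟩⟩

/-- ROW A4 IS LOAD-BEARING AS TYPED (top book; the tranche-96 edges hold over the denied assignment `c₁noA4` of section 95): A4 denied ⇒ BOTH C241 statements FAIL —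
the text names [Gee19] for the multiplicity formula and for the classification; the Roberts alternative it offers for the existence sentence is not a typed node.
[cite: HsiehPalvannan2025, §3.2 (« as established in [Gee19] (or … Roberts [MR1871665]) »), Prop. 3.2; GeeTaibi2019, Thm 7.4.1 (separating model; bookkeeping proved here)] -/
theorem c96_A4_denied_top :
    Implications96 νtop c₁noA4 (canon₉₆W νtop c₁noA4) ∧ ¬ (canon₉₆W νtop c₁noA4).HsPclass ∧ ¬ (canon₉₆W νtop c₁noA4).HsPmain :=
  ⟨canon_implications₉₆W _ _, fun h => h.2, fun h => h.2⟩

/-- UNITARY SIDE: in each of Mok's 29 countermodels (KMSW = `κnoMok`) and in each of KMSW's countermodels, the book at the all-ones assignment (canonical readings over it),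
BOTH typed statements HOLD — no statement of Mok 2015 or KMSW occurs in the tranche's edges (GSp_4 over ℚ throughout). [cite: HsiehPalvannan2025, Prop. 3.2, Thm (thm:mainconj2) (bookkeeping proved here)] -/
theorem c96_unitary_independent (l : Mok2015.LeafSupport.Leaf) (l' : KMSW2014.LeafSupport.Leaf) :
    ((canon₉₆ νtop (Mok2015.LeafSupport.mkN (Mok2015.LeafSupport.cm l)) κnoMok).HsPclass ∧ (canon₉₆ νtop (Mok2015.LeafSupport.mkN (Mok2015.LeafSupport.cm l)) κnoMok).HsPmain) ∧
      ((canon₉₆ νtop μtop (KMSW2014.LeafSupport.mkN (KMSW2014.LeafSupport.cm l'))).HsPclass ∧ (canon₉₆ νtop μtop (KMSW2014.LeafSupport.mkN (KMSW2014.LeafSupport.cm l'))).HsPmain) :=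
  have b : ∀ N, νtop.Everything N := bookInputs_top.everything
  ⟨⟨⟨b, b⟩, ⟨b, b⟩⟩, ⟨⟨b, b⟩, ⟨b, b⟩⟩⟩

/-- THE NINETY-SIXTH TRANCHE REGRADED, in one statement: (i) at the top both hold; (ii) in the book countermodel of ANY leaf both fail; (iii) A4 denied: both fail; (iv) in
every Mok / KMSW countermodel (book at the top) both hold.  Supports: book 24 for both statements (directly and through A4); nothing of Mok 2015 or KMSW — census row
E29's ‘classification-free alternative’ notwithstanding (it covers the existence sentence only). [cite: HsiehPalvannan2025, Prop. 3.2, Thms (thm:yoshidafamily), (thm:mainconj2), (thm:selmstructure) (bookkeeping proved here)] -/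
theorem c96_regraded :
    ((canon₉₆ νtop μtop κtop).HsPclass ∧ (canon₉₆ νtop μtop κtop).HsPmain) ∧
      (∀ l : LeafSupport.Leaf, ¬ (LeafSupport.mkN (LeafSupport.cm l)).leaf l ∧
        ¬ (canon₉₆ (LeafSupport.mkN (LeafSupport.cm l)) μtop κtop).HsPclass ∧ ¬ (canon₉₆ (LeafSupport.mkN (LeafSupport.cm l)) μtop κtop).HsPmain) ∧
      (¬ (canon₉₆W νtop c₁noA4).HsPclass ∧ ¬ (canon₉₆W νtop c₁noA4).HsPmain) ∧
      (∀ (l : Mok2015.LeafSupport.Leaf) (l' : KMSW2014.LeafSupport.Leaf),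
        (canon₉₆ νtop (Mok2015.LeafSupport.mkN (Mok2015.LeafSupport.cm l)) κnoMok).HsPmain ∧ (canon₉₆ νtop μtop (KMSW2014.LeafSupport.mkN (KMSW2014.LeafSupport.cm l'))).HsPmain) :=
  ⟨ninetysixth_holds_top,
    fun l => have h := c96_book_cm l
      ⟨h.2.2.1, h.2.2.2.2.1, h.2.2.2.2.2⟩,
    ⟨c96_A4_denied_top.2.1, c96_A4_denied_top.2.2⟩,
    fun l l' => have h := c96_unitary_independent l l'
      ⟨h.1.2, h.2.2⟩⟩


/-! ## 100. Ninety-seventh tranche (v2 of this file, after `Downstream29.lean` v2; unit `pub-arthur-down-g39`): supports of NEW rows C242 `ZLpadic` (⇐ book ∧ A4)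
and C243 `WYlevel` (⇐ C180) / `WYtwo` (⇐ C49); see the module docstring for the summary. -/

section Canon97

variable (ν : Nodes) (μ : Mok2015.Nodes) (κ : KMSW2014.Nodes)

/-- The parametrised canonical reading of the ninety-seventh tranche: the assignments `c`, `c₁₉`, `c₂₁` of tranches 1 / 19 / 21 are the parameters; C242's Theorem 1.0.1 := book ∧ A4; C243's Theorem 1.1 := C180, its Theorem 1.2 := C49. [cite: ZhengLiu2023GSp4GL2padicL, Thm 1.0.1; WeiYi2026DistinguishingSiegel, Thms 1.1, 1.2 (canonical model; bookkeeping)] -/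
abbrev canon₉₇W (c : Consumers) (c₁₉ : Consumers19) (c₂₁ : Consumers21) : Consumers97 where
  ZLpadic := (∀ N, ν.Everything N) ∧ c.GeeTaibi
  WYlevel := c₁₉.SchmidtParamodular
  WYtwo := c₂₁.RSYCount

/-- The canonical instance: the parametrised reading over the canonical readings `canon`, `canon₁₉`, `canon₂₁` of tranches 1 / 19 / 21 (there `GeeTaibi := ∀ N, ν.Everything N`, `SchmidtParamodular := ∀ N, ν.Everything N`, `RSYCount := book ∧ (canon₂₀ ν μ κ).SchmidtCAP`). [cite: ZhengLiu2023GSp4GL2padicL, Thm 1.0.1; WeiYi2026DistinguishingSiegel, Thm 1.1 (canonical model; bookkeeping)] -/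
abbrev canon₉₇ : Consumers97 := canon₉₇W ν (canon ν μ κ) (canon₁₉ ν μ κ) (canon₂₁ ν μ κ)

/-- Every ninety-seventh-tranche edge holds in the parametrised reading, for arbitrary ν and EVERY assignment of tranches 1 / 19 / 21. [cite: ZhengLiu2023GSp4GL2padicL, Thm 1.0.1; WeiYi2026DistinguishingSiegel, Thms 1.1, 1.2 (bookkeeping proved here)] -/
theorem canon_implications₉₇W (c : Consumers) (c₁₉ : Consumers19) (c₂₁ : Consumers21) : Implications97 ν c c₁₉ c₂₁ (canon₉₇W ν c c₁₉ c₂₁) where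
  zlPadic := fun b g => ⟨b, g⟩
  wyLevel := fun h => h
  wyTwo := fun h => h

/-- Every ninety-seventh-tranche edge holds in the canonical instance, for arbitrary ν, μ, κ. [cite: ZhengLiu2023GSp4GL2padicL, Thm 1.0.1; WeiYi2026DistinguishingSiegel, Thm 1.1 (bookkeeping proved here)] -/
theorem canon_implications₉₇ : Implications97 ν (canon ν μ κ) (canon₁₉ ν μ κ) (canon₂₁ ν μ κ) (canon₉₇ ν μ κ) :=
  canon_implications₉₇W ν _ _ _

/-- In the parametrised reading all three statements hold as soon as the book holds at all ranks and rows A4, C180, C49 hold — through the tranche's bookkeeping theorems `zl_of_book_and_A4`, `wy_of_conduits`. [cite: ZhengLiu2023GSp4GL2padicL, Thm 1.0.1; WeiYi2026DistinguishingSiegel, Thms 1.1, 1.2 (bookkeeping proved here)] -/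
theorem c97_all_of (c : Consumers) (c₁₉ : Consumers19) (c₂₁ : Consumers21) (hν : ∀ N, ν.Everything N) (h₄ : c.GeeTaibi) (h₁₈₀ : c₁₉.SchmidtParamodular) (h₄₉ : c₂₁.RSYCount) :
    (canon₉₇W ν c c₁₉ c₂₁).ZLpadic ∧ (canon₉₇W ν c c₁₉ c₂₁).WYlevel ∧ (canon₉₇W ν c c₁₉ c₂₁).WYtwo :=
  have X := canon_implications₉₇W ν c c₁₉ c₂₁
  have h := wy_of_conduits X h₁₈₀ h₄₉
  ⟨zl_of_book_and_A4 X hν h₄, h.1, h.2⟩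

end Canon97

/-- At the top (every input of the book; Mok and KMSW at the all-ones assignments, unread by the tranche; tranches 1 / 19 / 20 / 21 read canonically) all three statements hold,
through the tranche's own `ninetyseventh_of_leaves`. [cite: ZhengLiu2023GSp4GL2padicL, Thm 1.0.1; WeiYi2026DistinguishingSiegel, Thms 1.1, 1.2 (bookkeeping proved here)] -/
theorem ninetyseventh_holds_top : (canon₉₇ νtop μtop κtop).ZLpadic ∧ (canon₉₇ νtop μtop κtop).WYlevel ∧ (canon₉₇ νtop μtop κtop).WYtwo :=
  ninetyseventh_of_leaves (canon_implications₉₇ νtop μtop κtop) (canon_implications₂₁ νtop μtop κtop) (canon_implications₂₀ νtop μtop κtop) (canon_implications₁₉ νtop μtop κtop)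
    (canon_implications νtop μtop κtop) bookInputs_top

/-- BOOK SIDE, EXACT SUPPORT: in each of the 24 book countermodels (book edge systems and every other book leaf hold, the removed leaf fails; Mok and KMSW at the all-ones
assignments; tranches 1 / 19 / 20 / 21 / 97 read canonically over it, ALL their edges valid) ALL THREE statements FAIL — every one of the 24 book leaves is load-bearing, by
name (« [ Art04, GT19] ») and through row A4 for C242, through row C180 (« [Sch18, Table 1] », the type-(G) transfer) for C243's Theorem 1.1, through row C49 (« [RSY21,
Theorem 3.1] ») for its Theorem 1.2. [cite: ZhengLiu2023GSp4GL2padicL, p. 44 and proof of Thm 4.2.1; WeiYi2026DistinguishingSiegel, proof of Lemma 3.2, §4; with GeeTaibi2019 Thm 7.4.1, Schmidt2018Packet Thm 2.6, RoySchmidtYi2021 Cor. 2.3 and Arthur2013 §1.5 (bookkeeping proved here)] -/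
theorem c97_book_cm (l : LeafSupport.Leaf) :
    LeafSupport.Systems (LeafSupport.mkN (LeafSupport.cm l)) (LeafSupport.mkW (LeafSupport.cm l)) (LeafSupport.mkG (LeafSupport.cm l)) ∧
      (∀ l', l' ≠ l → (LeafSupport.mkN (LeafSupport.cm l)).leaf l') ∧ ¬ (LeafSupport.mkN (LeafSupport.cm l)).leaf l ∧
      (Implications (LeafSupport.mkN (LeafSupport.cm l)) μtop κtop (canon (LeafSupport.mkN (LeafSupport.cm l)) μtop κtop) ∧
        Implications19 (LeafSupport.mkN (LeafSupport.cm l)) μtop κtop (canon₁₉ (LeafSupport.mkN (LeafSupport.cm l)) μtop κtop) ∧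
        Implications20 (LeafSupport.mkN (LeafSupport.cm l)) (canon₁₉ (LeafSupport.mkN (LeafSupport.cm l)) μtop κtop) (canon₂₀ (LeafSupport.mkN (LeafSupport.cm l)) μtop κtop) ∧
        Implications21 (LeafSupport.mkN (LeafSupport.cm l)) (canon₁₉ (LeafSupport.mkN (LeafSupport.cm l)) μtop κtop) (canon₂₀ (LeafSupport.mkN (LeafSupport.cm l)) μtop κtop) (canon₂₁ (LeafSupport.mkN (LeafSupport.cm l)) μtop κtop) ∧
        Implications97 (LeafSupport.mkN (LeafSupport.cm l)) (canon (LeafSupport.mkN (LeafSupport.cm l)) μtop κtop) (canon₁₉ (LeafSupport.mkN (LeafSupport.cm l)) μtop κtop) (canon₂₁ (LeafSupport.mkN (LeafSupport.cm l)) μtop κtop) (canon₉₇ (LeafSupport.mkN (LeafSupport.cm l)) μtop κtop)) ∧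
      (¬ (canon₉₇ (LeafSupport.mkN (LeafSupport.cm l)) μtop κtop).ZLpadic ∧ ¬ (canon₉₇ (LeafSupport.mkN (LeafSupport.cm l)) μtop κtop).WYlevel ∧
        ¬ (canon₉₇ (LeafSupport.mkN (LeafSupport.cm l)) μtop κtop).WYtwo) :=
  have cmod := LeafSupport.countermodel l
  have nb := not_B_cm l
  ⟨cmod.1, cmod.2.1, cmod.2.2.1,
    ⟨canon_implications _ _ _, canon_implications₁₉ _ _ _, canon_implications₂₀ _ _ _, canon_implications₂₁ _ _ _, canon_implications₉₇ _ _ _⟩,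
    ⟨fun h => nb h.1, fun h => nb h, fun h => nb h.1⟩⟩

/-- THE PREMISES ARE LOAD-BEARING EXACTLY AS TYPED (reading-level separation at the top; the tranche-97 edges hold over each denied assignment; the denied readings are
`c₁noA4` of section 95, `c₁₉noConduit` / `canon₂₀free` / `canon₂₁noC180` of section 25 and `canon₂₁noC49` of section 26): (a) A4 DENIED ⇒ C242 FAILS, both C243
statements HOLD; (b) C180 DENIED (C182 and C49 free-standing) ⇒ C243's Theorem 1.1 FAILS, its Theorem 1.2 and C242 HOLD; (c) C49 ALONE DENIED ⇒ C243's Theorem 1.2 FAILS,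
its Theorem 1.1 and C242 HOLD. [cite: ZhengLiu2023GSp4GL2padicL, p. 44 (« [ Art04, GT19] »); WeiYi2026DistinguishingSiegel, proof of Lemma 3.2 (« [Sch18, Table 1] »), §4 (« [RSY21, Theorem 3.1] ») (separating models; bookkeeping proved here)] -/
theorem c97_denied_top :
    (Implications97 νtop c₁noA4 (canon₁₉ νtop μtop κtop) (canon₂₁ νtop μtop κtop) (canon₉₇W νtop c₁noA4 (canon₁₉ νtop μtop κtop) (canon₂₁ νtop μtop κtop)) ∧
        ¬ (canon₉₇W νtop c₁noA4 (canon₁₉ νtop μtop κtop) (canon₂₁ νtop μtop κtop)).ZLpadic ∧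
        (canon₉₇W νtop c₁noA4 (canon₁₉ νtop μtop κtop) (canon₂₁ νtop μtop κtop)).WYlevel ∧
        (canon₉₇W νtop c₁noA4 (canon₁₉ νtop μtop κtop) (canon₂₁ νtop μtop κtop)).WYtwo) ∧
      (Implications97 νtop (canon νtop μtop κtop) (c₁₉noConduit μtop κtop) canon₂₁noC180 (canon₉₇W νtop (canon νtop μtop κtop) (c₁₉noConduit μtop κtop) canon₂₁noC180) ∧
        (canon₉₇W νtop (canon νtop μtop κtop) (c₁₉noConduit μtop κtop) canon₂₁noC180).ZLpadic ∧
        ¬ (canon₉₇W νtop (canon νtop μtop κtop) (c₁₉noConduit μtop κtop) canon₂₁noC180).WYlevel ∧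
        (canon₉₇W νtop (canon νtop μtop κtop) (c₁₉noConduit μtop κtop) canon₂₁noC180).WYtwo) ∧
      (Implications97 νtop (canon νtop μtop κtop) (canon₁₉ νtop μtop κtop) (canon₂₁noC49 νtop μtop κtop) (canon₉₇W νtop (canon νtop μtop κtop) (canon₁₉ νtop μtop κtop) (canon₂₁noC49 νtop μtop κtop)) ∧
        (canon₉₇W νtop (canon νtop μtop κtop) (canon₁₉ νtop μtop κtop) (canon₂₁noC49 νtop μtop κtop)).ZLpadic ∧
        (canon₉₇W νtop (canon νtop μtop κtop) (canon₁₉ νtop μtop κtop) (canon₂₁noC49 νtop μtop κtop)).WYlevel ∧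
        ¬ (canon₉₇W νtop (canon νtop μtop κtop) (canon₁₉ νtop μtop κtop) (canon₂₁noC49 νtop μtop κtop)).WYtwo) :=
  have b : ∀ N, νtop.Everything N := bookInputs_top.everything
  ⟨⟨canon_implications₉₇W _ _ _ _, fun h => h.2, b, ⟨b, b, b⟩⟩,
    ⟨canon_implications₉₇W _ _ _ _, ⟨b, b⟩, fun h => h, True.intro⟩,
    ⟨canon_implications₉₇W _ _ _ _, ⟨b, b⟩, b, fun h => h⟩⟩

/-- UNITARY SIDE: in each of Mok's 29 countermodels (KMSW = `κnoMok`) and in each of KMSW's countermodels, the book at the all-ones assignment (canonical readings over it),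
ALL THREE typed statements HOLD — no statement of Mok 2015 or KMSW occurs in the tranche's edges (GSp_4 / Siegel modular forms over ℚ throughout). [cite: ZhengLiu2023GSp4GL2padicL, Thm 1.0.1; WeiYi2026DistinguishingSiegel, Thms 1.1, 1.2 (bookkeeping proved here)] -/
theorem c97_unitary_independent (l : Mok2015.LeafSupport.Leaf) (l' : KMSW2014.LeafSupport.Leaf) :
    ((canon₉₇ νtop (Mok2015.LeafSupport.mkN (Mok2015.LeafSupport.cm l)) κnoMok).ZLpadic ∧ (canon₉₇ νtop (Mok2015.LeafSupport.mkN (Mok2015.LeafSupport.cm l)) κnoMok).WYlevel ∧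
        (canon₉₇ νtop (Mok2015.LeafSupport.mkN (Mok2015.LeafSupport.cm l)) κnoMok).WYtwo) ∧
      ((canon₉₇ νtop μtop (KMSW2014.LeafSupport.mkN (KMSW2014.LeafSupport.cm l'))).ZLpadic ∧ (canon₉₇ νtop μtop (KMSW2014.LeafSupport.mkN (KMSW2014.LeafSupport.cm l'))).WYlevel ∧
        (canon₉₇ νtop μtop (KMSW2014.LeafSupport.mkN (KMSW2014.LeafSupport.cm l'))).WYtwo) :=
  have b : ∀ N, νtop.Everything N := bookInputs_top.everything
  ⟨⟨⟨b, b⟩, b, ⟨b, b, b⟩⟩, ⟨⟨b, b⟩, b, ⟨b, b, b⟩⟩⟩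

/-- THE NINETY-SEVENTH TRANCHE REGRADED, in one statement: (i) at the top all three hold; (ii) in the book countermodel of ANY leaf all three fail; (iii) A4 denied: C242
fails, C243 holds; C180 denied: C243's Theorem 1.1 fails, Theorem 1.2 holds; C49 denied: Theorem 1.2 fails, Theorem 1.1 holds; (iv) in every Mok / KMSW countermodel (book
at the top) all three hold.  Supports: book 24 for each of the three statements (through A4; through C180; through C49); nothing of Mok 2015 or KMSW. [cite: ZhengLiu2023GSp4GL2padicL, Thm 1.0.1; WeiYi2026DistinguishingSiegel, Thms 1.1, 1.2 (bookkeeping proved here)] -/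
theorem c97_regraded :
    ((canon₉₇ νtop μtop κtop).ZLpadic ∧ (canon₉₇ νtop μtop κtop).WYlevel ∧ (canon₉₇ νtop μtop κtop).WYtwo) ∧
      (∀ l : LeafSupport.Leaf, ¬ (LeafSupport.mkN (LeafSupport.cm l)).leaf l ∧
        ¬ (canon₉₇ (LeafSupport.mkN (LeafSupport.cm l)) μtop κtop).ZLpadic ∧ ¬ (canon₉₇ (LeafSupport.mkN (LeafSupport.cm l)) μtop κtop).WYlevel ∧
        ¬ (canon₉₇ (LeafSupport.mkN (LeafSupport.cm l)) μtop κtop).WYtwo) ∧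
      (¬ (canon₉₇W νtop c₁noA4 (canon₁₉ νtop μtop κtop) (canon₂₁ νtop μtop κtop)).ZLpadic ∧
        (canon₉₇W νtop c₁noA4 (canon₁₉ νtop μtop κtop) (canon₂₁ νtop μtop κtop)).WYlevel ∧
        ¬ (canon₉₇W νtop (canon νtop μtop κtop) (c₁₉noConduit μtop κtop) canon₂₁noC180).WYlevel ∧
        (canon₉₇W νtop (canon νtop μtop κtop) (c₁₉noConduit μtop κtop) canon₂₁noC180).WYtwo ∧
        ¬ (canon₉₇W νtop (canon νtop μtop κtop) (canon₁₉ νtop μtop κtop) (canon₂₁noC49 νtop μtop κtop)).WYtwo ∧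
        (canon₉₇W νtop (canon νtop μtop κtop) (canon₁₉ νtop μtop κtop) (canon₂₁noC49 νtop μtop κtop)).WYlevel) ∧
      (∀ (l : Mok2015.LeafSupport.Leaf) (l' : KMSW2014.LeafSupport.Leaf),
        (canon₉₇ νtop (Mok2015.LeafSupport.mkN (Mok2015.LeafSupport.cm l)) κnoMok).ZLpadic ∧ (canon₉₇ νtop (Mok2015.LeafSupport.mkN (Mok2015.LeafSupport.cm l)) κnoMok).WYtwo ∧
        (canon₉₇ νtop μtop (KMSW2014.LeafSupport.mkN (KMSW2014.LeafSupport.cm l'))).ZLpadic ∧ (canon₉₇ νtop μtop (KMSW2014.LeafSupport.mkN (KMSW2014.LeafSupport.cm l'))).WYtwo) :=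
  ⟨ninetyseventh_holds_top,
    fun l => have h := c97_book_cm l
      ⟨h.2.2.1, h.2.2.2.2.1, h.2.2.2.2.2.1, h.2.2.2.2.2.2⟩,
    ⟨c97_denied_top.1.2.1, c97_denied_top.1.2.2.1, c97_denied_top.2.1.2.2.1, c97_denied_top.2.1.2.2.2, c97_denied_top.2.2.2.2.2, c97_denied_top.2.2.2.2.1⟩,
    fun l l' => have h := c97_unitary_independent l l'
      ⟨h.1.1, h.1.2.2, h.2.1, h.2.2.2⟩⟩


/-! ## 101. Ninety-eighth tranche (v3 of this file, after `Downstream29.lean` v3; unit `pub-arthur-down-g39`): supports of NEW rows C244 `DPRTjl` (⇐ C182) /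
`DPRTcong` (⇐ `DPRTjl`), C245 `IbuCompact` (premise-free) / `IbuParamodular` (⇐ `IbuCompact` ∧ `DPRTjl` ∧ C90 ∧ C49 ∧ C182 ∧ C180) and C246 `LZ3padicL` (⇐ book ∧ A4 ∧
C87); see the module docstring for the summary. -/

section Canon98

variable (ν : Nodes) (μ : Mok2015.Nodes) (κ : KMSW2014.Nodes)

/-- The parametrised canonical reading of the ninety-eighth tranche: the assignments `c`, `c₁₉`, `c₂₀`, `c₂₁`, `c₂₈`, `c₂₉` of tranches 1 / 19 / 20 / 21 / 28 / 29 are the parameters; C244 (both fields) := C182; C245's Theorem 2.1 := `True` (premise-free), its Theorem 2.2 := C244's reading ∧ C90 ∧ C49 ∧ C182 ∧ C180; C246 := (book ∧ A4) ∧ C87. [cite: DummiganEtAl2024, Thms 9.6, 11.3; Ibukiyama2026, Thms 2.1, 2.2; LoefflerZerbes2021DiagonalCycles, Thm 5.5.1 (canonical model; bookkeeping)] -/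
abbrev canon₉₈W (c : Consumers) (c₁₉ : Consumers19) (c₂₀ : Consumers20) (c₂₁ : Consumers21) (c₂₈ : Consumers28) (c₂₉ : Consumers29) : Consumers98 where
  DPRTjl := c₂₀.SchmidtCAP
  DPRTcong := c₂₀.SchmidtCAP
  IbuCompact := True
  IbuParamodular := c₂₀.SchmidtCAP ∧ c₂₈.VanHoften ∧ c₂₁.RSYCount ∧ c₂₀.SchmidtCAP ∧ c₁₉.SchmidtParamodular
  LZ3padicL := ((∀ N, ν.Everything N) ∧ c.GeeTaibi) ∧ c₂₉.LPSZ

/-- The canonical instance: the parametrised reading over the canonical readings `canon`, `canon₁₉`, `canon₂₀`, `canon₂₁`, `canon₂₈`, `canon₂₉` of tranches 1 / 19 / 20 / 21 / 28 / 29 (there `GeeTaibi := ∀ N, ν.Everything N`, `SchmidtParamodular := ∀ N, ν.Everything N`, `SchmidtCAP := book ∧ C180`, `RSYCount := book ∧ C182`, `VanHoften := book ∧ A4`, `LPSZ := book ∧ A4`). [cite: DummiganEtAl2024, Thm 9.6; Ibukiyama2026, Thm 2.2; LoefflerZerbes2021DiagonalCycles, Thm 5.5.1 (canonical model; bookkeeping)]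 -/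
abbrev canon₉₈ : Consumers98 := canon₉₈W ν (canon ν μ κ) (canon₁₉ ν μ κ) (canon₂₀ ν μ κ) (canon₂₁ ν μ κ) (canon₂₈ ν μ κ) (canon₂₉ ν μ κ)

/-- Every ninety-eighth-tranche edge holds in the parametrised reading, for arbitrary ν and EVERY assignment of tranches 1 / 19 / 20 / 21 / 28 / 29. [cite: DummiganEtAl2024, Thms 9.6, 11.3; Ibukiyama2026, Thms 2.1, 2.2; LoefflerZerbes2021DiagonalCycles, Thm 5.5.1 (bookkeeping proved here)] -/
theorem canon_implications₉₈W (c : Consumers) (c₁₉ : Consumers19) (c₂₀ : Consumers20) (c₂₁ : Consumers21) (c₂₈ : Consumers28) (c₂₉ : Consumers29) :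
    Implications98 ν c c₁₉ c₂₀ c₂₁ c₂₈ c₂₉ (canon₉₈W ν c c₁₉ c₂₀ c₂₁ c₂₈ c₂₉) where
  dprtJL := fun k => k
  dprtCong := fun j => j
  ibuCompact := True.intro
  ibuParamodular := fun _ j v r k s => ⟨j, v, r, k, s⟩
  lz3 := fun b g p => ⟨⟨b, g⟩, p⟩

/-- Every ninety-eighth-tranche edge holds in the canonical instance, for arbitrary ν, μ, κ. [cite: DummiganEtAl2024, Thm 9.6; Ibukiyama2026, Thm 2.2; LoefflerZerbes2021DiagonalCycles, Thm 5.5.1 (bookkeeping proved here)] -/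
theorem canon_implications₉₈ :
    Implications98 ν (canon ν μ κ) (canon₁₉ ν μ κ) (canon₂₀ ν μ κ) (canon₂₁ ν μ κ) (canon₂₈ ν μ κ) (canon₂₉ ν μ κ) (canon₉₈ ν μ κ) :=
  canon_implications₉₈W ν _ _ _ _ _ _

/-- In the parametrised reading all five statements hold as soon as the book holds at all ranks and rows A4, C180, C182, C49, C90, C87 hold — through the tranche's bookkeeping theorems `dprt_of_C182`, `ibu_of_rows`, `lz3_of_book_and_rows`. [cite: DummiganEtAl2024, Thms 9.6, 11.3; Ibukiyama2026, Thms 2.1, 2.2; LoefflerZerbes2021DiagonalCycles, Thm 5.5.1 (bookkeeping proved here)] -/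
theorem c98_all_of (c : Consumers) (c₁₉ : Consumers19) (c₂₀ : Consumers20) (c₂₁ : Consumers21) (c₂₈ : Consumers28) (c₂₉ : Consumers29) (hν : ∀ N, ν.Everything N)
    (h₄ : c.GeeTaibi) (h₁₈₀ : c₁₉.SchmidtParamodular) (h₁₈₂ : c₂₀.SchmidtCAP) (h₄₉ : c₂₁.RSYCount) (h₉₀ : c₂₈.VanHoften) (h₈₇ : c₂₉.LPSZ) :
    (canon₉₈W ν c c₁₉ c₂₀ c₂₁ c₂₈ c₂₉).DPRTjl ∧ (canon₉₈W ν c c₁₉ c₂₀ c₂₁ c₂₈ c₂₉).DPRTcong ∧ (canon₉₈W ν c c₁₉ c₂₀ c₂₁ c₂₈ c₂₉).IbuCompact ∧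
      (canon₉₈W ν c c₁₉ c₂₀ c₂₁ c₂₈ c₂₉).IbuParamodular ∧ (canon₉₈W ν c c₁₉ c₂₀ c₂₁ c₂₈ c₂₉).LZ3padicL :=
  have X := canon_implications₉₈W ν c c₁₉ c₂₀ c₂₁ c₂₈ c₂₉
  have h1 := dprt_of_C182 X h₁₈₂
  have h2 := ibu_of_rows X h1.1 h₉₀ h₄₉ h₁₈₂ h₁₈₀
  ⟨h1.1, h1.2, h2.1, h2.2, lz3_of_book_and_rows X hν h₄ h₈₇⟩

end Canon98

/-- At the top (every input of the book; Mok and KMSW at the all-ones assignments, unread by the tranche; tranches 1 / 19 / 20 / 21 / 28 / 29 read canonically) all five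
statements hold, through the tranche's own `ninetyeighth_of_leaves`. [cite: DummiganEtAl2024, Thms 9.6, 11.3; Ibukiyama2026, Thms 2.1, 2.2; LoefflerZerbes2021DiagonalCycles, Thm 5.5.1 (bookkeeping proved here)] -/
theorem ninetyeighth_holds_top :
    (canon₉₈ νtop μtop κtop).DPRTjl ∧ (canon₉₈ νtop μtop κtop).DPRTcong ∧ (canon₉₈ νtop μtop κtop).IbuCompact ∧ (canon₉₈ νtop μtop κtop).IbuParamodular ∧
      (canon₉₈ νtop μtop κtop).LZ3padicL :=
  ninetyeighth_of_leaves (canon_implications₉₈ νtop μtop κtop) (canon_implications₂₈ νtop μtop κtop) (canon_implications₂₉ νtop μtop κtop) (canon_implications₂₁ νtop μtop κtop)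
    (canon_implications₂₀ νtop μtop κtop) (canon_implications₁₉ νtop μtop κtop) (canon_implications νtop μtop κtop) bookInputs_top

/-- BOOK SIDE, EXACT SUPPORT: in each of the 24 book countermodels (book edge systems and every other book leaf hold, the removed leaf fails; Mok and KMSW at the all-ones
assignments; tranches 1 / 19 / 20 / 21 / 28 / 29 / 98 read canonically over it, ALL their edges valid) the four Arthur-dependent statements FAIL and the control (C245's
Theorem 2.1) HOLDS — every one of the 24 book leaves is load-bearing, through row C182 (« By [ Sch20, Proposition 5.1] ») for C244, through rows C90 / C49 / C182 / C180 / C244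
(« [dummigan] », « [vanhoften] », « [royschmidtyi] Table 1 », « [schmidt] », « [schmidtpacket] ») for C245's Theorem 2.2, by name (« [arthur04,geetaibi18] ») and through rows
A4 / C87 for C246. [cite: DummiganEtAl2024, proof of Thm 9.6; Ibukiyama2026, §§2–3; LoefflerZerbes2021DiagonalCycles, Situation 3.4.1, proof of Thm 5.5.1; with Schmidt2020CAP Prop. 5.1, Vanhoften2021 Thm 3, RoySchmidtYi2021 Cor. 2.3, Schmidt2018Packet Thm 2.6, LoefflerPilloniSkinnerZerbes2021 Thms A–B, GeeTaibi2019 Thm 7.4.1 and Arthur2013 §1.5 (bookkeeping proved here)] -/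
theorem c98_book_cm (l : LeafSupport.Leaf) :
    LeafSupport.Systems (LeafSupport.mkN (LeafSupport.cm l)) (LeafSupport.mkW (LeafSupport.cm l)) (LeafSupport.mkG (LeafSupport.cm l)) ∧
      (∀ l', l' ≠ l → (LeafSupport.mkN (LeafSupport.cm l)).leaf l') ∧ ¬ (LeafSupport.mkN (LeafSupport.cm l)).leaf l ∧
      (Implications (LeafSupport.mkN (LeafSupport.cm l)) μtop κtop (canon (LeafSupport.mkN (LeafSupport.cm l)) μtop κtop) ∧
        Implications19 (LeafSupport.mkN (LeafSupport.cm l)) μtop κtop (canon₁₉ (LeafSupport.mkN (LeafSupport.cm l)) μtop κtop) ∧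
        Implications20 (LeafSupport.mkN (LeafSupport.cm l)) (canon₁₉ (LeafSupport.mkN (LeafSupport.cm l)) μtop κtop) (canon₂₀ (LeafSupport.mkN (LeafSupport.cm l)) μtop κtop) ∧
        Implications21 (LeafSupport.mkN (LeafSupport.cm l)) (canon₁₉ (LeafSupport.mkN (LeafSupport.cm l)) μtop κtop) (canon₂₀ (LeafSupport.mkN (LeafSupport.cm l)) μtop κtop) (canon₂₁ (LeafSupport.mkN (LeafSupport.cm l)) μtop κtop) ∧
        Implications28 (LeafSupport.mkN (LeafSupport.cm l)) μtop κtop (canon (LeafSupport.mkN (LeafSupport.cm l)) μtop κtop) (canon₁₉ (LeafSupport.mkN (LeafSupport.cm l)) μtop κtop) (canon₂₈ (LeafSupport.mkN (LeafSupport.cm l)) μtop κtop) ∧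
        Implications29 (LeafSupport.mkN (LeafSupport.cm l)) (canon (LeafSupport.mkN (LeafSupport.cm l)) μtop κtop) (canon₁₉ (LeafSupport.mkN (LeafSupport.cm l)) μtop κtop) (canon₂₈ (LeafSupport.mkN (LeafSupport.cm l)) μtop κtop) (canon₂₉ (LeafSupport.mkN (LeafSupport.cm l)) μtop κtop) ∧
        Implications98 (LeafSupport.mkN (LeafSupport.cm l)) (canon (LeafSupport.mkN (LeafSupport.cm l)) μtop κtop) (canon₁₉ (LeafSupport.mkN (LeafSupport.cm l)) μtop κtop) (canon₂₀ (LeafSupport.mkN (LeafSupport.cm l)) μtop κtop) (canon₂₁ (LeafSupport.mkN (LeafSupport.cm l)) μtop κtop) (canon₂₈ (LeafSupport.mkN (LeafSupport.cm l)) μtop κtop) (canon₂₉ (LeafSupport.mkN (LeafSupport.cm l)) μtop κtop) (canon₉₈ (LeafSupport.mkN (LeafSupport.cm l)) μtop κtop)) ∧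
      (¬ (canon₉₈ (LeafSupport.mkN (LeafSupport.cm l)) μtop κtop).DPRTjl ∧ ¬ (canon₉₈ (LeafSupport.mkN (LeafSupport.cm l)) μtop κtop).DPRTcong ∧
        (canon₉₈ (LeafSupport.mkN (LeafSupport.cm l)) μtop κtop).IbuCompact ∧ ¬ (canon₉₈ (LeafSupport.mkN (LeafSupport.cm l)) μtop κtop).IbuParamodular ∧
        ¬ (canon₉₈ (LeafSupport.mkN (LeafSupport.cm l)) μtop κtop).LZ3padicL) :=
  have cmod := LeafSupport.countermodel l
  have nb := not_B_cm l
  ⟨cmod.1, cmod.2.1, cmod.2.2.1,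
    ⟨canon_implications _ _ _, canon_implications₁₉ _ _ _, canon_implications₂₀ _ _ _, canon_implications₂₁ _ _ _, canon_implications₂₈ _ _ _, canon_implications₂₉ _ _ _,
      canon_implications₉₈ _ _ _⟩,
    ⟨fun h => nb h.1, fun h => nb h.1, True.intro, fun h => nb h.1.1, fun h => nb h.1.1⟩⟩

/-- Row C182 DENIED at the top (section 25's `canon₂₀noCAP` / `canon₂₁noC182`: C49 falls with it; C180, C90, C87, A4 canonical): the tranche-98 reading over it. [cite: DummiganEtAl2024, proof of Thm 9.6 (« By [ Sch20, Proposition 5.1] ») (separating model; bookkeeping)] -/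
abbrev canon₉₈noC182 : Consumers98 :=
  canon₉₈W νtop (canon νtop μtop κtop) (canon₁₉ νtop μtop κtop) (canon₂₀noCAP νtop μtop κtop) (canon₂₁noC182 νtop μtop κtop) (canon₂₈ νtop μtop κtop) (canon₂₉ νtop μtop κtop)

/-- Row C90 ALONE DENIED at the top (section 97's `c₂₈noC90`; every other premise canonical): the tranche-98 reading over it. [cite: Ibukiyama2026, §2 (« [vanhoften] ») (separating model; bookkeeping)] -/
abbrev canon₉₈noC90 : Consumers98 :=
  canon₉₈W νtop (canon νtop μtop κtop) (canon₁₉ νtop μtop κtop) (canon₂₀ νtop μtop κtop) (canon₂₁ νtop μtop κtop) c₂₈noC90 (canon₂₉ νtop μtop κtop)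

/-- Row C49 ALONE DENIED at the top (section 26's `canon₂₁noC49`; every other premise canonical): the tranche-98 reading over it. [cite: Ibukiyama2026, §3 (« [royschmidtyi] Table 1 ») (separating model; bookkeeping)] -/
abbrev canon₉₈noC49 : Consumers98 :=
  canon₉₈W νtop (canon νtop μtop κtop) (canon₁₉ νtop μtop κtop) (canon₂₀ νtop μtop κtop) (canon₂₁noC49 νtop μtop κtop) (canon₂₈ νtop μtop κtop) (canon₂₉ νtop μtop κtop)

/-- Row C180 DENIED at the top with C182 and C49 FREE-STANDING (section 25's `c₁₉noConduit` / `canon₂₀free` / `canon₂₁noC180`; C90, C87, A4 canonical): the tranche-98 reading over it. [cite: Ibukiyama2026, §3 (« [schmidtpacket] ») (separating model; bookkeeping)] -/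
abbrev canon₉₈noC180 : Consumers98 :=
  canon₉₈W νtop (canon νtop μtop κtop) (c₁₉noConduit μtop κtop) canon₂₀free canon₂₁noC180 (canon₂₈ νtop μtop κtop) (canon₂₉ νtop μtop κtop)

/-- Row C87 DENIED at the top (section 37's `canon₂₉noC87`; every other premise canonical): the tranche-98 reading over it. [cite: LoefflerZerbes2021DiagonalCycles, proof of Thm 5.5.1 (« Theorem 5.11 and Corollary 6.17 of [LPSZ1] ») (separating model; bookkeeping)] -/
abbrev canon₉₈noC87 : Consumers98 :=
  canon₉₈W νtop (canon νtop μtop κtop) (canon₁₉ νtop μtop κtop) (canon₂₀ νtop μtop κtop) (canon₂₁ νtop μtop κtop) (canon₂₈ νtop μtop κtop) (canon₂₉noC87 νtop μtop κtop)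

/-- Row A4 DENIED at the reading level (section 95's `c₁noA4`; C90 and C87 read canonically, i.e. free-standing over it; C180, C182, C49 canonical): the tranche-98 reading over it. [cite: LoefflerZerbes2021DiagonalCycles, Situation 3.4.1 (« [arthur04,geetaibi18] ») (separating model; bookkeeping)] -/
abbrev canon₉₈noA4 : Consumers98 :=
  canon₉₈W νtop c₁noA4 (canon₁₉ νtop μtop κtop) (canon₂₀ νtop μtop κtop) (canon₂₁ νtop μtop κtop) (canon₂₈ νtop μtop κtop) (canon₂₉ νtop μtop κtop)

/-- THE PREMISES ARE LOAD-BEARING EXACTLY AS TYPED (reading-level separation at the top; the tranche-98 edges hold over each denied assignment): (a) C182 DENIED (C49 with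
it) ⇒ both C244 fields and C245's Theorem 2.2 FAIL, C245's Theorem 2.1 and C246 HOLD; (b) C90 ALONE DENIED ⇒ only C245's Theorem 2.2 FAILS; (c) C49 ALONE DENIED ⇒ only
C245's Theorem 2.2 FAILS; (d) C180 DENIED (C182, C49 free-standing) ⇒ C245's Theorem 2.2 FAILS, C244 HOLDS free-standing, C246 HOLDS; (e) C87 DENIED ⇒ only C246 FAILS;
(f) A4 DENIED at the reading level (C90 / C87 free-standing) ⇒ only C246 FAILS. [cite: DummiganEtAl2024, proof of Thm 9.6; Ibukiyama2026, §§2–3; LoefflerZerbes2021DiagonalCycles, Situation 3.4.1 and proof of Thm 5.5.1 (separating models; bookkeeping proved here)] -/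
theorem c98_denied_top :
    (Implications98 νtop (canon νtop μtop κtop) (canon₁₉ νtop μtop κtop) (canon₂₀noCAP νtop μtop κtop) (canon₂₁noC182 νtop μtop κtop) (canon₂₈ νtop μtop κtop)
          (canon₂₉ νtop μtop κtop) canon₉₈noC182 ∧
        ¬ canon₉₈noC182.DPRTjl ∧ ¬ canon₉₈noC182.DPRTcong ∧ canon₉₈noC182.IbuCompact ∧ ¬ canon₉₈noC182.IbuParamodular ∧ canon₉₈noC182.LZ3padicL) ∧
      (Implications98 νtop (canon νtop μtop κtop) (canon₁₉ νtop μtop κtop) (canon₂₀ νtop μtop κtop) (canon₂₁ νtop μtop κtop) c₂₈noC90 (canon₂₉ νtop μtop κtop) canon₉₈noC90 ∧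
        canon₉₈noC90.DPRTjl ∧ canon₉₈noC90.DPRTcong ∧ ¬ canon₉₈noC90.IbuParamodular ∧ canon₉₈noC90.LZ3padicL) ∧
      (Implications98 νtop (canon νtop μtop κtop) (canon₁₉ νtop μtop κtop) (canon₂₀ νtop μtop κtop) (canon₂₁noC49 νtop μtop κtop) (canon₂₈ νtop μtop κtop)
          (canon₂₉ νtop μtop κtop) canon₉₈noC49 ∧
        canon₉₈noC49.DPRTjl ∧ canon₉₈noC49.DPRTcong ∧ ¬ canon₉₈noC49.IbuParamodular ∧ canon₉₈noC49.LZ3padicL) ∧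
      (Implications98 νtop (canon νtop μtop κtop) (c₁₉noConduit μtop κtop) canon₂₀free canon₂₁noC180 (canon₂₈ νtop μtop κtop) (canon₂₉ νtop μtop κtop) canon₉₈noC180 ∧
        canon₉₈noC180.DPRTjl ∧ ¬ canon₉₈noC180.IbuParamodular ∧ canon₉₈noC180.LZ3padicL) ∧
      (Implications98 νtop (canon νtop μtop κtop) (canon₁₉ νtop μtop κtop) (canon₂₀ νtop μtop κtop) (canon₂₁ νtop μtop κtop) (canon₂₈ νtop μtop κtop)
          (canon₂₉noC87 νtop μtop κtop) canon₉₈noC87 ∧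
        canon₉₈noC87.DPRTjl ∧ canon₉₈noC87.IbuParamodular ∧ ¬ canon₉₈noC87.LZ3padicL) ∧
      (Implications98 νtop c₁noA4 (canon₁₉ νtop μtop κtop) (canon₂₀ νtop μtop κtop) (canon₂₁ νtop μtop κtop) (canon₂₈ νtop μtop κtop) (canon₂₉ νtop μtop κtop) canon₉₈noA4 ∧
        canon₉₈noA4.DPRTjl ∧ canon₉₈noA4.IbuParamodular ∧ ¬ canon₉₈noA4.LZ3padicL) :=
  have b : ∀ N, νtop.Everything N := bookInputs_top.everything
  ⟨⟨canon_implications₉₈W _ _ _ _ _ _ _, fun h => h, fun h => h, True.intro, fun h => h.1, ⟨⟨b, b⟩, ⟨b, b⟩⟩⟩,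
    ⟨canon_implications₉₈W _ _ _ _ _ _ _, ⟨b, b⟩, ⟨b, b⟩, fun h => h.2.1, ⟨⟨b, b⟩, ⟨b, b⟩⟩⟩,
    ⟨canon_implications₉₈W _ _ _ _ _ _ _, ⟨b, b⟩, ⟨b, b⟩, fun h => h.2.2.1, ⟨⟨b, b⟩, ⟨b, b⟩⟩⟩,
    ⟨canon_implications₉₈W _ _ _ _ _ _ _, True.intro, fun h => h.2.2.2.2, ⟨⟨b, b⟩, ⟨b, b⟩⟩⟩,
    ⟨canon_implications₉₈W _ _ _ _ _ _ _, ⟨b, b⟩, ⟨⟨b, b⟩, ⟨b, b⟩, ⟨b, ⟨b, b⟩⟩, ⟨b, b⟩, b⟩, fun h => h.2⟩,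
    ⟨canon_implications₉₈W _ _ _ _ _ _ _, ⟨b, b⟩, ⟨⟨b, b⟩, ⟨b, b⟩, ⟨b, ⟨b, b⟩⟩, ⟨b, b⟩, b⟩, fun h => h.1.2⟩⟩

/-- UNITARY SIDE: in each of Mok's 29 countermodels (KMSW = `κnoMok`) and in each of KMSW's countermodels, the book at the all-ones assignment (canonical readings over it),
ALL FIVE typed statements HOLD — no statement of Mok 2015 or KMSW occurs in the tranche's edges (GSp_4, its inner forms and Siegel / paramodular forms over ℚ throughout).
[cite: DummiganEtAl2024, Thm 9.6; Ibukiyama2026, Thm 2.2; LoefflerZerbes2021DiagonalCycles, Thm 5.5.1 (bookkeeping proved here)] -/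
theorem c98_unitary_independent (l : Mok2015.LeafSupport.Leaf) (l' : KMSW2014.LeafSupport.Leaf) :
    ((canon₉₈ νtop (Mok2015.LeafSupport.mkN (Mok2015.LeafSupport.cm l)) κnoMok).DPRTjl ∧ (canon₉₈ νtop (Mok2015.LeafSupport.mkN (Mok2015.LeafSupport.cm l)) κnoMok).DPRTcong ∧
        (canon₉₈ νtop (Mok2015.LeafSupport.mkN (Mok2015.LeafSupport.cm l)) κnoMok).IbuCompact ∧ (canon₉₈ νtop (Mok2015.LeafSupport.mkN (Mok2015.LeafSupport.cm l)) κnoMok).IbuParamodular ∧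
        (canon₉₈ νtop (Mok2015.LeafSupport.mkN (Mok2015.LeafSupport.cm l)) κnoMok).LZ3padicL) ∧
      ((canon₉₈ νtop μtop (KMSW2014.LeafSupport.mkN (KMSW2014.LeafSupport.cm l'))).DPRTjl ∧ (canon₉₈ νtop μtop (KMSW2014.LeafSupport.mkN (KMSW2014.LeafSupport.cm l'))).DPRTcong ∧
        (canon₉₈ νtop μtop (KMSW2014.LeafSupport.mkN (KMSW2014.LeafSupport.cm l'))).IbuCompact ∧ (canon₉₈ νtop μtop (KMSW2014.LeafSupport.mkN (KMSW2014.LeafSupport.cm l'))).IbuParamodular ∧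
        (canon₉₈ νtop μtop (KMSW2014.LeafSupport.mkN (KMSW2014.LeafSupport.cm l'))).LZ3padicL) :=
  have b : ∀ N, νtop.Everything N := bookInputs_top.everything
  ⟨⟨⟨b, b⟩, ⟨b, b⟩, True.intro, ⟨⟨b, b⟩, ⟨b, b⟩, ⟨b, ⟨b, b⟩⟩, ⟨b, b⟩, b⟩, ⟨⟨b, b⟩, ⟨b, b⟩⟩⟩,
    ⟨⟨b, b⟩, ⟨b, b⟩, True.intro, ⟨⟨b, b⟩, ⟨b, b⟩, ⟨b, ⟨b, b⟩⟩, ⟨b, b⟩, b⟩, ⟨⟨b, b⟩, ⟨b, b⟩⟩⟩⟩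

/-- THE NINETY-EIGHTH TRANCHE REGRADED, in one statement: (i) at the top all five hold; (ii) in the book countermodel of ANY leaf the four Arthur-dependent statements fail
and the control holds; (iii) C182 denied: C244 fails, C246 holds; C90 / C49 / C180 denied: C245's Theorem 2.2 fails (C244 holding free-standing over the denied C180);
C87 denied and A4 denied: C246 fails, C245's Theorem 2.2 holds; (iv) in every Mok / KMSW countermodel (book at the top) C244, C245's Theorem 2.2 and C246 hold.  Supports:
book 24 for each of the four Arthur-dependent statements (through C182 / C180; through C90 / C49 / C182 / C180 / C244; through A4 / C87), ∅ for the control; nothing of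
Mok 2015 or KMSW. [cite: DummiganEtAl2024, Thms 9.6, 11.3; Ibukiyama2026, Thms 2.1, 2.2; LoefflerZerbes2021DiagonalCycles, Thm 5.5.1 (bookkeeping proved here)] -/
theorem c98_regraded :
    ((canon₉₈ νtop μtop κtop).DPRTjl ∧ (canon₉₈ νtop μtop κtop).DPRTcong ∧ (canon₉₈ νtop μtop κtop).IbuCompact ∧ (canon₉₈ νtop μtop κtop).IbuParamodular ∧
        (canon₉₈ νtop μtop κtop).LZ3padicL) ∧
      (∀ l : LeafSupport.Leaf, ¬ (LeafSupport.mkN (LeafSupport.cm l)).leaf l ∧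
        ¬ (canon₉₈ (LeafSupport.mkN (LeafSupport.cm l)) μtop κtop).DPRTjl ∧ ¬ (canon₉₈ (LeafSupport.mkN (LeafSupport.cm l)) μtop κtop).DPRTcong ∧
        (canon₉₈ (LeafSupport.mkN (LeafSupport.cm l)) μtop κtop).IbuCompact ∧ ¬ (canon₉₈ (LeafSupport.mkN (LeafSupport.cm l)) μtop κtop).IbuParamodular ∧
        ¬ (canon₉₈ (LeafSupport.mkN (LeafSupport.cm l)) μtop κtop).LZ3padicL) ∧
      (¬ canon₉₈noC182.DPRTjl ∧ canon₉₈noC182.LZ3padicL ∧ ¬ canon₉₈noC90.IbuParamodular ∧ ¬ canon₉₈noC49.IbuParamodular ∧ ¬ canon₉₈noC180.IbuParamodular ∧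
        canon₉₈noC180.DPRTjl ∧ ¬ canon₉₈noC87.LZ3padicL ∧ canon₉₈noC87.IbuParamodular ∧ ¬ canon₉₈noA4.LZ3padicL ∧ canon₉₈noA4.IbuParamodular) ∧
      (∀ (l : Mok2015.LeafSupport.Leaf) (l' : KMSW2014.LeafSupport.Leaf),
        ((canon₉₈ νtop (Mok2015.LeafSupport.mkN (Mok2015.LeafSupport.cm l)) κnoMok).DPRTjl ∧ (canon₉₈ νtop (Mok2015.LeafSupport.mkN (Mok2015.LeafSupport.cm l)) κnoMok).IbuParamodular ∧
          (canon₉₈ νtop (Mok2015.LeafSupport.mkN (Mok2015.LeafSupport.cm l)) κnoMok).LZ3padicL) ∧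
        ((canon₉₈ νtop μtop (KMSW2014.LeafSupport.mkN (KMSW2014.LeafSupport.cm l'))).DPRTjl ∧ (canon₉₈ νtop μtop (KMSW2014.LeafSupport.mkN (KMSW2014.LeafSupport.cm l'))).IbuParamodular ∧
          (canon₉₈ νtop μtop (KMSW2014.LeafSupport.mkN (KMSW2014.LeafSupport.cm l'))).LZ3padicL)) :=
  have ⟨⟨_, a1, _, _, _, a2⟩, ⟨_, _, _, b1, _⟩, ⟨_, _, _, c1, _⟩, ⟨_, d1, d2, _⟩, ⟨_, _, e1, e2⟩, ⟨_, _, f1, f2⟩⟩ := c98_denied_top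
  ⟨ninetyeighth_holds_top,
    fun l => have h := c98_book_cm l
      ⟨h.2.2.1, h.2.2.2.2⟩,
    ⟨a1, a2, b1, c1, d2, d1, e2, e1, f2, f1⟩,
    fun l l' => have h := c98_unitary_independent l l'
      ⟨⟨h.1.1, h.1.2.2.2.1, h.1.2.2.2.2⟩, ⟨h.2.1, h.2.2.2.2.1, h.2.2.2.2.2⟩⟩⟩


/-! ## 102. Ninety-ninth tranche (v4 of this file, after `Downstream29.lean` v4; unit `pub-arthur-down-g39`): supports of NEW rows C247 `BCisotypic` (⇐ book ∧ C180 ∧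
C184) and C248 `PSSdeg5` (⇐ book ∧ C180) / `PSSsym4` (⇐ `PSSdeg5`); see the module docstring for the summary. -/

section Canon99

variable (ν : Nodes) (μ : Mok2015.Nodes) (κ : KMSW2014.Nodes)

/-- The parametrised canonical reading of the ninety-ninth tranche: the assignments `c₁₉`, `c₂₂` of tranches 19 / 22 are the parameters; C247 := book ∧ C180 ∧ C184; C248 (both fields) := book ∧ C180. [cite: BergstromClery2025Level2, Thm 5.3; PitaleSahaSchmidt2021StandardL, Thms 1.1, 1.5 (canonical model; bookkeeping)] -/
abbrev canon₉₉W (c₁₉ : Consumers19) (c₂₂ : Consumers22) : Consumers99 where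
  BCisotypic := (∀ N, ν.Everything N) ∧ c₁₉.SchmidtParamodular ∧ c₂₂.RSYLevel4
  PSSdeg5 := (∀ N, ν.Everything N) ∧ c₁₉.SchmidtParamodular
  PSSsym4 := (∀ N, ν.Everything N) ∧ c₁₉.SchmidtParamodular

/-- The canonical instance: the parametrised reading over the canonical readings `canon₁₉`, `canon₂₂` of tranches 19 / 22 (there `SchmidtParamodular := ∀ N, ν.Everything N`, `RSYLevel4 := book ∧ C182 ∧ C49`). [cite: BergstromClery2025Level2, Thm 5.3; PitaleSahaSchmidt2021StandardL, Thm 1.1 (canonical model; bookkeeping)] -/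
abbrev canon₉₉ : Consumers99 := canon₉₉W ν (canon₁₉ ν μ κ) (canon₂₂ ν μ κ)

/-- Every ninety-ninth-tranche edge holds in the parametrised reading, for arbitrary ν and EVERY assignment of tranches 19 / 22. [cite: BergstromClery2025Level2, Thm 5.3; PitaleSahaSchmidt2021StandardL, Thms 1.1, 1.5 (bookkeeping proved here)] -/
theorem canon_implications₉₉W (c₁₉ : Consumers19) (c₂₂ : Consumers22) : Implications99 ν c₁₉ c₂₂ (canon₉₉W ν c₁₉ c₂₂) where
  bc := fun a s r => ⟨a, s, r⟩
  pssDeg5 := fun a s => ⟨a, s⟩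
  pssSym4 := fun h => h

/-- Every ninety-ninth-tranche edge holds in the canonical instance, for arbitrary ν, μ, κ. [cite: BergstromClery2025Level2, Thm 5.3; PitaleSahaSchmidt2021StandardL, Thm 1.1 (bookkeeping proved here)] -/
theorem canon_implications₉₉ : Implications99 ν (canon₁₉ ν μ κ) (canon₂₂ ν μ κ) (canon₉₉ ν μ κ) :=
  canon_implications₉₉W ν _ _

/-- In the parametrised reading all three statements hold as soon as the book holds at all ranks and rows C180, C184 hold — through the tranche's bookkeeping theorems `bc_of_book_and_rows`, `pss_of_book_and_C180`. [cite: BergstromClery2025Level2, Thm 5.3; PitaleSahaSchmidt2021StandardL, Thms 1.1, 1.5 (bookkeeping proved here)] -/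
theorem c99_all_of (c₁₉ : Consumers19) (c₂₂ : Consumers22) (hν : ∀ N, ν.Everything N) (h₁₈₀ : c₁₉.SchmidtParamodular) (h₁₈₄ : c₂₂.RSYLevel4) :
    (canon₉₉W ν c₁₉ c₂₂).BCisotypic ∧ (canon₉₉W ν c₁₉ c₂₂).PSSdeg5 ∧ (canon₉₉W ν c₁₉ c₂₂).PSSsym4 :=
  have X := canon_implications₉₉W ν c₁₉ c₂₂
  have h := pss_of_book_and_C180 X hν h₁₈₀
  ⟨bc_of_book_and_rows X hν h₁₈₀ h₁₈₄, h.1, h.2⟩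

end Canon99

/-- At the top (every input of the book; Mok and KMSW at the all-ones assignments, unread by the tranche; tranches 19 / 20 / 21 / 22 read canonically) all three statements hold,
through the tranche's own `ninetyninth_of_leaves`. [cite: BergstromClery2025Level2, Thm 5.3; PitaleSahaSchmidt2021StandardL, Thms 1.1, 1.5 (bookkeeping proved here)] -/
theorem ninetyninth_holds_top : (canon₉₉ νtop μtop κtop).BCisotypic ∧ (canon₉₉ νtop μtop κtop).PSSdeg5 ∧ (canon₉₉ νtop μtop κtop).PSSsym4 :=
  ninetyninth_of_leaves (canon_implications₉₉ νtop μtop κtop) (canon_implications₂₂ νtop μtop κtop) (canon_implications₂₁ νtop μtop κtop) (canon_implications₂₀ νtop μtop κtop)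
    (canon_implications₁₉ νtop μtop κtop) bookInputs_top

/-- BOOK SIDE, EXACT SUPPORT: in each of the 24 book countermodels (book edge systems and every other book leaf hold, the removed leaf fails; Mok and KMSW at the all-ones
assignments; tranches 19 / 20 / 21 / 22 / 99 read canonically over it, ALL their edges valid) ALL THREE statements FAIL — every one of the 24 book leaves is load-bearing, by
name (« [2] » / « [arthur-book] ») and through row C180 (« [24, Section 2.1] » / « [ralf-packets] »), for C247 also through row C184 (« [23, Proposition 4. 3] »).
[cite: BergstromClery2025Level2, §2 eq. (3); PitaleSahaSchmidt2021StandardL, Remark 1.2 and §7.1; with Schmidt2018Packet Thm 2.6, RoySchmidtYi2023 Prop. 4.3 and Arthur2013 §1.5 (bookkeeping proved here)] -/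
theorem c99_book_cm (l : LeafSupport.Leaf) :
    LeafSupport.Systems (LeafSupport.mkN (LeafSupport.cm l)) (LeafSupport.mkW (LeafSupport.cm l)) (LeafSupport.mkG (LeafSupport.cm l)) ∧
      (∀ l', l' ≠ l → (LeafSupport.mkN (LeafSupport.cm l)).leaf l') ∧ ¬ (LeafSupport.mkN (LeafSupport.cm l)).leaf l ∧
      (Implications19 (LeafSupport.mkN (LeafSupport.cm l)) μtop κtop (canon₁₉ (LeafSupport.mkN (LeafSupport.cm l)) μtop κtop) ∧
        Implications20 (LeafSupport.mkN (LeafSupport.cm l)) (canon₁₉ (LeafSupport.mkN (LeafSupport.cm l)) μtop κtop) (canon₂₀ (LeafSupport.mkN (LeafSupport.cm l)) μtop κtop) ∧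
        Implications21 (LeafSupport.mkN (LeafSupport.cm l)) (canon₁₉ (LeafSupport.mkN (LeafSupport.cm l)) μtop κtop) (canon₂₀ (LeafSupport.mkN (LeafSupport.cm l)) μtop κtop) (canon₂₁ (LeafSupport.mkN (LeafSupport.cm l)) μtop κtop) ∧
        Implications22 (LeafSupport.mkN (LeafSupport.cm l)) (canon₂₀ (LeafSupport.mkN (LeafSupport.cm l)) μtop κtop) (canon₂₁ (LeafSupport.mkN (LeafSupport.cm l)) μtop κtop) (canon₂₂ (LeafSupport.mkN (LeafSupport.cm l)) μtop κtop) ∧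
        Implications99 (LeafSupport.mkN (LeafSupport.cm l)) (canon₁₉ (LeafSupport.mkN (LeafSupport.cm l)) μtop κtop) (canon₂₂ (LeafSupport.mkN (LeafSupport.cm l)) μtop κtop) (canon₉₉ (LeafSupport.mkN (LeafSupport.cm l)) μtop κtop)) ∧
      (¬ (canon₉₉ (LeafSupport.mkN (LeafSupport.cm l)) μtop κtop).BCisotypic ∧ ¬ (canon₉₉ (LeafSupport.mkN (LeafSupport.cm l)) μtop κtop).PSSdeg5 ∧
        ¬ (canon₉₉ (LeafSupport.mkN (LeafSupport.cm l)) μtop κtop).PSSsym4) :=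
  have cmod := LeafSupport.countermodel l
  have nb := not_B_cm l
  ⟨cmod.1, cmod.2.1, cmod.2.2.1,
    ⟨canon_implications₁₉ _ _ _, canon_implications₂₀ _ _ _, canon_implications₂₁ _ _ _, canon_implications₂₂ _ _ _, canon_implications₉₉ _ _ _⟩,
    ⟨fun h => nb h.1, fun h => nb h.1, fun h => nb h.1⟩⟩

/-- Row C180 DENIED at the top with C184 FREE-STANDING (section 25's `c₁₉noConduit`; `canon₂₂` at the top): the tranche-99 reading over it. [cite: PitaleSahaSchmidt2021StandardL, §7.1 (« see [ralf-packets] »); BergstromClery2025Level2, §2 (« [24, Section 2.1] ») (separating model; bookkeeping)] -/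
abbrev canon₉₉noC180 : Consumers99 := canon₉₉W νtop (c₁₉noConduit μtop κtop) (canon₂₂ νtop μtop κtop)

/-- Row C184 ALONE DENIED at the top (section 26's `canon₂₂no`; C180 canonical): the tranche-99 reading over it. [cite: BergstromClery2025Level2, §2 (« [23, Proposition 4. 3] ») (separating model; bookkeeping)] -/
abbrev canon₉₉noC184 : Consumers99 := canon₉₉W νtop (canon₁₉ νtop μtop κtop) canon₂₂no

/-- THE PREMISES ARE LOAD-BEARING EXACTLY AS TYPED (reading-level separation at the top; the tranche-99 edges hold over each denied assignment): (a) C180 DENIED (C184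
free-standing) ⇒ ALL THREE FAIL; (b) C184 ALONE DENIED ⇒ C247 FAILS, both C248 statements HOLD. [cite: BergstromClery2025Level2, §2 eq. (3); PitaleSahaSchmidt2021StandardL, Remark 1.2 (separating models; bookkeeping proved here)] -/
theorem c99_denied_top :
    (Implications99 νtop (c₁₉noConduit μtop κtop) (canon₂₂ νtop μtop κtop) canon₉₉noC180 ∧
        ¬ canon₉₉noC180.BCisotypic ∧ ¬ canon₉₉noC180.PSSdeg5 ∧ ¬ canon₉₉noC180.PSSsym4) ∧
      (Implications99 νtop (canon₁₉ νtop μtop κtop) canon₂₂no canon₉₉noC184 ∧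
        ¬ canon₉₉noC184.BCisotypic ∧ canon₉₉noC184.PSSdeg5 ∧ canon₉₉noC184.PSSsym4) :=
  have b : ∀ N, νtop.Everything N := bookInputs_top.everything
  ⟨⟨canon_implications₉₉W _ _ _, fun h => h.2.1, fun h => h.2, fun h => h.2⟩,
    ⟨canon_implications₉₉W _ _ _, fun h => h.2.2, ⟨b, b⟩, ⟨b, b⟩⟩⟩

/-- UNITARY SIDE: in each of Mok's 29 countermodels (KMSW = `κnoMok`) and in each of KMSW's countermodels, the book at the all-ones assignment (canonical readings over it),
ALL THREE typed statements HOLD — no statement of Mok 2015 or KMSW occurs in the tranche's edges (GSp_4 / Sp_4 over ℚ throughout). [cite: BergstromClery2025Level2, Thm 5.3; PitaleSahaSchmidt2021StandardL, Thms 1.1, 1.5 (bookkeeping proved here)] -/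
theorem c99_unitary_independent (l : Mok2015.LeafSupport.Leaf) (l' : KMSW2014.LeafSupport.Leaf) :
    ((canon₉₉ νtop (Mok2015.LeafSupport.mkN (Mok2015.LeafSupport.cm l)) κnoMok).BCisotypic ∧ (canon₉₉ νtop (Mok2015.LeafSupport.mkN (Mok2015.LeafSupport.cm l)) κnoMok).PSSdeg5 ∧
        (canon₉₉ νtop (Mok2015.LeafSupport.mkN (Mok2015.LeafSupport.cm l)) κnoMok).PSSsym4) ∧
      ((canon₉₉ νtop μtop (KMSW2014.LeafSupport.mkN (KMSW2014.LeafSupport.cm l'))).BCisotypic ∧ (canon₉₉ νtop μtop (KMSW2014.LeafSupport.mkN (KMSW2014.LeafSupport.cm l'))).PSSdeg5 ∧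
        (canon₉₉ νtop μtop (KMSW2014.LeafSupport.mkN (KMSW2014.LeafSupport.cm l'))).PSSsym4) :=
  have b : ∀ N, νtop.Everything N := bookInputs_top.everything
  ⟨⟨⟨b, b, ⟨b, ⟨b, b⟩, ⟨b, ⟨b, b⟩⟩⟩⟩, ⟨b, b⟩, ⟨b, b⟩⟩, ⟨⟨b, b, ⟨b, ⟨b, b⟩, ⟨b, ⟨b, b⟩⟩⟩⟩, ⟨b, b⟩, ⟨b, b⟩⟩⟩

/-- THE NINETY-NINTH TRANCHE REGRADED, in one statement: (i) at the top all three hold; (ii) in the book countermodel of ANY leaf all three fail; (iii) C180 denied (C184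
free-standing): C247 and C248 fail; C184 denied: C247 fails, C248 holds; (iv) in every Mok / KMSW countermodel (book at the top) all hold.  Supports: book 24 for each of the
three statements (by name; through C180; through C184); nothing of Mok 2015 or KMSW. [cite: BergstromClery2025Level2, Thm 5.3; PitaleSahaSchmidt2021StandardL, Thms 1.1, 1.5 (bookkeeping proved here)] -/
theorem c99_regraded :
    ((canon₉₉ νtop μtop κtop).BCisotypic ∧ (canon₉₉ νtop μtop κtop).PSSdeg5 ∧ (canon₉₉ νtop μtop κtop).PSSsym4) ∧
      (∀ l : LeafSupport.Leaf, ¬ (LeafSupport.mkN (LeafSupport.cm l)).leaf l ∧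
        ¬ (canon₉₉ (LeafSupport.mkN (LeafSupport.cm l)) μtop κtop).BCisotypic ∧ ¬ (canon₉₉ (LeafSupport.mkN (LeafSupport.cm l)) μtop κtop).PSSdeg5 ∧
        ¬ (canon₉₉ (LeafSupport.mkN (LeafSupport.cm l)) μtop κtop).PSSsym4) ∧
      (¬ canon₉₉noC180.BCisotypic ∧ ¬ canon₉₉noC180.PSSdeg5 ∧ ¬ canon₉₉noC184.BCisotypic ∧ canon₉₉noC184.PSSdeg5) ∧
      (∀ (l : Mok2015.LeafSupport.Leaf) (l' : KMSW2014.LeafSupport.Leaf),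
        (canon₉₉ νtop (Mok2015.LeafSupport.mkN (Mok2015.LeafSupport.cm l)) κnoMok).BCisotypic ∧ (canon₉₉ νtop (Mok2015.LeafSupport.mkN (Mok2015.LeafSupport.cm l)) κnoMok).PSSdeg5 ∧
        (canon₉₉ νtop μtop (KMSW2014.LeafSupport.mkN (KMSW2014.LeafSupport.cm l'))).BCisotypic ∧ (canon₉₉ νtop μtop (KMSW2014.LeafSupport.mkN (KMSW2014.LeafSupport.cm l'))).PSSdeg5) :=
  have ⟨⟨_, a1, a2, _⟩, ⟨_, b1, b2, _⟩⟩ := c99_denied_top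
  ⟨ninetyninth_holds_top,
    fun l => have h := c99_book_cm l
      ⟨h.2.2.1, h.2.2.2.2⟩,
    ⟨a1, a2, b1, b2⟩,
    fun l l' => have h := c99_unitary_independent l l'
      ⟨h.1.1, h.1.2.1, h.2.1, h.2.2.1⟩⟩


/-! ## 103. Hundredth tranche (v5 of this file, after the NEW `Downstream30.lean` v1; unit `pub-arthur-down-g39`): supports of NEW rows C249 `DTresidual` (⇐ C244), C250
`RRYcong` (⇐ C49) and C251 `DangRB` (⇐ book ∧ C90 ∧ C244 ∧ C180); see the module docstring for the summary. -/

section Canon100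

variable (ν : Nodes) (μ : Mok2015.Nodes) (κ : KMSW2014.Nodes)

/-- The parametrised canonical reading of the hundredth tranche: the assignments `c₁₉`, `c₂₁`, `c₂₈`, `c₉₈` of tranches 19 / 21 / 28 / 98 are the parameters; C249 := C244's `DPRTjl`; C250 := C49; C251 := book ∧ C90 ∧ C244 ∧ C180. [cite: DummiganTornaria2026Residual, Thm 1.1; RayRoyYi2021DimensionCongruences, Thm 3.1; Dang2026RichelotBrandt, Thm 2.4 (canonical model; bookkeeping)] -/
abbrev canon₁₀₀W (c₁₉ : Consumers19) (c₂₁ : Consumers21) (c₂₈ : Consumers28) (c₉₈ : Consumers98) : Consumers100 where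
  DTresidual := c₉₈.DPRTjl
  RRYcong := c₂₁.RSYCount
  DangRB := (∀ N, ν.Everything N) ∧ c₂₈.VanHoften ∧ c₉₈.DPRTjl ∧ c₁₉.SchmidtParamodular

/-- The canonical instance: the parametrised reading over `canon₁₉`, `canon₂₁`, `canon₂₈` and section 101's `canon₉₈` (there `DPRTjl := (canon₂₀ ν μ κ).SchmidtCAP = book ∧ C180`, `RSYCount := book ∧ C182`, `VanHoften := book ∧ A4`). [cite: DummiganTornaria2026Residual, Thm 1.1; RayRoyYi2021DimensionCongruences, Thm 3.1; Dang2026RichelotBrandt, Thm 2.4 (canonical model; bookkeeping)] -/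
abbrev canon₁₀₀ : Consumers100 := canon₁₀₀W ν (canon₁₉ ν μ κ) (canon₂₁ ν μ κ) (canon₂₈ ν μ κ) (canon₉₈ ν μ κ)

/-- Every hundredth-tranche edge holds in the parametrised reading, for arbitrary ν and EVERY assignment of tranches 19 / 21 / 28 / 98. [cite: DummiganTornaria2026Residual, Thm 1.1; RayRoyYi2021DimensionCongruences, Thm 3.1; Dang2026RichelotBrandt, Thm 2.4 (bookkeeping proved here)] -/
theorem canon_implications₁₀₀W (c₁₉ : Consumers19) (c₂₁ : Consumers21) (c₂₈ : Consumers28) (c₉₈ : Consumers98) :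
    Implications100 ν c₁₉ c₂₁ c₂₈ c₉₈ (canon₁₀₀W ν c₁₉ c₂₁ c₂₈ c₉₈) where
  dtResidual := fun j => j
  rryCong := fun r => r
  dangRB := fun b v j s => ⟨b, v, j, s⟩

/-- Every hundredth-tranche edge holds in the canonical instance, for arbitrary ν, μ, κ. [cite: DummiganTornaria2026Residual, Thm 1.1; Dang2026RichelotBrandt, Thm 2.4 (bookkeeping proved here)] -/
theorem canon_implications₁₀₀ : Implications100 ν (canon₁₉ ν μ κ) (canon₂₁ ν μ κ) (canon₂₈ ν μ κ) (canon₉₈ ν μ κ) (canon₁₀₀ ν μ κ) :=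
  canon_implications₁₀₀W ν _ _ _ _

/-- In the parametrised reading all three statements hold as soon as the book holds at all ranks and rows C180, C49, C90, C244 hold — through the tranche's bookkeeping theorems `dt_of_C244`, `rry_of_C49`, `dang_of_rows`. [cite: DummiganTornaria2026Residual, Thm 1.1; RayRoyYi2021DimensionCongruences, Thm 3.1; Dang2026RichelotBrandt, Thm 2.4 (bookkeeping proved here)] -/
theorem c100_all_of (c₁₉ : Consumers19) (c₂₁ : Consumers21) (c₂₈ : Consumers28) (c₉₈ : Consumers98) (hν : ∀ N, ν.Everything N) (h₁₈₀ : c₁₉.SchmidtParamodular)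
    (h₄₉ : c₂₁.RSYCount) (h₉₀ : c₂₈.VanHoften) (h₂₄₄ : c₉₈.DPRTjl) :
    (canon₁₀₀W ν c₁₉ c₂₁ c₂₈ c₉₈).DTresidual ∧ (canon₁₀₀W ν c₁₉ c₂₁ c₂₈ c₉₈).RRYcong ∧ (canon₁₀₀W ν c₁₉ c₂₁ c₂₈ c₉₈).DangRB :=
  have X := canon_implications₁₀₀W ν c₁₉ c₂₁ c₂₈ c₉₈
  ⟨dt_of_C244 X h₂₄₄, rry_of_C49 X h₄₉, dang_of_rows X hν h₉₀ h₂₄₄ h₁₈₀⟩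

end Canon100

/-- At the top (every input of the book; Mok and KMSW at the all-ones assignments, unread by the tranche; tranches 1 / 19 / 20 / 21 / 28 / 98 read canonically) all three
statements hold, through the tranche's own `hundredth_of_leaves`. [cite: DummiganTornaria2026Residual, Thm 1.1; RayRoyYi2021DimensionCongruences, Thm 3.1; Dang2026RichelotBrandt, Thm 2.4 (bookkeeping proved here)] -/
theorem hundredth_holds_top : (canon₁₀₀ νtop μtop κtop).DTresidual ∧ (canon₁₀₀ νtop μtop κtop).RRYcong ∧ (canon₁₀₀ νtop μtop κtop).DangRB :=
  hundredth_of_leaves (canon_implications₁₀₀ νtop μtop κtop) (canon_implications₉₈ νtop μtop κtop) (canon_implications₂₈ νtop μtop κtop) (canon_implications₂₁ νtop μtop κtop)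
    (canon_implications₂₀ νtop μtop κtop) (canon_implications₁₉ νtop μtop κtop) (canon_implications νtop μtop κtop) bookInputs_top

/-- BOOK SIDE, EXACT SUPPORT: in each of the 24 book countermodels (book edge systems and every other book leaf hold, the removed leaf fails; Mok and KMSW at the all-ones
assignments; tranches 1 / 19 / 20 / 21 / 28 / 98 / 100 read canonically over it, ALL their edges valid) ALL THREE statements FAIL — every one of the 24 book leaves is
load-bearing, through C244 (« [DPRT] ») for C249, through C49 (« [RoySchmidtYi2021] ») for C250, by name (« the Arthur classification of the split side ») and through
C90 / C244 / C180 for C251. [cite: DummiganTornaria2026Residual, §2.4; RayRoyYi2021DimensionCongruences, §3; Dang2026RichelotBrandt, §4.2; with DummiganEtAl2024 Thm 9.6, RoySchmidtYi2021 Cor. 2.3, Vanhoften2021 Thm 3, Schmidt2018Packet Thm 2.6 and Arthur2013 §1.5 (bookkeeping proved here)] -/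
theorem c100_book_cm (l : LeafSupport.Leaf) :
    LeafSupport.Systems (LeafSupport.mkN (LeafSupport.cm l)) (LeafSupport.mkW (LeafSupport.cm l)) (LeafSupport.mkG (LeafSupport.cm l)) ∧
      (∀ l', l' ≠ l → (LeafSupport.mkN (LeafSupport.cm l)).leaf l') ∧ ¬ (LeafSupport.mkN (LeafSupport.cm l)).leaf l ∧
      (Implications (LeafSupport.mkN (LeafSupport.cm l)) μtop κtop (canon (LeafSupport.mkN (LeafSupport.cm l)) μtop κtop) ∧
        Implications19 (LeafSupport.mkN (LeafSupport.cm l)) μtop κtop (canon₁₉ (LeafSupport.mkN (LeafSupport.cm l)) μtop κtop) ∧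
        Implications20 (LeafSupport.mkN (LeafSupport.cm l)) (canon₁₉ (LeafSupport.mkN (LeafSupport.cm l)) μtop κtop) (canon₂₀ (LeafSupport.mkN (LeafSupport.cm l)) μtop κtop) ∧
        Implications21 (LeafSupport.mkN (LeafSupport.cm l)) (canon₁₉ (LeafSupport.mkN (LeafSupport.cm l)) μtop κtop) (canon₂₀ (LeafSupport.mkN (LeafSupport.cm l)) μtop κtop) (canon₂₁ (LeafSupport.mkN (LeafSupport.cm l)) μtop κtop) ∧
        Implications28 (LeafSupport.mkN (LeafSupport.cm l)) μtop κtop (canon (LeafSupport.mkN (LeafSupport.cm l)) μtop κtop) (canon₁₉ (LeafSupport.mkN (LeafSupport.cm l)) μtop κtop) (canon₂₈ (LeafSupport.mkN (LeafSupport.cm l)) μtop κtop) ∧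
        Implications98 (LeafSupport.mkN (LeafSupport.cm l)) (canon (LeafSupport.mkN (LeafSupport.cm l)) μtop κtop) (canon₁₉ (LeafSupport.mkN (LeafSupport.cm l)) μtop κtop) (canon₂₀ (LeafSupport.mkN (LeafSupport.cm l)) μtop κtop) (canon₂₁ (LeafSupport.mkN (LeafSupport.cm l)) μtop κtop) (canon₂₈ (LeafSupport.mkN (LeafSupport.cm l)) μtop κtop) (canon₂₉ (LeafSupport.mkN (LeafSupport.cm l)) μtop κtop) (canon₉₈ (LeafSupport.mkN (LeafSupport.cm l)) μtop κtop) ∧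
        Implications100 (LeafSupport.mkN (LeafSupport.cm l)) (canon₁₉ (LeafSupport.mkN (LeafSupport.cm l)) μtop κtop) (canon₂₁ (LeafSupport.mkN (LeafSupport.cm l)) μtop κtop) (canon₂₈ (LeafSupport.mkN (LeafSupport.cm l)) μtop κtop) (canon₉₈ (LeafSupport.mkN (LeafSupport.cm l)) μtop κtop) (canon₁₀₀ (LeafSupport.mkN (LeafSupport.cm l)) μtop κtop)) ∧
      (¬ (canon₁₀₀ (LeafSupport.mkN (LeafSupport.cm l)) μtop κtop).DTresidual ∧ ¬ (canon₁₀₀ (LeafSupport.mkN (LeafSupport.cm l)) μtop κtop).RRYcong ∧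
        ¬ (canon₁₀₀ (LeafSupport.mkN (LeafSupport.cm l)) μtop κtop).DangRB) :=
  have cmod := LeafSupport.countermodel l
  have nb := not_B_cm l
  ⟨cmod.1, cmod.2.1, cmod.2.2.1,
    ⟨canon_implications _ _ _, canon_implications₁₉ _ _ _, canon_implications₂₀ _ _ _, canon_implications₂₁ _ _ _, canon_implications₂₈ _ _ _, canon_implications₉₈ _ _ _,
      canon_implications₁₀₀ _ _ _⟩,
    ⟨fun h => nb h.1, fun h => nb h.1, fun h => nb h.1⟩⟩

/-- Row C182 DENIED at the top — C244 and C49 fall with it (section 101's `canon₉₈noC182`, section 25's `canon₂₁noC182`; C180, C90 canonical): the tranche-100 reading over it. [cite: DummiganTornaria2026Residual, §2.4 (« [DPRT] »); RayRoyYi2021DimensionCongruences, §3 (separating model; bookkeeping)] -/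
abbrev canon₁₀₀noC182 : Consumers100 := canon₁₀₀W νtop (canon₁₉ νtop μtop κtop) (canon₂₁noC182 νtop μtop κtop) (canon₂₈ νtop μtop κtop) canon₉₈noC182

/-- Row C49 ALONE DENIED at the top (section 26's `canon₂₁noC49`, section 101's `canon₉₈noC49`; C182 / C244 canonical): the tranche-100 reading over it. [cite: RayRoyYi2021DimensionCongruences, §3 (« From [RoySchmidtYi2021] ») (separating model; bookkeeping)] -/
abbrev canon₁₀₀noC49 : Consumers100 := canon₁₀₀W νtop (canon₁₉ νtop μtop κtop) (canon₂₁noC49 νtop μtop κtop) (canon₂₈ νtop μtop κtop) canon₉₈noC49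

/-- Row C90 ALONE DENIED at the top (section 97's `c₂₈noC90`, section 101's `canon₉₈noC90`): the tranche-100 reading over it. [cite: Dang2026RichelotBrandt, §4.2 (« [39] ») (separating model; bookkeeping)] -/
abbrev canon₁₀₀noC90 : Consumers100 := canon₁₀₀W νtop (canon₁₉ νtop μtop κtop) (canon₂₁ νtop μtop κtop) c₂₈noC90 canon₉₈noC90

/-- Row C180 DENIED at the top with C182, C49 and C244 FREE-STANDING (section 25's `c₁₉noConduit` / `canon₂₁noC180`, section 101's `canon₉₈noC180`): the tranche-100 reading over it. [cite: Dang2026RichelotBrandt, §4.2 (« as in [37] ») (separating model; bookkeeping)] -/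
abbrev canon₁₀₀noC180 : Consumers100 := canon₁₀₀W νtop (c₁₉noConduit μtop κtop) canon₂₁noC180 (canon₂₈ νtop μtop κtop) canon₉₈noC180

/-- THE PREMISES ARE LOAD-BEARING EXACTLY AS TYPED (reading-level separation at the top; the tranche-100 edges hold over each denied assignment): (a) C182 DENIED (C244,
C49 with it) ⇒ ALL THREE FAIL; (b) C49 ALONE DENIED ⇒ only C250 FAILS; (c) C90 ALONE DENIED ⇒ only C251 FAILS; (d) C180 DENIED (C182 / C49 / C244 free-standing) ⇒ only
C251 FAILS. [cite: DummiganTornaria2026Residual, §2.4; RayRoyYi2021DimensionCongruences, §3; Dang2026RichelotBrandt, §4.2 (separating models; bookkeeping proved here)] -/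
theorem c100_denied_top :
    (Implications100 νtop (canon₁₉ νtop μtop κtop) (canon₂₁noC182 νtop μtop κtop) (canon₂₈ νtop μtop κtop) canon₉₈noC182 canon₁₀₀noC182 ∧
        ¬ canon₁₀₀noC182.DTresidual ∧ ¬ canon₁₀₀noC182.RRYcong ∧ ¬ canon₁₀₀noC182.DangRB) ∧
      (Implications100 νtop (canon₁₉ νtop μtop κtop) (canon₂₁noC49 νtop μtop κtop) (canon₂₈ νtop μtop κtop) canon₉₈noC49 canon₁₀₀noC49 ∧
        canon₁₀₀noC49.DTresidual ∧ ¬ canon₁₀₀noC49.RRYcong ∧ canon₁₀₀noC49.DangRB) ∧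
      (Implications100 νtop (canon₁₉ νtop μtop κtop) (canon₂₁ νtop μtop κtop) c₂₈noC90 canon₉₈noC90 canon₁₀₀noC90 ∧
        canon₁₀₀noC90.DTresidual ∧ canon₁₀₀noC90.RRYcong ∧ ¬ canon₁₀₀noC90.DangRB) ∧
      (Implications100 νtop (c₁₉noConduit μtop κtop) canon₂₁noC180 (canon₂₈ νtop μtop κtop) canon₉₈noC180 canon₁₀₀noC180 ∧
        canon₁₀₀noC180.DTresidual ∧ canon₁₀₀noC180.RRYcong ∧ ¬ canon₁₀₀noC180.DangRB) :=
  have b : ∀ N, νtop.Everything N := bookInputs_top.everything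
  ⟨⟨canon_implications₁₀₀W _ _ _ _ _, fun h => h, fun h => h, fun h => h.2.2.1⟩,
    ⟨canon_implications₁₀₀W _ _ _ _ _, ⟨b, b⟩, fun h => h, ⟨b, ⟨b, b⟩, ⟨b, b⟩, b⟩⟩,
    ⟨canon_implications₁₀₀W _ _ _ _ _, ⟨b, b⟩, ⟨b, ⟨b, b⟩⟩, fun h => h.2.1⟩,
    ⟨canon_implications₁₀₀W _ _ _ _ _, True.intro, True.intro, fun h => h.2.2.2⟩⟩

/-- UNITARY SIDE: in each of Mok's 29 countermodels (KMSW = `κnoMok`) and in each of KMSW's countermodels, the book at the all-ones assignment (canonical readings over it),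
ALL THREE typed statements HOLD — no statement of Mok 2015 or KMSW occurs in the tranche's edges (GSp_4, its compact inner form and Siegel / paramodular forms over ℚ
throughout). [cite: DummiganTornaria2026Residual, Thm 1.1; RayRoyYi2021DimensionCongruences, Thm 3.1; Dang2026RichelotBrandt, Thm 2.4 (bookkeeping proved here)] -/
theorem c100_unitary_independent (l : Mok2015.LeafSupport.Leaf) (l' : KMSW2014.LeafSupport.Leaf) :
    ((canon₁₀₀ νtop (Mok2015.LeafSupport.mkN (Mok2015.LeafSupport.cm l)) κnoMok).DTresidual ∧ (canon₁₀₀ νtop (Mok2015.LeafSupport.mkN (Mok2015.LeafSupport.cm l)) κnoMok).RRYcong ∧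
        (canon₁₀₀ νtop (Mok2015.LeafSupport.mkN (Mok2015.LeafSupport.cm l)) κnoMok).DangRB) ∧
      ((canon₁₀₀ νtop μtop (KMSW2014.LeafSupport.mkN (KMSW2014.LeafSupport.cm l'))).DTresidual ∧ (canon₁₀₀ νtop μtop (KMSW2014.LeafSupport.mkN (KMSW2014.LeafSupport.cm l'))).RRYcong ∧
        (canon₁₀₀ νtop μtop (KMSW2014.LeafSupport.mkN (KMSW2014.LeafSupport.cm l'))).DangRB) :=
  have b : ∀ N, νtop.Everything N := bookInputs_top.everything
  ⟨⟨⟨b, b⟩, ⟨b, ⟨b, b⟩⟩, ⟨b, ⟨b, b⟩, ⟨b, b⟩, b⟩⟩, ⟨⟨b, b⟩, ⟨b, ⟨b, b⟩⟩, ⟨b, ⟨b, b⟩, ⟨b, b⟩, b⟩⟩⟩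

/-- THE HUNDREDTH TRANCHE REGRADED, in one statement: (i) at the top all three hold; (ii) in the book countermodel of ANY leaf all three fail; (iii) C182 denied: all three
fail; C49 denied: only C250 fails; C90 denied, C180 denied (C244 free-standing): only C251 fails — C249 holding wherever C244's node holds; (iv) in every Mok / KMSW
countermodel (book at the top) all hold.  Supports: book 24 for each of the three statements (through C244 / C182 / C180; through C49 / C182; by name and through C90 / C244
/ C180); nothing of Mok 2015 or KMSW. [cite: DummiganTornaria2026Residual, Thm 1.1; RayRoyYi2021DimensionCongruences, Thm 3.1; Dang2026RichelotBrandt, Thm 2.4 (bookkeeping proved here)] -/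
theorem c100_regraded :
    ((canon₁₀₀ νtop μtop κtop).DTresidual ∧ (canon₁₀₀ νtop μtop κtop).RRYcong ∧ (canon₁₀₀ νtop μtop κtop).DangRB) ∧
      (∀ l : LeafSupport.Leaf, ¬ (LeafSupport.mkN (LeafSupport.cm l)).leaf l ∧
        ¬ (canon₁₀₀ (LeafSupport.mkN (LeafSupport.cm l)) μtop κtop).DTresidual ∧ ¬ (canon₁₀₀ (LeafSupport.mkN (LeafSupport.cm l)) μtop κtop).RRYcong ∧
        ¬ (canon₁₀₀ (LeafSupport.mkN (LeafSupport.cm l)) μtop κtop).DangRB) ∧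
      (¬ canon₁₀₀noC182.DTresidual ∧ ¬ canon₁₀₀noC182.RRYcong ∧ ¬ canon₁₀₀noC182.DangRB ∧ ¬ canon₁₀₀noC49.RRYcong ∧ canon₁₀₀noC49.DTresidual ∧
        ¬ canon₁₀₀noC90.DangRB ∧ canon₁₀₀noC90.DTresidual ∧ ¬ canon₁₀₀noC180.DangRB ∧ canon₁₀₀noC180.DTresidual) ∧
      (∀ (l : Mok2015.LeafSupport.Leaf) (l' : KMSW2014.LeafSupport.Leaf),
        (canon₁₀₀ νtop (Mok2015.LeafSupport.mkN (Mok2015.LeafSupport.cm l)) κnoMok).DTresidual ∧ (canon₁₀₀ νtop (Mok2015.LeafSupport.mkN (Mok2015.LeafSupport.cm l)) κnoMok).DangRB ∧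
        (canon₁₀₀ νtop μtop (KMSW2014.LeafSupport.mkN (KMSW2014.LeafSupport.cm l'))).DTresidual ∧ (canon₁₀₀ νtop μtop (KMSW2014.LeafSupport.mkN (KMSW2014.LeafSupport.cm l'))).DangRB) :=
  have ⟨⟨_, a1, a2, a3⟩, ⟨_, b1, b2, _⟩, ⟨_, c1, _, c2⟩, ⟨_, d1, _, d2⟩⟩ := c100_denied_top
  ⟨hundredth_holds_top,
    fun l => have h := c100_book_cm l
      ⟨h.2.2.1, h.2.2.2.2⟩,
    ⟨a1, a2, a3, b2, b1, c2, c1, d2, d1⟩,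
    fun l l' => have h := c100_unitary_independent l l'
      ⟨h.1.1, h.1.2.2, h.2.1, h.2.2.2⟩⟩


/-! ## 104. Hundred-and-first tranche (v6 of this file, after `Downstream30.lean` v2; unit `pub-arthur-down-g39`): supports of NEW rows C252 `WaibelMoment` (⇐ C180), C253
`CCGmodular`, C254 `GuK3` and C255 `FPpotQM` (⇐ C9 each); see the module docstring for the summary. -/

section Canon101

variable (ν : Nodes) (μ : Mok2015.Nodes) (κ : KMSW2014.Nodes)

/-- The parametrised canonical reading of the hundred-and-first tranche: the assignments `c`, `c₁₉` of tranches 1 / 19 are the parameters; C252 := C180; C253, C254, C255 := C9. [cite: Waibel2019SpinorMoments, Thm 1; CalegariChidambaramGhitza2020, Thm 5; Gu2025K3PotentialAutomorphy, Thm 1.1; FloritPacetti2024KVarieties, Thm 5.3 (canonical model; bookkeeping)] -/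
abbrev canon₁₀₁W (c : Consumers) (c₁₉ : Consumers19) : Consumers101 where
  WaibelMoment := c₁₉.SchmidtParamodular
  CCGmodular := c.BCGP
  GuK3 := c.BCGP
  FPpotQM := c.BCGP

/-- The canonical instance over `canon`, `canon₁₉` (there `SchmidtParamodular := ∀ N, ν.Everything N`, `BCGP := ∀ N, ν.Everything N`). [cite: Waibel2019SpinorMoments, Thm 1; CalegariChidambaramGhitza2020, Thm 5 (canonical model; bookkeeping)] -/
abbrev canon₁₀₁ : Consumers101 := canon₁₀₁W (canon ν μ κ) (canon₁₉ ν μ κ)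

/-- Every hundred-and-first-tranche edge holds in the parametrised reading, for EVERY assignment of tranches 1 / 19. [cite: Waibel2019SpinorMoments, Thm 1; CalegariChidambaramGhitza2020, Thm 5; Gu2025K3PotentialAutomorphy, Thm 1.1 (bookkeeping proved here)] -/
theorem canon_implications₁₀₁W (c : Consumers) (c₁₉ : Consumers19) : Implications101 c c₁₉ (canon₁₀₁W c c₁₉) where
  waibel := fun s => s
  ccg := fun g => g
  gu := fun g => g
  fp := fun g => g

/-- Every hundred-and-first-tranche edge holds in the canonical instance, for arbitrary ν, μ, κ. [cite: Waibel2019SpinorMoments, Thm 1; CalegariChidambaramGhitza2020, Thm 5 (bookkeeping proved here)] -/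
theorem canon_implications₁₀₁ : Implications101 (canon ν μ κ) (canon₁₉ ν μ κ) (canon₁₀₁ ν μ κ) :=
  canon_implications₁₀₁W _ _

/-- In the parametrised reading all four statements hold as soon as rows C180 and C9 hold. [cite: Waibel2019SpinorMoments, Thm 1; CalegariChidambaramGhitza2020, Thm 5; Gu2025K3PotentialAutomorphy, Thm 1.1; FloritPacetti2024KVarieties, Thm 5.3 (bookkeeping proved here)] -/
theorem c101_all_of (c : Consumers) (c₁₉ : Consumers19) (h₁₈₀ : c₁₉.SchmidtParamodular) (h₉ : c.BCGP) :
    (canon₁₀₁W c c₁₉).WaibelMoment ∧ (canon₁₀₁W c c₁₉).CCGmodular ∧ (canon₁₀₁W c c₁₉).GuK3 ∧ (canon₁₀₁W c c₁₉).FPpotQM :=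
  have X := canon_implications₁₀₁W c c₁₉
  ⟨waibel_of_C180 X h₁₈₀, bcgpCiters_of_C9 X h₉⟩

end Canon101

/-- At the top all four statements hold, through the tranche's own `hundredfirst_of_leaves`. [cite: Waibel2019SpinorMoments, Thm 1; CalegariChidambaramGhitza2020, Thm 5; Gu2025K3PotentialAutomorphy, Thm 1.1 (bookkeeping proved here)] -/
theorem hundredfirst_holds_top :
    (canon₁₀₁ νtop μtop κtop).WaibelMoment ∧ (canon₁₀₁ νtop μtop κtop).CCGmodular ∧ (canon₁₀₁ νtop μtop κtop).GuK3 ∧ (canon₁₀₁ νtop μtop κtop).FPpotQM :=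
  hundredfirst_of_leaves (canon_implications₁₀₁ νtop μtop κtop) (canon_implications₁₉ νtop μtop κtop) (canon_implications νtop μtop κtop) bookInputs_top

/-- BOOK SIDE, EXACT SUPPORT: in each of the 24 book countermodels (tranches 1 / 19 / 101 read canonically over it, ALL their edges valid) ALL FOUR statements FAIL — every book
leaf is load-bearing, through C180 (« [RS2018] ») for C252 and through C9 ⇐ A4 (« [BCGP] » / « [MR4349242] ») for C253 – C255. [cite: Waibel2019SpinorMoments, §3; CalegariChidambaramGhitza2020, Thm 1; Gu2025K3PotentialAutomorphy, §6; FloritPacetti2024KVarieties, proof of Thm 5.3; with Schmidt2018Packet Thm 2.6, BoxerEtAl2021, GeeTaibi2019 Thm 7.4.1 and Arthur2013 §1.5 (bookkeeping proved here)] -/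
theorem c101_book_cm (l : LeafSupport.Leaf) :
    LeafSupport.Systems (LeafSupport.mkN (LeafSupport.cm l)) (LeafSupport.mkW (LeafSupport.cm l)) (LeafSupport.mkG (LeafSupport.cm l)) ∧
      (∀ l', l' ≠ l → (LeafSupport.mkN (LeafSupport.cm l)).leaf l') ∧ ¬ (LeafSupport.mkN (LeafSupport.cm l)).leaf l ∧
      (Implications (LeafSupport.mkN (LeafSupport.cm l)) μtop κtop (canon (LeafSupport.mkN (LeafSupport.cm l)) μtop κtop) ∧
        Implications19 (LeafSupport.mkN (LeafSupport.cm l)) μtop κtop (canon₁₉ (LeafSupport.mkN (LeafSupport.cm l)) μtop κtop) ∧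
        Implications101 (canon (LeafSupport.mkN (LeafSupport.cm l)) μtop κtop) (canon₁₉ (LeafSupport.mkN (LeafSupport.cm l)) μtop κtop) (canon₁₀₁ (LeafSupport.mkN (LeafSupport.cm l)) μtop κtop)) ∧
      (¬ (canon₁₀₁ (LeafSupport.mkN (LeafSupport.cm l)) μtop κtop).WaibelMoment ∧ ¬ (canon₁₀₁ (LeafSupport.mkN (LeafSupport.cm l)) μtop κtop).CCGmodular ∧
        ¬ (canon₁₀₁ (LeafSupport.mkN (LeafSupport.cm l)) μtop κtop).GuK3 ∧ ¬ (canon₁₀₁ (LeafSupport.mkN (LeafSupport.cm l)) μtop κtop).FPpotQM) :=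
  have cmod := LeafSupport.countermodel l
  have nb := not_B_cm l
  ⟨cmod.1, cmod.2.1, cmod.2.2.1, ⟨canon_implications _ _ _, canon_implications₁₉ _ _ _, canon_implications₁₀₁ _ _ _⟩, ⟨fun h => nb h, fun h => nb h, fun h => nb h, fun h => nb h⟩⟩

/-- Row C9 DENIED (`BCGP := False`; the other tranche-1 fields as in `canon` at the top): a reading of `Consumers` used only to deny Boxer – Calegari – Gee – Pilloni's theorem; no first-tranche edge is claimed for it. [cite: BoxerEtAl2021, main theorem (separating model; bookkeeping)] -/
abbrev c₁noC9 : Consumers := { canon νtop μtop κtop with BCGP := False }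

/-- THE PREMISES ARE LOAD-BEARING EXACTLY AS TYPED (reading-level separation at the top): (a) C180 DENIED (section 25's `c₁₉noConduit`) ⇒ only C252 FAILS; (b) C9 DENIED
(`c₁noC9`) ⇒ C253, C254 and C255 FAIL, C252 HOLDS. [cite: Waibel2019SpinorMoments, §3 (« [RS2018] »); CalegariChidambaramGhitza2020, Thm 1 (« proved in [BCGP] »); Gu2025K3PotentialAutomorphy, §6; FloritPacetti2024KVarieties, proof of Thm 5.3 (separating models; bookkeeping proved here)] -/
theorem c101_denied_top :
    (Implications101 (canon νtop μtop κtop) (c₁₉noConduit μtop κtop) (canon₁₀₁W (canon νtop μtop κtop) (c₁₉noConduit μtop κtop)) ∧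
        ¬ (canon₁₀₁W (canon νtop μtop κtop) (c₁₉noConduit μtop κtop)).WaibelMoment ∧ (canon₁₀₁W (canon νtop μtop κtop) (c₁₉noConduit μtop κtop)).CCGmodular ∧
        (canon₁₀₁W (canon νtop μtop κtop) (c₁₉noConduit μtop κtop)).GuK3 ∧ (canon₁₀₁W (canon νtop μtop κtop) (c₁₉noConduit μtop κtop)).FPpotQM) ∧
      (Implications101 c₁noC9 (canon₁₉ νtop μtop κtop) (canon₁₀₁W c₁noC9 (canon₁₉ νtop μtop κtop)) ∧
        (canon₁₀₁W c₁noC9 (canon₁₉ νtop μtop κtop)).WaibelMoment ∧ ¬ (canon₁₀₁W c₁noC9 (canon₁₉ νtop μtop κtop)).CCGmodular ∧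
        ¬ (canon₁₀₁W c₁noC9 (canon₁₉ νtop μtop κtop)).GuK3 ∧ ¬ (canon₁₀₁W c₁noC9 (canon₁₉ νtop μtop κtop)).FPpotQM) :=
  have b : ∀ N, νtop.Everything N := bookInputs_top.everything
  ⟨⟨canon_implications₁₀₁W _ _, fun h => h, b, b, b⟩, ⟨canon_implications₁₀₁W _ _, b, fun h => h, fun h => h, fun h => h⟩⟩

/-- UNITARY SIDE: in each of Mok's 29 countermodels (KMSW = `κnoMok`) and in each of KMSW's countermodels, the book at the all-ones assignment, ALL FOUR typed statements HOLD
— no statement of Mok 2015 or KMSW occurs in the tranche's edges. [cite: Waibel2019SpinorMoments, Thm 1; CalegariChidambaramGhitza2020, Thm 5; Gu2025K3PotentialAutomorphy, Thm 1.1; FloritPacetti2024KVarieties, Thm 5.3 (bookkeeping proved here)] -/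
theorem c101_unitary_independent (l : Mok2015.LeafSupport.Leaf) (l' : KMSW2014.LeafSupport.Leaf) :
    ((canon₁₀₁ νtop (Mok2015.LeafSupport.mkN (Mok2015.LeafSupport.cm l)) κnoMok).WaibelMoment ∧ (canon₁₀₁ νtop (Mok2015.LeafSupport.mkN (Mok2015.LeafSupport.cm l)) κnoMok).CCGmodular ∧
        (canon₁₀₁ νtop (Mok2015.LeafSupport.mkN (Mok2015.LeafSupport.cm l)) κnoMok).GuK3 ∧ (canon₁₀₁ νtop (Mok2015.LeafSupport.mkN (Mok2015.LeafSupport.cm l)) κnoMok).FPpotQM) ∧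
      ((canon₁₀₁ νtop μtop (KMSW2014.LeafSupport.mkN (KMSW2014.LeafSupport.cm l'))).WaibelMoment ∧ (canon₁₀₁ νtop μtop (KMSW2014.LeafSupport.mkN (KMSW2014.LeafSupport.cm l'))).CCGmodular ∧
        (canon₁₀₁ νtop μtop (KMSW2014.LeafSupport.mkN (KMSW2014.LeafSupport.cm l'))).GuK3 ∧ (canon₁₀₁ νtop μtop (KMSW2014.LeafSupport.mkN (KMSW2014.LeafSupport.cm l'))).FPpotQM) :=
  have b : ∀ N, νtop.Everything N := bookInputs_top.everything
  ⟨⟨b, b, b, b⟩, ⟨b, b, b, b⟩⟩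

/-- THE HUNDRED-AND-FIRST TRANCHE REGRADED, in one statement: (i) at the top all four hold; (ii) in the book countermodel of ANY leaf all four fail; (iii) C180 denied: only C252
fails; C9 denied: C253, C254 and C255 fail, C252 holds; (iv) in every Mok / KMSW countermodel all hold.  Supports: book 24 each (through C180; through C9 ⇐ A4); nothing of Mok
2015 or KMSW. [cite: Waibel2019SpinorMoments, Thm 1; CalegariChidambaramGhitza2020, Thm 5; Gu2025K3PotentialAutomorphy, Thm 1.1; FloritPacetti2024KVarieties, Thm 5.3 (bookkeeping proved here)] -/
theorem c101_regraded :
    ((canon₁₀₁ νtop μtop κtop).WaibelMoment ∧ (canon₁₀₁ νtop μtop κtop).CCGmodular ∧ (canon₁₀₁ νtop μtop κtop).GuK3 ∧ (canon₁₀₁ νtop μtop κtop).FPpotQM) ∧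
      (∀ l : LeafSupport.Leaf, ¬ (LeafSupport.mkN (LeafSupport.cm l)).leaf l ∧
        ¬ (canon₁₀₁ (LeafSupport.mkN (LeafSupport.cm l)) μtop κtop).WaibelMoment ∧ ¬ (canon₁₀₁ (LeafSupport.mkN (LeafSupport.cm l)) μtop κtop).CCGmodular ∧
        ¬ (canon₁₀₁ (LeafSupport.mkN (LeafSupport.cm l)) μtop κtop).GuK3 ∧ ¬ (canon₁₀₁ (LeafSupport.mkN (LeafSupport.cm l)) μtop κtop).FPpotQM) ∧
      (¬ (canon₁₀₁W (canon νtop μtop κtop) (c₁₉noConduit μtop κtop)).WaibelMoment ∧ (canon₁₀₁W (canon νtop μtop κtop) (c₁₉noConduit μtop κtop)).CCGmodular ∧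
        ¬ (canon₁₀₁W c₁noC9 (canon₁₉ νtop μtop κtop)).CCGmodular ∧ ¬ (canon₁₀₁W c₁noC9 (canon₁₉ νtop μtop κtop)).GuK3 ∧
        ¬ (canon₁₀₁W c₁noC9 (canon₁₉ νtop μtop κtop)).FPpotQM ∧ (canon₁₀₁W c₁noC9 (canon₁₉ νtop μtop κtop)).WaibelMoment) ∧
      (∀ (l : Mok2015.LeafSupport.Leaf) (l' : KMSW2014.LeafSupport.Leaf),
        (canon₁₀₁ νtop (Mok2015.LeafSupport.mkN (Mok2015.LeafSupport.cm l)) κnoMok).WaibelMoment ∧ (canon₁₀₁ νtop (Mok2015.LeafSupport.mkN (Mok2015.LeafSupport.cm l)) κnoMok).FPpotQM ∧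
        (canon₁₀₁ νtop μtop (KMSW2014.LeafSupport.mkN (KMSW2014.LeafSupport.cm l'))).WaibelMoment ∧ (canon₁₀₁ νtop μtop (KMSW2014.LeafSupport.mkN (KMSW2014.LeafSupport.cm l'))).GuK3) :=
  have ⟨⟨_, a1, a2, _, _⟩, ⟨_, b1, b2, b3, b4⟩⟩ := c101_denied_top
  ⟨hundredfirst_holds_top,
    fun l => have h := c101_book_cm l
      ⟨h.2.2.1, h.2.2.2.2⟩,
    ⟨a1, a2, b2, b3, b4, b1⟩,
    fun l l' => have h := c101_unitary_independent l l'
      ⟨h.1.1, h.1.2.2.2, h.2.1, h.2.2.2.1⟩⟩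


/-! ## 105. Hundred-and-second tranche (v7 of this file, after `Downstream30.lean` v3; unit `pub-arthur-down-g40`): supports of NEW rows C256 `NTaylorTraces` (⇐ C9 ∧ A4)
and C257 `CCRfamilies` (⇐ C9); see the module docstring for the summary. -/

section Canon102

variable (ν : Nodes) (μ : Mok2015.Nodes) (κ : KMSW2014.Nodes)

/-- The parametrised canonical reading of the hundred-and-second tranche: the assignment `c` of tranche 1 is the parameter; C256 := C9 ∧ A4; C257 := C9. [cite: NTaylor2020SatoTateSurfaces, Thms 4.1-4.4; CalegariChidambaramRoberts2020, §4.3 (canonical model; bookkeeping)] -/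
abbrev canon₁₀₂W (c : Consumers) : Consumers102 where
  NTaylorTraces := c.BCGP ∧ c.GeeTaibi
  CCRfamilies := c.BCGP

/-- The canonical instance over `canon` (there `BCGP := ∀ N, ν.Everything N` and `GeeTaibi := ∀ N, ν.Everything N`). [cite: NTaylor2020SatoTateSurfaces, Thms 4.1-4.4; CalegariChidambaramRoberts2020, §4.3 (canonical model; bookkeeping)] -/
abbrev canon₁₀₂ : Consumers102 := canon₁₀₂W (canon ν μ κ)

/-- Every hundred-and-second-tranche edge holds in the parametrised reading, for EVERY assignment of tranche 1. [cite: NTaylor2020SatoTateSurfaces, Thms 4.1-4.4; CalegariChidambaramRoberts2020, §4.3 (bookkeeping proved here)] -/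
theorem canon_implications₁₀₂W (c : Consumers) : Implications102 c (canon₁₀₂W c) where
  nt := fun g a => ⟨g, a⟩
  ccr := fun g => g

/-- Every hundred-and-second-tranche edge holds in the canonical instance, for arbitrary ν, μ, κ. [cite: NTaylor2020SatoTateSurfaces, Thms 4.1-4.4; CalegariChidambaramRoberts2020, §4.3 (bookkeeping proved here)] -/
theorem canon_implications₁₀₂ : Implications102 (canon ν μ κ) (canon₁₀₂ ν μ κ) :=
  canon_implications₁₀₂W _

/-- In the parametrised reading both statements hold as soon as rows C9 and A4 hold. [cite: NTaylor2020SatoTateSurfaces, Thms 4.1-4.4; CalegariChidambaramRoberts2020, §4.3 (bookkeeping proved here)] -/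
theorem c102_all_of (c : Consumers) (h₉ : c.BCGP) (h₄ : c.GeeTaibi) : (canon₁₀₂W c).NTaylorTraces ∧ (canon₁₀₂W c).CCRfamilies :=
  have X := canon_implications₁₀₂W c
  ⟨nt_of_rows X h₉ h₄, ccr_of_C9 X h₉⟩

end Canon102

/-- At the top both statements hold, through the tranche's own `hundredsecond_of_leaves`. [cite: NTaylor2020SatoTateSurfaces, Thms 4.1-4.4; CalegariChidambaramRoberts2020, §4.3 (bookkeeping proved here)] -/
theorem hundredsecond_holds_top : (canon₁₀₂ νtop μtop κtop).NTaylorTraces ∧ (canon₁₀₂ νtop μtop κtop).CCRfamilies :=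
  hundredsecond_of_leaves (canon_implications₁₀₂ νtop μtop κtop) (canon_implications νtop μtop κtop) bookInputs_top

/-- BOOK SIDE, EXACT SUPPORT: in each of the 24 book countermodels (tranches 1 / 102 read canonically over it, ALL their edges valid) BOTH statements FAIL — every book leaf is
load-bearing, through C9 ⇐ A4 (« Theorem 4.5 ( [BCGP]) » / « the conditions of [BCGP] ») and, for C256, also through A4 (« Theorem 4.6 ([GeeTaibi]) »). [cite: NTaylor2020SatoTateSurfaces, §4.1 Thms 4.5, 4.6; CalegariChidambaramRoberts2020, §4.3; with BoxerEtAl2021, GeeTaibi2019 Thm 7.4.1 and Arthur2013 §1.5 (bookkeeping proved here)] -/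
theorem c102_book_cm (l : LeafSupport.Leaf) :
    LeafSupport.Systems (LeafSupport.mkN (LeafSupport.cm l)) (LeafSupport.mkW (LeafSupport.cm l)) (LeafSupport.mkG (LeafSupport.cm l)) ∧
      (∀ l', l' ≠ l → (LeafSupport.mkN (LeafSupport.cm l)).leaf l') ∧ ¬ (LeafSupport.mkN (LeafSupport.cm l)).leaf l ∧
      (Implications (LeafSupport.mkN (LeafSupport.cm l)) μtop κtop (canon (LeafSupport.mkN (LeafSupport.cm l)) μtop κtop) ∧
        Implications102 (canon (LeafSupport.mkN (LeafSupport.cm l)) μtop κtop) (canon₁₀₂ (LeafSupport.mkN (LeafSupport.cm l)) μtop κtop)) ∧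
      (¬ (canon₁₀₂ (LeafSupport.mkN (LeafSupport.cm l)) μtop κtop).NTaylorTraces ∧ ¬ (canon₁₀₂ (LeafSupport.mkN (LeafSupport.cm l)) μtop κtop).CCRfamilies) :=
  have cmod := LeafSupport.countermodel l
  have nb := not_B_cm l
  ⟨cmod.1, cmod.2.1, cmod.2.2.1, ⟨canon_implications _ _ _, canon_implications₁₀₂ _ _ _⟩, ⟨fun h => nb h.1, fun h => nb h⟩⟩

/-- THE PREMISES ARE LOAD-BEARING EXACTLY AS TYPED (reading-level separation at the top): (a) C9 DENIED (section 104's `c₁noC9`) ⇒ BOTH FAIL; (b) A4 DENIED (section 95's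
`c₁noA4`; C9 read canonically over it) ⇒ C256 FAILS, C257 HOLDS. [cite: NTaylor2020SatoTateSurfaces, §4.1 (« Theorem 4.5 ( [BCGP]) », « Theorem 4.6 ([GeeTaibi]) »); CalegariChidambaramRoberts2020, §4.3 (« the conditions of [BCGP] ») (separating models; bookkeeping proved here)] -/
theorem c102_denied_top :
    (Implications102 c₁noC9 (canon₁₀₂W c₁noC9) ∧ ¬ (canon₁₀₂W c₁noC9).NTaylorTraces ∧ ¬ (canon₁₀₂W c₁noC9).CCRfamilies) ∧
      (Implications102 c₁noA4 (canon₁₀₂W c₁noA4) ∧ ¬ (canon₁₀₂W c₁noA4).NTaylorTraces ∧ (canon₁₀₂W c₁noA4).CCRfamilies) :=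
  have b : ∀ N, νtop.Everything N := bookInputs_top.everything
  ⟨⟨canon_implications₁₀₂W _, fun h => h.1, fun h => h⟩, ⟨canon_implications₁₀₂W _, fun h => h.2, b⟩⟩

/-- UNITARY SIDE: in each of Mok's 29 countermodels (KMSW = `κnoMok`) and in each of KMSW's countermodels, the book at the all-ones assignment, BOTH typed statements HOLD — no
statement of Mok 2015 or KMSW occurs in the tranche's edges. [cite: NTaylor2020SatoTateSurfaces, Thms 4.1-4.4; CalegariChidambaramRoberts2020, §4.3 (bookkeeping proved here)] -/
theorem c102_unitary_independent (l : Mok2015.LeafSupport.Leaf) (l' : KMSW2014.LeafSupport.Leaf) :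
    ((canon₁₀₂ νtop (Mok2015.LeafSupport.mkN (Mok2015.LeafSupport.cm l)) κnoMok).NTaylorTraces ∧ (canon₁₀₂ νtop (Mok2015.LeafSupport.mkN (Mok2015.LeafSupport.cm l)) κnoMok).CCRfamilies) ∧
      ((canon₁₀₂ νtop μtop (KMSW2014.LeafSupport.mkN (KMSW2014.LeafSupport.cm l'))).NTaylorTraces ∧ (canon₁₀₂ νtop μtop (KMSW2014.LeafSupport.mkN (KMSW2014.LeafSupport.cm l'))).CCRfamilies) :=
  have b : ∀ N, νtop.Everything N := bookInputs_top.everything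
  ⟨⟨⟨b, b⟩, b⟩, ⟨⟨b, b⟩, b⟩⟩

/-- THE HUNDRED-AND-SECOND TRANCHE REGRADED, in one statement: (i) at the top both hold; (ii) in the book countermodel of ANY leaf both fail; (iii) C9 denied: both fail; A4
denied: C256 fails, C257 holds; (iv) in every Mok / KMSW countermodel both hold.  Supports: book 24 each (through C9 ⇐ A4; C256 also through A4); nothing of Mok 2015 or
KMSW. [cite: NTaylor2020SatoTateSurfaces, Thms 4.1-4.4; CalegariChidambaramRoberts2020, §4.3 (bookkeeping proved here)] -/
theorem c102_regraded :
    ((canon₁₀₂ νtop μtop κtop).NTaylorTraces ∧ (canon₁₀₂ νtop μtop κtop).CCRfamilies) ∧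
      (∀ l : LeafSupport.Leaf, ¬ (LeafSupport.mkN (LeafSupport.cm l)).leaf l ∧
        ¬ (canon₁₀₂ (LeafSupport.mkN (LeafSupport.cm l)) μtop κtop).NTaylorTraces ∧ ¬ (canon₁₀₂ (LeafSupport.mkN (LeafSupport.cm l)) μtop κtop).CCRfamilies) ∧
      (¬ (canon₁₀₂W c₁noC9).NTaylorTraces ∧ ¬ (canon₁₀₂W c₁noC9).CCRfamilies ∧ ¬ (canon₁₀₂W c₁noA4).NTaylorTraces ∧ (canon₁₀₂W c₁noA4).CCRfamilies) ∧
      (∀ (l : Mok2015.LeafSupport.Leaf) (l' : KMSW2014.LeafSupport.Leaf),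
        (canon₁₀₂ νtop (Mok2015.LeafSupport.mkN (Mok2015.LeafSupport.cm l)) κnoMok).NTaylorTraces ∧
        (canon₁₀₂ νtop μtop (KMSW2014.LeafSupport.mkN (KMSW2014.LeafSupport.cm l'))).CCRfamilies) :=
  have ⟨⟨_, a1, a2⟩, ⟨_, b1, b2⟩⟩ := c102_denied_top
  ⟨hundredsecond_holds_top,
    fun l => have h := c102_book_cm l
      ⟨h.2.2.1, h.2.2.2.2⟩,
    ⟨a1, a2, b1, b2⟩,
    fun l l' => have h := c102_unitary_independent l l'
      ⟨h.1.1, h.2.2⟩⟩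


/-! ## 106. Hundred-and-third tranche (v8 of this file, after `Downstream30.lean` v4; unit `pub-arthur-down-g40`): supports of NEW rows C258 `CJdensity`, C260 `LZtateII`, C261
`NYregulator` (⇐ C9 each) and C259 `CGHselmer` (⇐ C34 ∧ C9); see the module docstring for the summary. -/

section Canon103

variable (ν : Nodes) (μ : Mok2015.Nodes) (κ : KMSW2014.Nodes)

/-- The parametrised canonical reading of the hundred-and-third tranche: the assignments `c`, `c₆₄` of tranches 1 / 64 are the parameters; C258, C260, C261 := C9; C259 := C34 ∧ C9. [cite: ChiriacJorza2019HeckeComparison, Example 4.7; CalegariGeraghtyHarris2019BlochKato, Thm 1.1; LiZhang2022Tate, Thm 1.4; NemotoYamauchi2025Regulators, §5.2 (canonical model; bookkeeping)] -/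
abbrev canon₁₀₃W (c : Consumers) (c₆₄ : Consumers64) : Consumers103 where
  CJdensity := c.BCGP
  CGHselmer := c₆₄.CalegariGeraghtyGSp4 ∧ c.BCGP
  LZtateII := c.BCGP
  NYregulator := c.BCGP

/-- The canonical instance over `canon`, `canon₆₄` (there `BCGP := ∀ N, ν.Everything N` and `CalegariGeraghtyGSp4 :=` book ∧ book ∧ (book ∧ book)). [cite: ChiriacJorza2019HeckeComparison, Example 4.7; CalegariGeraghtyHarris2019BlochKato, Thm 1.1 (canonical model; bookkeeping)] -/
abbrev canon₁₀₃ : Consumers103 := canon₁₀₃W (canon ν μ κ) (canon₆₄ ν μ κ)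

/-- Every hundred-and-third-tranche edge holds in the parametrised reading, for EVERY assignment of tranches 1 / 64. [cite: ChiriacJorza2019HeckeComparison, Example 4.7; CalegariGeraghtyHarris2019BlochKato, Thm 1.1; LiZhang2022Tate, Thm 1.4; NemotoYamauchi2025Regulators, §5.2 (bookkeeping proved here)] -/
theorem canon_implications₁₀₃W (c : Consumers) (c₆₄ : Consumers64) : Implications103 c c₆₄ (canon₁₀₃W c c₆₄) where
  cj := fun g => g
  cgh := fun h g => ⟨h, g⟩
  lz := fun g => g
  ny := fun g => g

/-- Every hundred-and-third-tranche edge holds in the canonical instance, for arbitrary ν, μ, κ. [cite: ChiriacJorza2019HeckeComparison, Example 4.7; CalegariGeraghtyHarris2019BlochKato, Thm 1.1 (bookkeeping proved here)] -/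
theorem canon_implications₁₀₃ : Implications103 (canon ν μ κ) (canon₆₄ ν μ κ) (canon₁₀₃ ν μ κ) :=
  canon_implications₁₀₃W _ _

/-- In the parametrised reading all four statements hold as soon as rows C9 and C34 hold. [cite: ChiriacJorza2019HeckeComparison, Example 4.7; CalegariGeraghtyHarris2019BlochKato, Thm 1.1; LiZhang2022Tate, Thm 1.4; NemotoYamauchi2025Regulators, §5.2 (bookkeeping proved here)] -/
theorem c103_all_of (c : Consumers) (c₆₄ : Consumers64) (h₉ : c.BCGP) (h₃₄ : c₆₄.CalegariGeraghtyGSp4) :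
    (canon₁₀₃W c c₆₄).CJdensity ∧ (canon₁₀₃W c c₆₄).CGHselmer ∧ (canon₁₀₃W c c₆₄).LZtateII ∧ (canon₁₀₃W c c₆₄).NYregulator :=
  have X := canon_implications₁₀₃W c c₆₄
  have h := bcgpVein103_of_C9 X h₉
  ⟨h.1, cghSelmer_of_rows X h₃₄ h₉, h.2⟩

end Canon103

/-- At the top all four statements hold, through the tranche's own `hundredthird_of_leaves` (fed by `canon_implications₆₄`, `canon_implications`, `canon_implications₂₈`). [cite: ChiriacJorza2019HeckeComparison, Example 4.7; CalegariGeraghtyHarris2019BlochKato, Thm 1.1; LiZhang2022Tate, Thm 1.4; NemotoYamauchi2025Regulators, §5.2 (bookkeeping proved here)] -/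
theorem hundredthird_holds_top :
    (canon₁₀₃ νtop μtop κtop).CJdensity ∧ (canon₁₀₃ νtop μtop κtop).CGHselmer ∧ (canon₁₀₃ νtop μtop κtop).LZtateII ∧ (canon₁₀₃ νtop μtop κtop).NYregulator :=
  hundredthird_of_leaves (canon_implications₁₀₃ νtop μtop κtop) (canon_implications₆₄ νtop μtop κtop) (canon_implications νtop μtop κtop)
    (canon_implications₂₈ νtop μtop κtop) bookInputs_top

/-- BOOK SIDE, EXACT SUPPORT: in each of the 24 book countermodels (tranches 1 / 64 / 103 read canonically over it, ALL the edges of tranches 1 / 103 valid) ALL FOUR statements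
FAIL — every book leaf is load-bearing, through C9 ⇐ A4 (« A recent result of Boxer, Calegari, Gee, and Pilloni … implies » / « [BCGP21] and its proof » / « by [BCGP] it is
potentially automorphic ») and, for C259, also through C34 (« the modularity lifting results of [CG] and [CG2] »). [cite: ChiriacJorza2019HeckeComparison, Example 4.7; CalegariGeraghtyHarris2019BlochKato, §1, Lemmas 3.3-3.4; LiZhang2022Tate, Lemma 3.4; NemotoYamauchi2025Regulators, §5.2; with BoxerEtAl2021, GeeTaibi2019 Thm 7.4.1, CalegariGeraghty2020Nonregular §1.4 and Arthur2013 §1.5 (bookkeeping proved here)] -/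
theorem c103_book_cm (l : LeafSupport.Leaf) :
    LeafSupport.Systems (LeafSupport.mkN (LeafSupport.cm l)) (LeafSupport.mkW (LeafSupport.cm l)) (LeafSupport.mkG (LeafSupport.cm l)) ∧
      (∀ l', l' ≠ l → (LeafSupport.mkN (LeafSupport.cm l)).leaf l') ∧ ¬ (LeafSupport.mkN (LeafSupport.cm l)).leaf l ∧
      (Implications (LeafSupport.mkN (LeafSupport.cm l)) μtop κtop (canon (LeafSupport.mkN (LeafSupport.cm l)) μtop κtop) ∧
        Implications103 (canon (LeafSupport.mkN (LeafSupport.cm l)) μtop κtop) (canon₆₄ (LeafSupport.mkN (LeafSupport.cm l)) μtop κtop) (canon₁₀₃ (LeafSupport.mkN (LeafSupport.cm l)) μtop κtop)) ∧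
      (¬ (canon₁₀₃ (LeafSupport.mkN (LeafSupport.cm l)) μtop κtop).CJdensity ∧ ¬ (canon₁₀₃ (LeafSupport.mkN (LeafSupport.cm l)) μtop κtop).CGHselmer ∧
        ¬ (canon₁₀₃ (LeafSupport.mkN (LeafSupport.cm l)) μtop κtop).LZtateII ∧ ¬ (canon₁₀₃ (LeafSupport.mkN (LeafSupport.cm l)) μtop κtop).NYregulator) :=
  have cmod := LeafSupport.countermodel l
  have nb := not_B_cm l
  ⟨cmod.1, cmod.2.1, cmod.2.2.1, ⟨canon_implications _ _ _, canon_implications₁₀₃ _ _ _⟩, ⟨fun h => nb h, fun h => nb h.2, fun h => nb h, fun h => nb h⟩⟩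

/-- Row C34 DENIED (`CalegariGeraghtyGSp4 := False`; the other tranche-64 fields as in `canon₆₄` at the top): a reading of `Consumers64` used only to deny Calegari – Geraghty's theorem; no sixty-fourth-tranche edge is claimed for it. [cite: CalegariGeraghty2020Nonregular, Thm 1.1 (separating model; bookkeeping)] -/
abbrev c₆₄noC34 : Consumers64 := { canon₆₄ νtop μtop κtop with CalegariGeraghtyGSp4 := False }

/-- THE PREMISES ARE LOAD-BEARING EXACTLY AS TYPED (reading-level separation at the top): (a) C9 DENIED (section 104's `c₁noC9`; C34 read canonically) ⇒ ALL FOUR FAIL; (b) C34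
DENIED (`c₆₄noC34`; C9 read canonically) ⇒ only C259 FAILS, C258 / C260 / C261 HOLD. [cite: ChiriacJorza2019HeckeComparison, Example 4.7; CalegariGeraghtyHarris2019BlochKato, §1 (« [CG] and [CG2] »), Lemma 3.4 (« Proposition 7.9.8 of [BCGP] »); LiZhang2022Tate, Lemma 3.4; NemotoYamauchi2025Regulators, §5.2 (separating models; bookkeeping proved here)] -/
theorem c103_denied_top :
    (Implications103 c₁noC9 (canon₆₄ νtop μtop κtop) (canon₁₀₃W c₁noC9 (canon₆₄ νtop μtop κtop)) ∧
        ¬ (canon₁₀₃W c₁noC9 (canon₆₄ νtop μtop κtop)).CJdensity ∧ ¬ (canon₁₀₃W c₁noC9 (canon₆₄ νtop μtop κtop)).CGHselmer ∧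
        ¬ (canon₁₀₃W c₁noC9 (canon₆₄ νtop μtop κtop)).LZtateII ∧ ¬ (canon₁₀₃W c₁noC9 (canon₆₄ νtop μtop κtop)).NYregulator) ∧
      (Implications103 (canon νtop μtop κtop) c₆₄noC34 (canon₁₀₃W (canon νtop μtop κtop) c₆₄noC34) ∧
        (canon₁₀₃W (canon νtop μtop κtop) c₆₄noC34).CJdensity ∧ ¬ (canon₁₀₃W (canon νtop μtop κtop) c₆₄noC34).CGHselmer ∧
        (canon₁₀₃W (canon νtop μtop κtop) c₆₄noC34).LZtateII ∧ (canon₁₀₃W (canon νtop μtop κtop) c₆₄noC34).NYregulator) :=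
  have b : ∀ N, νtop.Everything N := bookInputs_top.everything
  ⟨⟨canon_implications₁₀₃W _ _, fun h => h, fun h => h.2, fun h => h, fun h => h⟩, ⟨canon_implications₁₀₃W _ _, b, fun h => h.1, b, b⟩⟩

/-- UNITARY SIDE: in each of Mok's 29 countermodels (KMSW = `κnoMok`) and in each of KMSW's countermodels, the book at the all-ones assignment, ALL FOUR typed statements HOLD
— no statement of Mok 2015 or KMSW occurs in the tranche's edges (C34's premise C191 is Mok's Compositio 2014 paper on GSp₄, a book-side row). [cite: ChiriacJorza2019HeckeComparison, Example 4.7; CalegariGeraghtyHarris2019BlochKato, Thm 1.1; LiZhang2022Tate, Thm 1.4; NemotoYamauchi2025Regulators, §5.2 (bookkeeping proved here)] -/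
theorem c103_unitary_independent (l : Mok2015.LeafSupport.Leaf) (l' : KMSW2014.LeafSupport.Leaf) :
    ((canon₁₀₃ νtop (Mok2015.LeafSupport.mkN (Mok2015.LeafSupport.cm l)) κnoMok).CJdensity ∧ (canon₁₀₃ νtop (Mok2015.LeafSupport.mkN (Mok2015.LeafSupport.cm l)) κnoMok).CGHselmer ∧
        (canon₁₀₃ νtop (Mok2015.LeafSupport.mkN (Mok2015.LeafSupport.cm l)) κnoMok).LZtateII ∧ (canon₁₀₃ νtop (Mok2015.LeafSupport.mkN (Mok2015.LeafSupport.cm l)) κnoMok).NYregulator) ∧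
      ((canon₁₀₃ νtop μtop (KMSW2014.LeafSupport.mkN (KMSW2014.LeafSupport.cm l'))).CJdensity ∧ (canon₁₀₃ νtop μtop (KMSW2014.LeafSupport.mkN (KMSW2014.LeafSupport.cm l'))).CGHselmer ∧
        (canon₁₀₃ νtop μtop (KMSW2014.LeafSupport.mkN (KMSW2014.LeafSupport.cm l'))).LZtateII ∧ (canon₁₀₃ νtop μtop (KMSW2014.LeafSupport.mkN (KMSW2014.LeafSupport.cm l'))).NYregulator) :=
  have b : ∀ N, νtop.Everything N := bookInputs_top.everything
  ⟨⟨b, ⟨⟨b, b, ⟨b, b⟩⟩, b⟩, b, b⟩, ⟨b, ⟨⟨b, b, ⟨b, b⟩⟩, b⟩, b, b⟩⟩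

/-- THE HUNDRED-AND-THIRD TRANCHE REGRADED, in one statement: (i) at the top all four hold; (ii) in the book countermodel of ANY leaf all four fail; (iii) C9 denied: all four
fail; C34 denied: C259 fails, C258 / C260 / C261 hold; (iv) in every Mok / KMSW countermodel all hold.  Supports: book 24 each (through C9 ⇐ A4; C259 also through C34 ⇐ book
∧ A4 ∧ C191); nothing of Mok 2015 or KMSW. [cite: ChiriacJorza2019HeckeComparison, Example 4.7; CalegariGeraghtyHarris2019BlochKato, Thm 1.1; LiZhang2022Tate, Thm 1.4; NemotoYamauchi2025Regulators, §5.2 (bookkeeping proved here)] -/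
theorem c103_regraded :
    ((canon₁₀₃ νtop μtop κtop).CJdensity ∧ (canon₁₀₃ νtop μtop κtop).CGHselmer ∧ (canon₁₀₃ νtop μtop κtop).LZtateII ∧ (canon₁₀₃ νtop μtop κtop).NYregulator) ∧
      (∀ l : LeafSupport.Leaf, ¬ (LeafSupport.mkN (LeafSupport.cm l)).leaf l ∧
        ¬ (canon₁₀₃ (LeafSupport.mkN (LeafSupport.cm l)) μtop κtop).CJdensity ∧ ¬ (canon₁₀₃ (LeafSupport.mkN (LeafSupport.cm l)) μtop κtop).CGHselmer ∧
        ¬ (canon₁₀₃ (LeafSupport.mkN (LeafSupport.cm l)) μtop κtop).LZtateII ∧ ¬ (canon₁₀₃ (LeafSupport.mkN (LeafSupport.cm l)) μtop κtop).NYregulator) ∧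
      (¬ (canon₁₀₃W c₁noC9 (canon₆₄ νtop μtop κtop)).CJdensity ∧ ¬ (canon₁₀₃W c₁noC9 (canon₆₄ νtop μtop κtop)).CGHselmer ∧
        ¬ (canon₁₀₃W (canon νtop μtop κtop) c₆₄noC34).CGHselmer ∧ (canon₁₀₃W (canon νtop μtop κtop) c₆₄noC34).CJdensity ∧
        (canon₁₀₃W (canon νtop μtop κtop) c₆₄noC34).LZtateII ∧ (canon₁₀₃W (canon νtop μtop κtop) c₆₄noC34).NYregulator) ∧
      (∀ (l : Mok2015.LeafSupport.Leaf) (l' : KMSW2014.LeafSupport.Leaf),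
        (canon₁₀₃ νtop (Mok2015.LeafSupport.mkN (Mok2015.LeafSupport.cm l)) κnoMok).CGHselmer ∧ (canon₁₀₃ νtop (Mok2015.LeafSupport.mkN (Mok2015.LeafSupport.cm l)) κnoMok).NYregulator ∧
        (canon₁₀₃ νtop μtop (KMSW2014.LeafSupport.mkN (KMSW2014.LeafSupport.cm l'))).CJdensity ∧ (canon₁₀₃ νtop μtop (KMSW2014.LeafSupport.mkN (KMSW2014.LeafSupport.cm l'))).LZtateII) :=
  have ⟨⟨_, a1, a2, _, _⟩, ⟨_, b1, b2, b3, b4⟩⟩ := c103_denied_top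
  ⟨hundredthird_holds_top,
    fun l => have h := c103_book_cm l
      ⟨h.2.2.1, h.2.2.2.2⟩,
    ⟨a1, a2, b2, b1, b3, b4⟩,
    fun l l' => have h := c103_unitary_independent l l'
      ⟨h.1.2.1, h.1.2.2.2, h.2.1, h.2.2.2.1⟩⟩


/-! ## 107. Hundred-and-fourth tranche (v9 of this file, after NEW `Downstream31.lean` v1 — hence `import …Downstream31`; unit `pub-arthur-down-g40`): supports of NEW rows
C262 `KatsuradaMult1` / `KatsuradaDenom`, C263 `IKKperiod` (⇐ C5 ∧ B1), row C226's new node `FMtempered` (⇐ book) and C264 `PSSsup` (⇐ `FMtempered`) / `PSSbessel` (⇐ C226's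
`FMrefined` ∧ `FMtempered`); see the module docstring for the summary. -/

section Canon104

variable (ν : Nodes) (μ : Mok2015.Nodes) (κ : KMSW2014.Nodes)

/-- The parametrised canonical reading of the hundred-and-fourth tranche: ν and the assignments `c`, `c₈₉` of tranches 1 / 89 are the parameters; C262 (both statements), C263 := C5 ∧ B1; C226's node, C264's Theorem 1.1 := the book at all ranks; C264's Theorem 4.8 := C226's Theorem 1.2 ∧ the book. [cite: Katsurada2021Denominators, Thms 2.2-2.3; IbukiyamaKatsuradaKojima2025IkedaMiyawaki, Thm 3.6; FurusawaMorimoto2024SO5, Cor. 8.1, Thm 1.2; PitaleSahaSchmidt2023Supercuspidal, Thms 1.1, 4.8 (canonical model; bookkeeping)] -/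
abbrev canon₁₀₄W (c : Consumers) (c₈₉ : Consumers89) : Consumers104 where
  KatsuradaMult1 := c.ChenevierLannesStar ∧ c.AMR
  KatsuradaDenom := c.ChenevierLannesStar ∧ c.AMR
  IKKperiod := c.ChenevierLannesStar ∧ c.AMR
  FMtempered := ∀ N, ν.Everything N
  PSSsup := ∀ N, ν.Everything N
  PSSbessel := c₈₉.FMrefined ∧ ∀ N, ν.Everything N

/-- The canonical instance over `canon` and section 89's `canon₈₉W` (Chapter-9 leaf denied, `canon₈no`; tranche 34's `canon₃₄`): there `FMrefined := Mok ∧ C67's value ∧ C24's value`. [cite: Katsurada2021Denominators, Thm 2.2; FurusawaMorimoto2024SO5, Cor. 8.1, Thm 1.2 (canonical model; bookkeeping)] -/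
abbrev canon₁₀₄ : Consumers104 := canon₁₀₄W ν (canon ν μ κ) (canon₈₉W ν μ (canon ν μ κ) (canon₈no ν μ) (canon₃₄ μ κ))

/-- Every hundred-and-fourth-tranche edge holds in the parametrised reading, for EVERY ν and every assignment of tranches 1 / 89. [cite: Katsurada2021Denominators, Thms 2.2-2.3; IbukiyamaKatsuradaKojima2025IkedaMiyawaki, Thm 3.6; FurusawaMorimoto2024SO5, Cor. 8.1; PitaleSahaSchmidt2023Supercuspidal, Thms 1.1, 4.8 (bookkeeping proved here)] -/
theorem canon_implications₁₀₄W (c : Consumers) (c₈₉ : Consumers89) : Implications104 ν c c₈₉ (canon₁₀₄W ν c c₈₉) where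
  kaMult := fun h5 h1 => ⟨h5, h1⟩
  kaDenom := fun m => m
  ikk := fun h1 h5 => ⟨h5, h1⟩
  fm := fun b => b
  pss := fun t => t
  pssB := fun r t => ⟨r, t⟩

/-- Every hundred-and-fourth-tranche edge holds in the canonical instance, for arbitrary ν, μ, κ. [cite: Katsurada2021Denominators, Thm 2.2; FurusawaMorimoto2024SO5, Cor. 8.1 (bookkeeping proved here)] -/
theorem canon_implications₁₀₄ : Implications104 ν (canon ν μ κ) (canon₈₉W ν μ (canon ν μ κ) (canon₈no ν μ) (canon₃₄ μ κ)) (canon₁₀₄ ν μ κ) :=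
  canon_implications₁₀₄W _ _ _

/-- In the parametrised reading all six statements hold as soon as rows C5, B1 hold, the book holds at all ranks and C226's Theorem 1.2 holds. [cite: Katsurada2021Denominators, Thms 2.2-2.3; IbukiyamaKatsuradaKojima2025IkedaMiyawaki, Thm 3.6; FurusawaMorimoto2024SO5, Cor. 8.1, Thm 1.2; PitaleSahaSchmidt2023Supercuspidal, Thms 1.1, 4.8 (bookkeeping proved here)] -/
theorem c104_all_of (c : Consumers) (c₈₉ : Consumers89) (h₅ : c.ChenevierLannesStar) (h₁ : c.AMR) (hν : ∀ N, ν.Everything N) (hR : c₈₉.FMrefined) :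
    (((canon₁₀₄W ν c c₈₉).KatsuradaMult1 ∧ (canon₁₀₄W ν c c₈₉).KatsuradaDenom ∧ (canon₁₀₄W ν c c₈₉).IKKperiod) ∧ ((canon₁₀₄W ν c c₈₉).FMtempered ∧ (canon₁₀₄W ν c c₈₉).PSSsup)) ∧
      (canon₁₀₄W ν c c₈₉).PSSbessel :=
  have X := canon_implications₁₀₄W ν c c₈₉
  ⟨⟨siegelMultOne104_of_rows X h₅ h₁, fmTempered104_of_book X hν⟩, pssBessel_of_rows X hR (X.fm hν)⟩

end Canon104

/-- At the top (every input of the three DAGs; Chapter-9 leaf denied in section 89's reading, which `PSSbessel` does not use) all six statements hold, through the tranche's own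
`hundredfourth_of_inputs` fed by `canon_implications`, section 89's `canon_implications₈₉W` and tranche 34's `canon_implications₃₄`. [cite: Katsurada2021Denominators, Thms 2.2-2.3; IbukiyamaKatsuradaKojima2025IkedaMiyawaki, Thm 3.6; FurusawaMorimoto2024SO5, Cor. 8.1, Thm 1.2; PitaleSahaSchmidt2023Supercuspidal, Thms 1.1, 4.8 (bookkeeping proved here)] [claim: KalethaMinguezShinWhite2014, under-review] -/
theorem hundredfourth_holds_top :
    (((canon₁₀₄ νtop μtop κtop).KatsuradaMult1 ∧ (canon₁₀₄ νtop μtop κtop).KatsuradaDenom ∧ (canon₁₀₄ νtop μtop κtop).IKKperiod) ∧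
        ((canon₁₀₄ νtop μtop κtop).FMtempered ∧ (canon₁₀₄ νtop μtop κtop).PSSsup)) ∧ (canon₁₀₄ νtop μtop κtop).PSSbessel :=
  hundredfourth_of_inputs (canon_implications₁₀₄ νtop μtop κtop) (canon_implications νtop μtop κtop)
    (canon_implications₈₉W νtop μtop (canon νtop μtop κtop) (canon₈no νtop μtop) (canon₃₄ μtop κtop)) (canon_implications₃₄ νtop μtop κtop)
    bookInputs_top mokInputs_top (kmswInputs_top μtop).1

/-- BOOK SIDE, EXACT SUPPORT: in each of the 24 book countermodels (Mok and KMSW at the top; tranches 1 / 89 / 104 read canonically over it, ALL the edges of tranches 1 / 104 valid)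
ALL SIX statements FAIL — every book leaf is load-bearing, through C5 / B1 (« Chenevier-Lannes … Corollary 8.5.4 », « [Arancibia-Moeglin-Renard18] », « (cf. [2],[7]) ») for C262 /
C263, by name (« Arthur [3] ») for C226's node and, through it, for both C264 statements. [cite: Katsurada2021Denominators, proof of Thm 2.2; IbukiyamaKatsuradaKojima2025IkedaMiyawaki, Remark 2.1; FurusawaMorimoto2024SO5, proofs of Cor. 8.1 / Prop. 8.1; PitaleSahaSchmidt2023Supercuspidal, §4.3, proof of Thm 4.8; with ChenevierLannes2019, ArancibiaMoeglinRenard2015 and Arthur2013 §1.5 (bookkeeping proved here)] -/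
theorem c104_book_cm (l : LeafSupport.Leaf) :
    LeafSupport.Systems (LeafSupport.mkN (LeafSupport.cm l)) (LeafSupport.mkW (LeafSupport.cm l)) (LeafSupport.mkG (LeafSupport.cm l)) ∧
      (∀ l', l' ≠ l → (LeafSupport.mkN (LeafSupport.cm l)).leaf l') ∧ ¬ (LeafSupport.mkN (LeafSupport.cm l)).leaf l ∧
      (Implications (LeafSupport.mkN (LeafSupport.cm l)) μtop κtop (canon (LeafSupport.mkN (LeafSupport.cm l)) μtop κtop) ∧
        Implications104 (LeafSupport.mkN (LeafSupport.cm l)) (canon (LeafSupport.mkN (LeafSupport.cm l)) μtop κtop)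
          (canon₈₉W (LeafSupport.mkN (LeafSupport.cm l)) μtop (canon (LeafSupport.mkN (LeafSupport.cm l)) μtop κtop) (canon₈no (LeafSupport.mkN (LeafSupport.cm l)) μtop) (canon₃₄ μtop κtop))
          (canon₁₀₄ (LeafSupport.mkN (LeafSupport.cm l)) μtop κtop)) ∧
      (¬ (canon₁₀₄ (LeafSupport.mkN (LeafSupport.cm l)) μtop κtop).KatsuradaMult1 ∧ ¬ (canon₁₀₄ (LeafSupport.mkN (LeafSupport.cm l)) μtop κtop).KatsuradaDenom ∧
        ¬ (canon₁₀₄ (LeafSupport.mkN (LeafSupport.cm l)) μtop κtop).IKKperiod ∧ ¬ (canon₁₀₄ (LeafSupport.mkN (LeafSupport.cm l)) μtop κtop).FMtempered ∧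
        ¬ (canon₁₀₄ (LeafSupport.mkN (LeafSupport.cm l)) μtop κtop).PSSsup ∧ ¬ (canon₁₀₄ (LeafSupport.mkN (LeafSupport.cm l)) μtop κtop).PSSbessel) :=
  have cmod := LeafSupport.countermodel l
  have nb := not_B_cm l
  ⟨cmod.1, cmod.2.1, cmod.2.2.1, ⟨canon_implications _ _ _, canon_implications₁₀₄ _ _ _⟩,
    ⟨fun h => nb h.1, fun h => nb h.1, fun h => nb h.1, fun h => nb h, fun h => nb h, fun h => nb h.2⟩⟩

/-- Row C5 DENIED (`ChenevierLannesStar := False`; the other tranche-1 fields as in `canon` at the top): a reading of `Consumers` used only to deny Chenevier – Lannes's starred statements; no first-tranche edge is claimed for it. [cite: ChenevierLannes2019, starred statements (separating model; bookkeeping)] -/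
abbrev c₁noC5 : Consumers := { canon νtop μtop κtop with ChenevierLannesStar := False }

/-- THE PREMISES ARE LOAD-BEARING EXACTLY AS TYPED (reading-level separation at the top; `c₈₉` read canonically): (a) C5 DENIED (`c₁noC5`) ⇒ C262 (both) and C263 FAIL, C226's
node and both C264 statements HOLD; (b) B1 DENIED (section 98's `c₁noB1`) ⇒ the same pattern.  The book-by-name premise of `FMtempered` is the top itself and is separated only
by the countermodels (`c104_book_cm`). [cite: Katsurada2021Denominators, proof of Thm 2.2; IbukiyamaKatsuradaKojima2025IkedaMiyawaki, Remark 2.1 (« (cf. [2],[7]) »); FurusawaMorimoto2024SO5, Cor. 8.1; PitaleSahaSchmidt2023Supercuspidal, Thms 1.1, 4.8 (separating models; bookkeeping proved here)] -/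
theorem c104_denied_top :
    (Implications104 νtop c₁noC5 (canon₈₉W νtop μtop (canon νtop μtop κtop) (canon₈no νtop μtop) (canon₃₄ μtop κtop)) (canon₁₀₄W νtop c₁noC5 (canon₈₉W νtop μtop (canon νtop μtop κtop) (canon₈no νtop μtop) (canon₃₄ μtop κtop))) ∧
        ¬ (canon₁₀₄W νtop c₁noC5 (canon₈₉W νtop μtop (canon νtop μtop κtop) (canon₈no νtop μtop) (canon₃₄ μtop κtop))).KatsuradaMult1 ∧
        ¬ (canon₁₀₄W νtop c₁noC5 (canon₈₉W νtop μtop (canon νtop μtop κtop) (canon₈no νtop μtop) (canon₃₄ μtop κtop))).KatsuradaDenom ∧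
        ¬ (canon₁₀₄W νtop c₁noC5 (canon₈₉W νtop μtop (canon νtop μtop κtop) (canon₈no νtop μtop) (canon₃₄ μtop κtop))).IKKperiod ∧
        (canon₁₀₄W νtop c₁noC5 (canon₈₉W νtop μtop (canon νtop μtop κtop) (canon₈no νtop μtop) (canon₃₄ μtop κtop))).FMtempered ∧
        (canon₁₀₄W νtop c₁noC5 (canon₈₉W νtop μtop (canon νtop μtop κtop) (canon₈no νtop μtop) (canon₃₄ μtop κtop))).PSSsup ∧
        (canon₁₀₄W νtop c₁noC5 (canon₈₉W νtop μtop (canon νtop μtop κtop) (canon₈no νtop μtop) (canon₃₄ μtop κtop))).PSSbessel) ∧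
      (Implications104 νtop c₁noB1 (canon₈₉W νtop μtop (canon νtop μtop κtop) (canon₈no νtop μtop) (canon₃₄ μtop κtop)) (canon₁₀₄W νtop c₁noB1 (canon₈₉W νtop μtop (canon νtop μtop κtop) (canon₈no νtop μtop) (canon₃₄ μtop κtop))) ∧
        ¬ (canon₁₀₄W νtop c₁noB1 (canon₈₉W νtop μtop (canon νtop μtop κtop) (canon₈no νtop μtop) (canon₃₄ μtop κtop))).KatsuradaMult1 ∧
        ¬ (canon₁₀₄W νtop c₁noB1 (canon₈₉W νtop μtop (canon νtop μtop κtop) (canon₈no νtop μtop) (canon₃₄ μtop κtop))).KatsuradaDenom ∧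
        ¬ (canon₁₀₄W νtop c₁noB1 (canon₈₉W νtop μtop (canon νtop μtop κtop) (canon₈no νtop μtop) (canon₃₄ μtop κtop))).IKKperiod ∧
        (canon₁₀₄W νtop c₁noB1 (canon₈₉W νtop μtop (canon νtop μtop κtop) (canon₈no νtop μtop) (canon₃₄ μtop κtop))).FMtempered ∧
        (canon₁₀₄W νtop c₁noB1 (canon₈₉W νtop μtop (canon νtop μtop κtop) (canon₈no νtop μtop) (canon₃₄ μtop κtop))).PSSsup ∧
        (canon₁₀₄W νtop c₁noB1 (canon₈₉W νtop μtop (canon νtop μtop κtop) (canon₈no νtop μtop) (canon₃₄ μtop κtop))).PSSbessel) :=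
  have b : ∀ N, νtop.Everything N := bookInputs_top.everything
  have m : ∀ N, μtop.Everything N := mokInputs_top.everything
  have s : ∀ N, κtop.Scope N := (kmswInputs_top μtop).1.scope mokInputs_top
  have r : (∀ N, μtop.Everything N) ∧ (canon₃₄ μtop κtop).FurusawaMorimoto ∧ (canon₃₄ μtop κtop).BPlocalGGP := ⟨m, ⟨m, s, ⟨m, s⟩⟩, ⟨m, s⟩⟩
  ⟨⟨canon_implications₁₀₄W _ _ _, fun h => h.1, fun h => h.1, fun h => h.1, b, b, ⟨r, b⟩⟩, ⟨canon_implications₁₀₄W _ _ _, fun h => h.2, fun h => h.2, fun h => h.2, b, b, ⟨r, b⟩⟩⟩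

/-- MOK SIDE: in the Mok countermodel of ANY leaf `l` (book and KMSW at the top; tranches 1 / 89 / 104 read over it) every hundred-and-fourth edge holds, the five book-side
statements HOLD and C264's Theorem 4.8 FAILS — through C226's Theorem 1.2 (« by Mok [82] », row C67, row C24). [cite: PitaleSahaSchmidt2023Supercuspidal, proof of Thm 4.8 (« Theorem 1.2 of [12] »); FurusawaMorimoto2024SO5, §7; Mok2012, Thm 2.5.2 (bookkeeping proved here)] -/
theorem c104_mok_cm (l : Mok2015.LeafSupport.Leaf) :
    ¬ (Mok2015.LeafSupport.mkN (Mok2015.LeafSupport.cm l)).leaf l ∧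
      Implications104 νtop (canon νtop (Mok2015.LeafSupport.mkN (Mok2015.LeafSupport.cm l)) κtop)
        (canon₈₉W νtop (Mok2015.LeafSupport.mkN (Mok2015.LeafSupport.cm l)) (canon νtop (Mok2015.LeafSupport.mkN (Mok2015.LeafSupport.cm l)) κtop) (canon₈no νtop (Mok2015.LeafSupport.mkN (Mok2015.LeafSupport.cm l))) (canon₃₄ (Mok2015.LeafSupport.mkN (Mok2015.LeafSupport.cm l)) κtop))
        (canon₁₀₄ νtop (Mok2015.LeafSupport.mkN (Mok2015.LeafSupport.cm l)) κtop) ∧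
      ((canon₁₀₄ νtop (Mok2015.LeafSupport.mkN (Mok2015.LeafSupport.cm l)) κtop).KatsuradaMult1 ∧ (canon₁₀₄ νtop (Mok2015.LeafSupport.mkN (Mok2015.LeafSupport.cm l)) κtop).KatsuradaDenom ∧
        (canon₁₀₄ νtop (Mok2015.LeafSupport.mkN (Mok2015.LeafSupport.cm l)) κtop).IKKperiod ∧ (canon₁₀₄ νtop (Mok2015.LeafSupport.mkN (Mok2015.LeafSupport.cm l)) κtop).FMtempered ∧
        (canon₁₀₄ νtop (Mok2015.LeafSupport.mkN (Mok2015.LeafSupport.cm l)) κtop).PSSsup) ∧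
      ¬ (canon₁₀₄ νtop (Mok2015.LeafSupport.mkN (Mok2015.LeafSupport.cm l)) κtop).PSSbessel :=
  have cmod := Mok2015.LeafSupport.countermodel l
  have nm := not_M_cm l
  have b : ∀ N, νtop.Everything N := bookInputs_top.everything
  ⟨cmod.2.2.1, canon_implications₁₀₄W _ _ _, ⟨⟨b, b⟩, ⟨b, b⟩, ⟨b, b⟩, b, b⟩, fun h => nm h.1.1⟩

/-- KMSW SIDE, I: with the book and Mok at the top and KMSW's Mok import DENIED (`κnoMok`: KMSW's proved scope fails at every rank) every edge holds, the five book-side statements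
HOLD and C264's Theorem 4.8 FAILS — through C226's Theorem 1.2 ⇐ rows C67 / C24, which read the unitary classifications « [KMSW, Mok] ».  II: in each of KMSW's leaf countermodels
(book and Mok at the top) the five book-side statements HOLD. [cite: PitaleSahaSchmidt2023Supercuspidal, proof of Thm 4.8; FurusawaMorimoto2024SO5, §7; FurusawaMorimoto2024, §1.2; BeuzartPlessis2020Asterisque, Thm 1 (bookkeeping proved here)] [claim: KalethaMinguezShinWhite2014, under-review] -/
theorem c104_kmsw (l' : KMSW2014.LeafSupport.Leaf) :
    ((∀ N, ¬ κnoMok.Scope N) ∧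
        Implications104 νtop (canon νtop μtop κnoMok) (canon₈₉W νtop μtop (canon νtop μtop κnoMok) (canon₈no νtop μtop) (canon₃₄ μtop κnoMok)) (canon₁₀₄ νtop μtop κnoMok) ∧
        ((canon₁₀₄ νtop μtop κnoMok).KatsuradaMult1 ∧ (canon₁₀₄ νtop μtop κnoMok).IKKperiod ∧ (canon₁₀₄ νtop μtop κnoMok).FMtempered ∧ (canon₁₀₄ νtop μtop κnoMok).PSSsup) ∧
        ¬ (canon₁₀₄ νtop μtop κnoMok).PSSbessel) ∧
      ((canon₁₀₄ νtop μtop (KMSW2014.LeafSupport.mkN (KMSW2014.LeafSupport.cm l'))).KatsuradaMult1 ∧ (canon₁₀₄ νtop μtop (KMSW2014.LeafSupport.mkN (KMSW2014.LeafSupport.cm l'))).KatsuradaDenom ∧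
        (canon₁₀₄ νtop μtop (KMSW2014.LeafSupport.mkN (KMSW2014.LeafSupport.cm l'))).IKKperiod ∧ (canon₁₀₄ νtop μtop (KMSW2014.LeafSupport.mkN (KMSW2014.LeafSupport.cm l'))).FMtempered ∧
        (canon₁₀₄ νtop μtop (KMSW2014.LeafSupport.mkN (KMSW2014.LeafSupport.cm l'))).PSSsup) :=
  have ns : ∀ N, ¬ κnoMok.Scope N := κnoMok_facts.2.2.2.2.2.1
  have b : ∀ N, νtop.Everything N := bookInputs_top.everything
  ⟨⟨ns, canon_implications₁₀₄W _ _ _, ⟨⟨b, b⟩, ⟨b, b⟩, b, b⟩, fun h => ns 0 (h.1.2.2.2 0)⟩, ⟨⟨b, b⟩, ⟨b, b⟩, ⟨b, b⟩, b, b⟩⟩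

/-- THE HUNDRED-AND-FOURTH TRANCHE REGRADED, in one statement: (i) at the top all six hold; (ii) in the book countermodel of ANY leaf all six fail; (iii) C5 denied or B1 denied:
C262 (both) and C263 fail, C226's node and both C264 statements hold; (iv) in every Mok countermodel the five book-side statements hold and C264's Theorem 4.8 fails; (v) with
KMSW's Mok import denied the same; in KMSW's leaf countermodels the five hold.  Supports: book 24 for all six (through C5 / B1; by name); Mok 29 and KMSW's import for
`PSSbessel` only (through C226's Theorem 1.2). [cite: Katsurada2021Denominators, Thms 2.2-2.3; IbukiyamaKatsuradaKojima2025IkedaMiyawaki, Thm 3.6; FurusawaMorimoto2024SO5, Cor. 8.1, Thm 1.2; PitaleSahaSchmidt2023Supercuspidal, Thms 1.1, 4.8 (bookkeeping proved here)] [claim: KalethaMinguezShinWhite2014, under-review] -/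
theorem c104_regraded :
    ((((canon₁₀₄ νtop μtop κtop).KatsuradaMult1 ∧ (canon₁₀₄ νtop μtop κtop).KatsuradaDenom ∧ (canon₁₀₄ νtop μtop κtop).IKKperiod) ∧
        ((canon₁₀₄ νtop μtop κtop).FMtempered ∧ (canon₁₀₄ νtop μtop κtop).PSSsup)) ∧ (canon₁₀₄ νtop μtop κtop).PSSbessel) ∧
      (∀ l : LeafSupport.Leaf, ¬ (LeafSupport.mkN (LeafSupport.cm l)).leaf l ∧
        ¬ (canon₁₀₄ (LeafSupport.mkN (LeafSupport.cm l)) μtop κtop).KatsuradaMult1 ∧ ¬ (canon₁₀₄ (LeafSupport.mkN (LeafSupport.cm l)) μtop κtop).IKKperiod ∧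
        ¬ (canon₁₀₄ (LeafSupport.mkN (LeafSupport.cm l)) μtop κtop).FMtempered ∧ ¬ (canon₁₀₄ (LeafSupport.mkN (LeafSupport.cm l)) μtop κtop).PSSsup ∧
        ¬ (canon₁₀₄ (LeafSupport.mkN (LeafSupport.cm l)) μtop κtop).PSSbessel) ∧
      (¬ (canon₁₀₄W νtop c₁noC5 (canon₈₉W νtop μtop (canon νtop μtop κtop) (canon₈no νtop μtop) (canon₃₄ μtop κtop))).KatsuradaMult1 ∧
        ¬ (canon₁₀₄W νtop c₁noC5 (canon₈₉W νtop μtop (canon νtop μtop κtop) (canon₈no νtop μtop) (canon₃₄ μtop κtop))).IKKperiod ∧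
        (canon₁₀₄W νtop c₁noC5 (canon₈₉W νtop μtop (canon νtop μtop κtop) (canon₈no νtop μtop) (canon₃₄ μtop κtop))).PSSbessel ∧
        ¬ (canon₁₀₄W νtop c₁noB1 (canon₈₉W νtop μtop (canon νtop μtop κtop) (canon₈no νtop μtop) (canon₃₄ μtop κtop))).KatsuradaDenom ∧
        ¬ (canon₁₀₄W νtop c₁noB1 (canon₈₉W νtop μtop (canon νtop μtop κtop) (canon₈no νtop μtop) (canon₃₄ μtop κtop))).IKKperiod ∧
        (canon₁₀₄W νtop c₁noB1 (canon₈₉W νtop μtop (canon νtop μtop κtop) (canon₈no νtop μtop) (canon₃₄ μtop κtop))).FMtempered) ∧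
      (∀ l : Mok2015.LeafSupport.Leaf, ¬ (Mok2015.LeafSupport.mkN (Mok2015.LeafSupport.cm l)).leaf l ∧
        (canon₁₀₄ νtop (Mok2015.LeafSupport.mkN (Mok2015.LeafSupport.cm l)) κtop).IKKperiod ∧ (canon₁₀₄ νtop (Mok2015.LeafSupport.mkN (Mok2015.LeafSupport.cm l)) κtop).PSSsup ∧
        ¬ (canon₁₀₄ νtop (Mok2015.LeafSupport.mkN (Mok2015.LeafSupport.cm l)) κtop).PSSbessel) ∧
      ((∀ N, ¬ κnoMok.Scope N) ∧ (canon₁₀₄ νtop μtop κnoMok).FMtempered ∧ ¬ (canon₁₀₄ νtop μtop κnoMok).PSSbessel ∧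
        ∀ l' : KMSW2014.LeafSupport.Leaf, (canon₁₀₄ νtop μtop (KMSW2014.LeafSupport.mkN (KMSW2014.LeafSupport.cm l'))).KatsuradaMult1 ∧
          (canon₁₀₄ νtop μtop (KMSW2014.LeafSupport.mkN (KMSW2014.LeafSupport.cm l'))).PSSsup) :=
  have ⟨⟨_, a1, _, a3, _, _, a6⟩, ⟨_, _, b2, b3, b4, _, _⟩⟩ := c104_denied_top
  have k := c104_kmsw .MokMain
  ⟨hundredfourth_holds_top,
    fun l => have h := c104_book_cm l
      ⟨h.2.2.1, h.2.2.2.2.1, h.2.2.2.2.2.2.1, h.2.2.2.2.2.2.2.1, h.2.2.2.2.2.2.2.2.1, h.2.2.2.2.2.2.2.2.2⟩,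
    ⟨a1, a3, a6, b2, b3, b4⟩,
    fun l => have h := c104_mok_cm l
      ⟨h.1, h.2.2.1.2.2.1, h.2.2.1.2.2.2.2, h.2.2.2⟩,
    ⟨k.1.1, k.1.2.2.1.2.2.1, k.1.2.2.2, fun l' => have h := c104_kmsw l'
      ⟨h.2.1, h.2.2.2.2.2⟩⟩⟩

end Support

end Downstream

end Literature.NumberTheory.Automorphic.Arthur2013
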